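import Literature.Analysis.FluidPDE.SelfSimilarEulerLpExclusionHolds
import HarnessLib

/-!
# Chae–Shvydkoy 2013, Corollary 3.4 for every `3 ≤ p < ∞`: the energy growth
`∫_{|y|<L}|U|² ≲ L^{3−2α}` in the window `3/p < α ≤ 3/2`, and the discharge
`chaeShvydkoy2013_energy_growth_holds`

Analysis/FluidPDE proof file (theorems only; no definitions, no named facts, no `sorry`): the
DISCHARGE of the NAMED FACT `chaeShvydkoy2013_energy_growth` (`SelfSimilarEulerLpExclusion.lean`) —

* D. Chae, R. Shvydkoy, *On formation of a locally self-similar collapse in the incompressible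
  Euler equations*, Arch. Ration. Mech. Anal. **209** (2013) 999–1017 = arXiv:1201.6009
  [ChaeShvydkoy2013], **Corollary 3.4** (`N = 3`, `C²` profiles, `3 ≤ p < ∞`): in the window
  `N/p < α ≤ N/2` a stationary self-similar Euler profile with `U ∈ L^p`, associated pressure
  `P ∈ L^{p/2}`, has `∫_{|y|≤L}|v|² ≲ L^{N−2α}` for all large `L` (display (3.20) = (1.3)) —

following the printed proof (§3.2.2–§3.2.3): the two-scale inequality with the inner scale FIXED
(`l₁ = 2`) and the outer scale `l₂ = 2L` large,
`(1/l₂^{N−2α})∫_{|y|≤l₂/2}|v|² ≲ (1/l₁^{N−2α})∫_{|y|≤l₁}|v|² + ∫_{l₁/2≤|y|≤l₂}(|v|³+|q||v|)|y|^{2α−N−1}`,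
then the bootstrap of Theorem 3.2 (§3.2.1, tree file `SelfSimilarEulerLpExclusionHolds.lean`) run
towards the exponent `N − 2α`, "There is only one place of the argument which needs extra attention.
That is if at some point we run into the logarithmic bound … Then for any `ε > 0` we have
`∫_{|y|≤L}|v|² ≲ L^{N−2α+ε}`" (§3.2.3).

1. `IsSelfSimilarEulerProfile.annular_energy_le_weightedFlux_core` — the annular form of the
   two-scale inequality with a WEIGHTED LOCAL flux (the `p = 3` tree version
   `annular_energy_le_of_window` bounds the flux by its global integral, which is not available for
   `p > 3`): for `β = 3/2 − α ≥ 0` and `L ≥ 4`,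
   `∫_{L/4≤|y|≤L/2}|U|² ≤ 8L^{3−2α}[K₁E₁ + (1+α)((4K₂ + 2^{β+2}/L²)F₁ + 2β J₁(L) + (4/L²) J₂(L))]`,
   `J₁(L) = ∫_{1≤|y|≤L}|y|^{−2β−1} f`, `J₂(L) = ∫_{1≤|y|≤L}|y|^{1−2β} f`, `f = |U|³ + 2|P||U|`, with
   the same radial test `Φ₁Φ₂` as the tree's `p = 3` proof (inner profile `ψ_β`, polynomial outer
   cut `((1 − t/L²)₊)²`; private packages re-derived verbatim) and an abstract inner profile so
   that `Φ₁ ≡ 1` (`K₁ = K₂ = 0`) serves the endpoint `β = 0` (`α = 3/2`), where the bound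
   DECAYS like `L^{−2}(F₁ + J₂(L))`;
2. `IsSelfSimilarEulerProfile.annular_energy_le_weightedFlux` — the unified form
   `≤ A[β L^{3−2α}(1 + J₁(L)) + L^{1−2α}(1 + J₂(L))]`;
3. dyadic shell sums of `J₁`, `J₂` under a local flux growth `∫_{|y|≤ρ} f ≤ C ρ^b`
   (`setIntegral_shells_le`, geometric sums with an `ε`-shift absorbing CS13's logarithm), and
   the two ROUNDS: `energyGrowth_window_final` (`b − 1 < 3 − 2α` gives the target `L^{3−2α}`,
   including `U ∈ L²` at `α = 3/2`) and `energyGrowth_window_step` (`b − 1 ≥ 3 − 2α` gives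
   `L^{b − 1/2}`);
4. `IsSelfSimilarEulerProfile.energyGrowth_of_memLp_of_window` — finitely many rounds from the
   Hölder flux bound `b₀ = 3 − 9/p` (the flux lemma `setIntegral_flux_le_of_growth` of the
   Theorem 3.2 file turns `L^{a}` energy growth into `L^{α_p a}` flux growth), for every
   `3 ≤ p < ∞` and `3/p < α ≤ 3/2`; and **`chaeShvydkoy2013_energy_growth_holds`**.

## Mathlib / tree search

Reused: `IsSelfSimilarEulerProfile.localEnergy_identity_radial` (`SelfSimilarEulerL3Exclusion`),
`setIntegral_flux_le_of_growth` (`SelfSimilarEulerLpExclusionHolds`), `memLp_flux_of_memLp`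
(`SelfSimilarEulerLpTwoScale`), `Calculus.exists_bound_deriv_smoothTransition`,
`Calculus.deriv_smoothTransition_of_nonpos/of_one_le` (`Calculus/SmoothCutoff`); Mathlib
`integral_mul_le_Lp_mul_Lq_of_nonneg`, `geom_sum_eq`, `exists_nat_pow_near`, `Nat.find`.
The private cut-off packages of `SelfSimilarEulerL3Exclusion.lean` (`ψ_β` lemmas,
`exists_innerCut₂`, `exists_polyCut`, `window_Q1`) are private there and re-derived verbatim here.
No new definitions, no instances, no notation.
-/

noncomputable section

open MeasureTheory Set Filter Topology Metric InnerProductSpace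
open scoped RealInnerProductSpace ENNReal NNReal Laplacian

namespace Literature.Analysis.FluidPDE



/-! ## The inner profile `ψ_β(s) = 1 + smoothTransition (s − 1) · ((s/2)^{−β} − 1)` (range `α ≤ 1`)

`ψ_β = 1` on `s ≤ 1`, `ψ_β(s) = (s/2)^{−β}` for `s ≥ 2`, and `s^β ψ_β(s)` is nondecreasing:
`β ψ_β(s) + s ψ_β'(s) ≥ 0`. With `β = 3/2 − α > 0` and `Φ₁(t) = ψ_β(t/l₁²)` this is Chae–Shvydkoy's
integrated family of cut-offs `∫ l^{2α−4} σ(y/l) dl` (§3.2.1) collapsed into one test function. -/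

/-- `ψ_β = 1` on `s ≤ 1`. [folklore] -/
private theorem inner_eq_one {β s : ℝ} (hs : s ≤ 1) :
    1 + Real.smoothTransition (s - 1) * ((s / 2) ^ (-β) - 1) = 1 := by
  rw [Real.smoothTransition.zero_of_nonpos (by linarith), zero_mul, add_zero]

/-- Auxiliary computation. [folklore] -/
private theorem inner_eq_rpow {β s : ℝ} (hs : 2 ≤ s) :
    1 + Real.smoothTransition (s - 1) * ((s / 2) ^ (-β) - 1) = (s / 2) ^ (-β) := by
  rw [Real.smoothTransition.one_of_one_le (by linarith), one_mul, add_sub_cancel]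

/-- `ψ_β = (1 − T) + T g` with `T ∈ [0,1]`, `g > 0`: hence `ψ_β ≥ 0` (for `s > 0`). [folklore] -/
private theorem inner_nonneg {β s : ℝ} (hs : 0 < s) :
    0 ≤ 1 + Real.smoothTransition (s - 1) * ((s / 2) ^ (-β) - 1) := by
  have hT0 := Real.smoothTransition.nonneg (s - 1)
  have hT1 := Real.smoothTransition.le_one (s - 1)
  have hg : 0 < (s / 2) ^ (-β) := Real.rpow_pos_of_pos (by positivity) _
  have h1 : 0 ≤ Real.smoothTransition (s - 1) * (s / 2) ^ (-β) := mul_nonneg hT0 hg.le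
  nlinarith

/-- For `s ≥ 2` (and `β ≥ 0`), `ψ_β(s) = (s/2)^{−β} ≤ 1`. [folklore] -/
private theorem inner_le_one {β s : ℝ} (hβ : 0 ≤ β) (hs : 2 ≤ s) :
    1 + Real.smoothTransition (s - 1) * ((s / 2) ^ (-β) - 1) ≤ 1 := by
  rw [inner_eq_rpow hs]
  exact Real.rpow_le_one_of_one_le_of_nonpos (by linarith) (by linarith)

/-- The derivative of `ψ_β` at `s > 0`. [folklore] -/
private theorem inner_hasDerivAt {β s : ℝ} (hs : 0 < s) :
    HasDerivAt (fun s : ℝ => 1 + Real.smoothTransition (s - 1) * ((s / 2) ^ (-β) - 1))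
      (deriv Real.smoothTransition (s - 1) * ((s / 2) ^ (-β) - 1) +
        Real.smoothTransition (s - 1) * (1 / 2 * (-β) * (s / 2) ^ (-β - 1))) s := by
  have hT : HasDerivAt (fun s : ℝ => Real.smoothTransition (s - 1))
      (deriv Real.smoothTransition (s - 1)) s := by
    have h2 := (Calculus.differentiable_smoothTransition (s - 1)).hasDerivAt.comp s
      ((hasDerivAt_id s).sub_const 1)
    simpa [Function.comp_def] using h2
  have hg : HasDerivAt (fun s : ℝ => (s / 2) ^ (-β)) (1 / 2 * (-β) * (s / 2) ^ (-β - 1)) s := by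
    have h1 : HasDerivAt (fun s : ℝ => s / 2) (1 / 2) s := by
      simpa using (hasDerivAt_id s).div_const 2
    exact h1.rpow_const (Or.inl (by positivity))
  simpa using (hT.mul (hg.sub_const 1)).const_add 1

/-- The derivative of `ψ_β` vanishes on `s < 1` (there `ψ_β ≡ 1`). [folklore] -/
private theorem inner_hasDerivAt_zero {β s : ℝ} (hs : s < 1) :
    HasDerivAt (fun s : ℝ => 1 + Real.smoothTransition (s - 1) * ((s / 2) ^ (-β) - 1)) 0 s := by
  have hev : (fun s : ℝ => 1 + Real.smoothTransition (s - 1) * ((s / 2) ^ (-β) - 1)) =ᶠ[𝓝 s]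
      fun _ => (1 : ℝ) := by
    filter_upwards [Iio_mem_nhds hs] with r hr using inner_eq_one hr.le
  exact (hasDerivAt_const s (1 : ℝ)).congr_of_eventuallyEq hev

/-- The derivative of `ψ_β`, as a closed formula valid at every point (the formula vanishes
identically on `s ≤ 1`). [folklore] -/
private theorem inner_deriv (β s : ℝ) :
    deriv (fun s : ℝ => 1 + Real.smoothTransition (s - 1) * ((s / 2) ^ (-β) - 1)) s =
      deriv Real.smoothTransition (s - 1) * ((s / 2) ^ (-β) - 1) +
        Real.smoothTransition (s - 1) * (1 / 2 * (-β) * (s / 2) ^ (-β - 1)) := by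
  by_cases hs : 0 < s
  · exact (inner_hasDerivAt hs).deriv
  · push Not at hs
    rw [(inner_hasDerivAt_zero (by linarith : s < 1)).deriv,
      Calculus.deriv_smoothTransition_of_nonpos (by linarith),
      Real.smoothTransition.zero_of_nonpos (by linarith)]
    ring

/-- Auxiliary computation. [folklore] -/
private theorem inner_deriv_eq_zero {β s : ℝ} (hs : s ≤ 1) :
    deriv (fun s : ℝ => 1 + Real.smoothTransition (s - 1) * ((s / 2) ^ (-β) - 1)) s = 0 := by
  rw [inner_deriv, Calculus.deriv_smoothTransition_of_nonpos (by linarith),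
    Real.smoothTransition.zero_of_nonpos (by linarith)]
  ring

/-- Auxiliary computation. [folklore] -/
private theorem inner_contDiff (β : ℝ) :
    ContDiff ℝ 1 fun s : ℝ => 1 + Real.smoothTransition (s - 1) * ((s / 2) ^ (-β) - 1) := by
  refine contDiff_iff_contDiffAt.2 fun s => ?_
  by_cases hs : s < 1
  · have hev : (fun s : ℝ => 1 + Real.smoothTransition (s - 1) * ((s / 2) ^ (-β) - 1)) =ᶠ[𝓝 s]
        fun _ => (1 : ℝ) := by
      filter_upwards [Iio_mem_nhds hs] with r hr using inner_eq_one hr.le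
    exact contDiffAt_const.congr_of_eventuallyEq hev
  · push Not at hs
    have hT : ContDiffAt ℝ 1 (fun s : ℝ => Real.smoothTransition (s - 1)) s :=
      Real.smoothTransition.contDiffAt.comp s (contDiffAt_id.sub contDiffAt_const)
    have hg : ContDiffAt ℝ 1 (fun s : ℝ => (s / 2) ^ (-β)) s :=
      (contDiffAt_id.div_const 2).rpow_const_of_ne (by positivity)
    exact contDiffAt_const.add (hT.mul (hg.sub contDiffAt_const))

/-- **Monotonicity of `s^β ψ_β`**: `β ψ_β(s) + s ψ_β'(s) ≥ 0` (`β ≥ 0`). [folklore] -/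
private theorem inner_sign {β : ℝ} (hβ : 0 ≤ β) (s : ℝ) :
    0 ≤ β * (1 + Real.smoothTransition (s - 1) * ((s / 2) ^ (-β) - 1)) +
      s * deriv (fun s : ℝ => 1 + Real.smoothTransition (s - 1) * ((s / 2) ^ (-β) - 1)) s := by
  by_cases hs : s ≤ 1
  · rw [inner_eq_one hs, inner_deriv_eq_zero hs]
    nlinarith
  · push Not at hs
    have hs0 : 0 < s := by linarith
    rw [inner_deriv]
    set T := Real.smoothTransition (s - 1) with hT_def
    set T' := deriv Real.smoothTransition (s - 1) with hT'_def
    set g := (s / 2) ^ (-β) with hg_def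
    have hsg : s * (1 / 2 * (-β) * (s / 2) ^ (-β - 1)) = -β * g := by
      have hne : (s / 2 : ℝ) ≠ 0 := by positivity
      have : (s / 2) ^ (-β) = (s / 2) ^ (-β - 1) * (s / 2) := by
        rw [← Real.rpow_add_one hne]
        ring_nf
      rw [hg_def, this]
      ring
    have hT1 : T ≤ 1 := Real.smoothTransition.le_one _
    have hT'0 : 0 ≤ T' := Real.smoothTransition.monotone.deriv_nonneg
    -- the identity `βψ + sψ' = β(1 − T) + s T'(g − 1)`
    have hid : β * (1 + T * (g - 1)) + s * (T' * (g - 1) + T * (1 / 2 * (-β) * (s / 2) ^ (-β - 1))) =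
        β * (1 - T) + s * T' * (g - 1) := by
      have : s * (T * (1 / 2 * (-β) * (s / 2) ^ (-β - 1))) = T * (-β * g) := by
        rw [← hsg]
        ring
      linear_combination this
    rw [hid]
    have h1 : 0 ≤ β * (1 - T) := mul_nonneg hβ (by linarith)
    have h2 : 0 ≤ s * T' * (g - 1) := by
      by_cases hs2 : s ≤ 2
      · have hg1 : 1 ≤ g :=
          Real.one_le_rpow_of_pos_of_le_one_of_nonpos (by positivity) (by linarith) (by linarith)
        have : 0 ≤ s * T' := mul_nonneg hs0.le hT'0
        nlinarith
      · push Not at hs2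
        rw [hT'_def, Calculus.deriv_smoothTransition_of_one_le (by linarith)]
        simp
    linarith

/-- **Decay of `ψ_β'`**: `s |ψ_β'(s)| ≤ (D + β) 2^{β+1}` for `s ≥ 1`, where `|σ'| ≤ D`. [folklore] -/
private theorem inner_abs_deriv_mul_le {β : ℝ} (hβ : 0 ≤ β) {D : ℝ} (hD0 : 0 ≤ D)
    (hD : ∀ r, |deriv Real.smoothTransition r| ≤ D) {s : ℝ} (hs : 1 ≤ s) :
    |deriv (fun s : ℝ => 1 + Real.smoothTransition (s - 1) * ((s / 2) ^ (-β) - 1)) s| * s ≤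
      (D + β) * (2 : ℝ) ^ (β + 1) := by
  have hs0 : 0 < s := by linarith
  rw [inner_deriv]
  set T := Real.smoothTransition (s - 1) with hT_def
  set T' := deriv Real.smoothTransition (s - 1) with hT'_def
  set g := (s / 2) ^ (-β) with hg_def
  have hne : (s / 2 : ℝ) ≠ 0 := by positivity
  have h2β : (2 : ℝ) ^ (β + 1) = 2 ^ β * 2 := Real.rpow_add_one two_ne_zero β
  have h2β0 : 0 < (2 : ℝ) ^ β := Real.rpow_pos_of_pos two_pos _
  have hg0 : 0 < g := Real.rpow_pos_of_pos (by positivity) _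
  -- `g ≤ 2^β` (as `s/2 ≥ 1/2`)
  have hgle : g ≤ (2 : ℝ) ^ β := by
    have h1 : g ≤ (1 / 2 : ℝ) ^ (-β) :=
      Real.rpow_le_rpow_of_nonpos (by norm_num) (by linarith) (by linarith)
    have h2 : (1 / 2 : ℝ) ^ (-β) = 2 ^ β := by
      rw [one_div, Real.inv_rpow (by norm_num), Real.rpow_neg (by norm_num), inv_inv]
    linarith [h2 ▸ h1]
  -- second term: `s · |T| · (β/2) (s/2)^{−β−1} = β T g ≤ β 2^β`
  have hsg : s * (1 / 2 * (-β) * (s / 2) ^ (-β - 1)) = -β * g := by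
    have : (s / 2) ^ (-β) = (s / 2) ^ (-β - 1) * (s / 2) := by
      rw [← Real.rpow_add_one hne]
      ring_nf
    rw [hg_def, this]
    ring
  have hT0 : 0 ≤ T := Real.smoothTransition.nonneg _
  have hT1 : T ≤ 1 := Real.smoothTransition.le_one _
  have hT'0 : 0 ≤ T' := Real.smoothTransition.monotone.deriv_nonneg
  have hB : |T * (1 / 2 * (-β) * (s / 2) ^ (-β - 1))| * s ≤ β * 2 ^ β := by
    have : |T * (1 / 2 * (-β) * (s / 2) ^ (-β - 1))| * s = β * T * g := by
      rw [abs_mul, abs_of_nonneg hT0]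
      have hin : 1 / 2 * (-β) * (s / 2) ^ (-β - 1) ≤ 0 := by
        have : 0 < (s / 2) ^ (-β - 1) := Real.rpow_pos_of_pos (by positivity) _
        nlinarith
      rw [abs_of_nonpos hin]
      linear_combination (-T) * hsg
    rw [this]
    have : T * g ≤ 1 * 2 ^ β := by gcongr
    nlinarith
  -- first term: `s |T'| |g − 1| ≤ D 2^{β+1}` (vanishes for `s > 2`)
  have hA : |T' * (g - 1)| * s ≤ D * (2 ^ β * 2) := by
    by_cases hs2 : s ≤ 2
    · have hg1 : 1 ≤ g :=
        Real.one_le_rpow_of_pos_of_le_one_of_nonpos (by positivity) (by linarith) (by linarith)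
      rw [abs_mul, abs_of_nonneg (by linarith : 0 ≤ g - 1)]
      calc |T'| * (g - 1) * s ≤ D * 2 ^ β * 2 := by
            gcongr
            · exact hD _
            · linarith
        _ = D * (2 ^ β * 2) := by ring
    · push Not at hs2
      rw [hT'_def, Calculus.deriv_smoothTransition_of_one_le (by linarith), zero_mul, abs_zero,
        zero_mul]
      positivity
  calc |T' * (g - 1) + T * (1 / 2 * (-β) * (s / 2) ^ (-β - 1))| * s
      ≤ (|T' * (g - 1)| + |T * (1 / 2 * (-β) * (s / 2) ^ (-β - 1))|) * s := by
        gcongr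
        exact abs_add_le _ _
    _ = |T' * (g - 1)| * s + |T * (1 / 2 * (-β) * (s / 2) ^ (-β - 1))| * s := by ring
    _ ≤ D * (2 ^ β * 2) + β * 2 ^ β := add_le_add hA hB
    _ ≤ (D + β) * (2 : ℝ) ^ (β + 1) := by
        rw [h2β]
        nlinarith

/-! ## Theorem 3.2 at `p = 3` in the range `−1 < α ≤ 1` -/


/-- `x ↦ (x₊)²` is differentiable with derivative `2x₊`. [folklore] -/
private theorem hasDerivAt_posPart_sq (x : ℝ) :
    HasDerivAt (fun x : ℝ => max x 0 ^ 2) (2 * max x 0) x := by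
  rcases lt_trichotomy x 0 with hx | hx | hx
  · have hev : (fun x : ℝ => max x 0 ^ 2) =ᶠ[𝓝 x] fun _ => (0 : ℝ) := by
      filter_upwards [Iio_mem_nhds hx] with y hy
      rw [max_eq_right (le_of_lt hy)]
      ring
    rw [max_eq_right hx.le, mul_zero]
    exact (hasDerivAt_const x (0 : ℝ)).congr_of_eventuallyEq hev
  · subst hx
    rw [max_self, mul_zero, hasDerivAt_iff_isLittleO_nhds_zero]
    refine Asymptotics.isLittleO_iff.2 fun c hc => ?_
    filter_upwards [Icc_mem_nhds (by linarith : -c < (0 : ℝ)) hc] with h hh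
    have h1 : |max h 0| ≤ |h| := by
      rcases le_or_gt h 0 with h0 | h0
      · rw [max_eq_right h0, abs_zero]
        exact abs_nonneg _
      · rw [max_eq_left h0.le]
    have h2 : |h| ≤ c := abs_le.2 ⟨hh.1, hh.2⟩
    have e : (fun x : ℝ => max x 0 ^ 2) (0 + h) - (fun x : ℝ => max x 0 ^ 2) 0 - h • (0 : ℝ) =
        max h 0 ^ 2 := by simp
    rw [e, Real.norm_eq_abs, Real.norm_eq_abs, abs_pow]
    calc |max h 0| ^ 2 = |max h 0| * |max h 0| := sq _
      _ ≤ |h| * |h| := by gcongr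
      _ ≤ c * |h| := by gcongr
  · have hev : (fun x : ℝ => max x 0 ^ 2) =ᶠ[𝓝 x] fun y => y ^ 2 := by
      filter_upwards [Ioi_mem_nhds hx] with y hy
      rw [max_eq_left (le_of_lt hy)]
    rw [max_eq_left hx.le]
    have h := (hasDerivAt_pow 2 x).congr_of_eventuallyEq hev
    simpa using h

/-- `x ↦ (x₊)²` is `C¹`. [folklore] -/
private theorem contDiff_posPart_sq : ContDiff ℝ 1 fun x : ℝ => max x 0 ^ 2 := by
  rw [contDiff_one_iff_deriv]
  refine ⟨fun x => (hasDerivAt_posPart_sq x).differentiableAt, ?_⟩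
  have : deriv (fun x : ℝ => max x 0 ^ 2) = fun x => 2 * max x 0 :=
    funext fun x => (hasDerivAt_posPart_sq x).deriv
  rw [this]
  exact continuous_const.mul (continuous_id.max continuous_const)

/-- **The polynomial outer profile, packaged.** For `b > 0`, `Φ₂(t) = ((1 − t/b)₊)²` is `C¹`,
vanishes on `t ≥ b`, is `≥ 0`, and for `0 ≤ t`: `Φ₂ ≤ 1`, `|Φ₂'| ≤ 2/b`; `Φ₂' ≤ 0` everywhere,
`Φ₂' = 0` on `t ≥ b`, and `−Φ₂'(t) ≥ 1/b` on `t ≤ b/2`. [folklore] -/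
private theorem exists_polyCut {b : ℝ} (hb : 0 < b) :
    ∃ Φ₂ : ℝ → ℝ, ContDiff ℝ 1 Φ₂ ∧ (∀ t, b ≤ t → Φ₂ t = 0) ∧ (∀ t, 0 ≤ Φ₂ t) ∧
      (∀ t, 0 ≤ t → Φ₂ t ≤ 1) ∧ (∀ t, deriv Φ₂ t ≤ 0) ∧ (∀ t, 0 ≤ t → |deriv Φ₂ t| ≤ 2 / b) ∧
      (∀ t, b ≤ t → deriv Φ₂ t = 0) ∧ (∀ t, t ≤ b / 2 → 1 / b ≤ -deriv Φ₂ t) := by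
  have hd : ∀ t, HasDerivAt (fun t : ℝ => max (1 - t / b) 0 ^ 2)
      (2 * max (1 - t / b) 0 * (-(1 / b))) t := fun t => by
    have h1 : HasDerivAt (fun t : ℝ => 1 - t / b) (-(1 / b)) t := by
      simpa using ((hasDerivAt_id t).div_const b).const_sub 1
    exact (hasDerivAt_posPart_sq (1 - t / b)).comp t h1
  have hle1 : ∀ t, 0 ≤ t → max (1 - t / b) 0 ≤ 1 := fun t ht =>
    max_le (by have : 0 ≤ t / b := div_nonneg ht hb.le; linarith) zero_le_one
  refine ⟨fun t => max (1 - t / b) 0 ^ 2,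
    contDiff_posPart_sq.comp (contDiff_const.sub (contDiff_id.div_const b)),
    ?_, fun t => sq_nonneg _, ?_, ?_, ?_, ?_, ?_⟩
  · intro t ht
    have : 1 - t / b ≤ 0 := by rw [sub_nonpos, le_div_iff₀ hb]; linarith
    simp [max_eq_right this]
  · intro t ht
    have h0 : 0 ≤ max (1 - t / b) 0 := le_max_right _ _
    nlinarith [hle1 t ht]
  · intro t
    rw [(hd t).deriv]
    have h0 : 0 ≤ max (1 - t / b) 0 := le_max_right _ _
    have : 0 < 1 / b := by positivity
    nlinarith
  · intro t ht
    rw [(hd t).deriv, show 2 * max (1 - t / b) 0 * -(1 / b) = -(2 / b * max (1 - t / b) 0) by ring,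
      abs_neg, abs_of_nonneg (by positivity)]
    calc 2 / b * max (1 - t / b) 0 ≤ 2 / b * 1 := by gcongr; exact hle1 t ht
      _ = 2 / b := mul_one _
  · intro t ht
    rw [(hd t).deriv]
    have : 1 - t / b ≤ 0 := by rw [sub_nonpos, le_div_iff₀ hb]; linarith
    simp [max_eq_right this]
  · intro t ht
    rw [(hd t).deriv]
    have h1 : 1 / 2 ≤ 1 - t / b := by
      have : t / b ≤ 1 / 2 := by rw [div_le_iff₀ hb]; linarith
      linarith
    rw [max_eq_left (by linarith)]
    have hb' : 0 < 1 / b := by positivity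
    nlinarith

/-- **The inner cut-off, packaged with the extra facts used in the window**: `Φ₁ = ψ_β(t/a)` is
`C¹`, `Φ₁' = 0` on `t ≤ a`, `0 ≤ Φ₁ ≤ 2^β` on `t > 0`, `Φ₁ = (t/(2a))^{−β}` on `t ≥ 2a`, the defect
`κ₁ = −2βΦ₁ − 2tΦ₁'` satisfies `−(2β + 4D·2^β) ≤ κ₁ ≤ 0` and `κ₁ = 0` on `t ≥ 2a`, and
`t|Φ₁'| ≤ (D+β)2^{β+1}` on `t ≥ a`. [folklore] -/
private theorem exists_innerCut₂ {β a D : ℝ} (hβ : 0 ≤ β) (ha : 0 < a) (hD0 : 0 ≤ D)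
    (hD : ∀ r, |deriv Real.smoothTransition r| ≤ D) :
    ∃ Φ₁ : ℝ → ℝ, ContDiff ℝ 1 Φ₁ ∧ (∀ t, t ≤ a → deriv Φ₁ t = 0) ∧
      (∀ t, 0 < t → 0 ≤ Φ₁ t) ∧ (∀ t, 0 < t → Φ₁ t ≤ (2 : ℝ) ^ β) ∧
      (∀ t, 2 * a ≤ t → Φ₁ t = (t / a / 2) ^ (-β)) ∧
      (∀ t, -(2 * β) * Φ₁ t - 2 * t * deriv Φ₁ t ≤ 0) ∧
      (∀ t, 2 * a ≤ t → -(2 * β) * Φ₁ t - 2 * t * deriv Φ₁ t = 0) ∧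
      (∀ t, -(2 * β + 4 * D * (2 : ℝ) ^ β) ≤ -(2 * β) * Φ₁ t - 2 * t * deriv Φ₁ t) ∧
      (∀ t, a ≤ t → |deriv Φ₁ t| * t ≤ (D + β) * (2 : ℝ) ^ (β + 1)) := by
  set ψ : ℝ → ℝ := fun s => 1 + Real.smoothTransition (s - 1) * ((s / 2) ^ (-β) - 1) with hψ
  have hψ1 : ContDiff ℝ 1 ψ := inner_contDiff β
  have hd : ∀ t, HasDerivAt (fun t => ψ (t / a)) (deriv ψ (t / a) * (1 / a)) t := fun t =>
    ((hψ1.differentiable one_ne_zero) _).hasDerivAt.comp t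
      (by simpa using (hasDerivAt_id t).div_const a)
  have h2β : (1 : ℝ) ≤ 2 ^ β := Real.one_le_rpow (by norm_num) hβ
  have hhalf : (1 / 2 : ℝ) ^ (-β) = 2 ^ β := by
    rw [one_div, Real.inv_rpow (by norm_num), Real.rpow_neg (by norm_num), inv_inv]
  -- `g = (s/2)^{−β} ≤ 2^β` for `s ≥ 1`, `≥ 1` for `0 < s ≤ 2`
  have hg_le : ∀ s : ℝ, 1 ≤ s → (s / 2) ^ (-β) ≤ (2 : ℝ) ^ β := fun s hs => by
    have h1' : (s / 2) ^ (-β) ≤ (1 / 2 : ℝ) ^ (-β) :=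
      Real.rpow_le_rpow_of_nonpos (by norm_num) (by linarith) (by linarith)
    rwa [hhalf] at h1'
  have hg_ge : ∀ s : ℝ, 0 < s → s ≤ 2 → 1 ≤ (s / 2) ^ (-β) := fun s hs hs2 =>
    Real.one_le_rpow_of_pos_of_le_one_of_nonpos (by positivity) (by linarith) (by linarith)
  -- the key identity `−2βΦ₁ − 2tΦ₁' = −2(βψ(s) + sψ'(s))`, `s = t/a`
  have hκ : ∀ t, -(2 * β) * ψ (t / a) - 2 * t * (deriv ψ (t / a) * (1 / a)) =
      -2 * (β * ψ (t / a) + t / a * deriv ψ (t / a)) := fun t => by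
    field_simp
    ring
  -- `βψ + sψ'` in closed form for `s > 0`
  have hform : ∀ s : ℝ, 0 < s → β * ψ s + s * deriv ψ s =
      β * (1 - Real.smoothTransition (s - 1)) +
        s * deriv Real.smoothTransition (s - 1) * ((s / 2) ^ (-β) - 1) := by
    intro s hs
    have hne : (s / 2 : ℝ) ≠ 0 := by positivity
    have hsg : s * (1 / 2 * (-β) * (s / 2) ^ (-β - 1)) = -β * (s / 2) ^ (-β) := by
      have : (s / 2) ^ (-β) = (s / 2) ^ (-β - 1) * (s / 2) := by
        rw [← Real.rpow_add_one hne]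
        ring_nf
      rw [this]
      ring
    simp only [hψ]
    rw [inner_deriv]
    linear_combination (Real.smoothTransition (s - 1)) * hsg
  refine ⟨fun t => ψ (t / a), hψ1.comp (contDiff_id.div_const a), ?_, ?_, ?_, ?_, ?_, ?_, ?_, ?_⟩
  · intro t ht
    rw [(hd t).deriv, show deriv ψ (t / a) = 0 from inner_deriv_eq_zero (by rwa [div_le_one ha]),
      zero_mul]
  · intro t ht
    exact inner_nonneg (by positivity)
  · intro t ht
    have hs : 0 < t / a := by positivity
    by_cases h1 : t / a ≤ 1
    · simp only [hψ]
      rw [inner_eq_one h1]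
      exact h2β
    · push Not at h1
      have hT0 := Real.smoothTransition.nonneg (t / a - 1)
      have hT1 := Real.smoothTransition.le_one (t / a - 1)
      have hg := hg_le (t / a) h1.le
      simp only [hψ]
      nlinarith [mul_nonneg hT0 (sub_nonneg.2 hg), mul_nonneg (sub_nonneg.2 hT1) (sub_nonneg.2 h2β)]
  · intro t ht
    exact inner_eq_rpow (by rw [le_div_iff₀ ha]; linarith)
  · intro t
    rw [(hd t).deriv, hκ]
    have := inner_sign hβ (t / a)
    simp only [hψ] at this ⊢
    linarith
  · intro t ht
    rw [(hd t).deriv, hκ]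
    have hs : 2 ≤ t / a := by rw [le_div_iff₀ ha]; linarith
    have hs0 : 0 < t / a := by linarith
    rw [hform _ hs0, Real.smoothTransition.one_of_one_le (by linarith),
      Calculus.deriv_smoothTransition_of_one_le (by linarith)]
    ring
  · intro t
    rw [(hd t).deriv, hκ]
    have h4D : 0 ≤ 4 * D * (2 : ℝ) ^ β := by positivity
    by_cases h1 : t / a ≤ 1
    · simp only [hψ]
      rw [inner_eq_one h1, inner_deriv_eq_zero h1]
      nlinarith
    · push Not at h1
      have hs0 : 0 < t / a := by linarith
      rw [hform _ hs0]
      set s := t / a with hs_def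
      have hT0 := Real.smoothTransition.nonneg (s - 1)
      have hT1 := Real.smoothTransition.le_one (s - 1)
      have hT'0 : 0 ≤ deriv Real.smoothTransition (s - 1) :=
        Real.smoothTransition.monotone.deriv_nonneg
      have hT'D : deriv Real.smoothTransition (s - 1) ≤ D := le_trans (le_abs_self _) (hD _)
      -- the second term lies in `[0, 2D·2^β]`
      have hsec : 0 ≤ s * deriv Real.smoothTransition (s - 1) * ((s / 2) ^ (-β) - 1) ∧
          s * deriv Real.smoothTransition (s - 1) * ((s / 2) ^ (-β) - 1) ≤ 2 * D * 2 ^ β := by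
        by_cases h2 : s ≤ 2
        · have hg1 := hg_ge s hs0 h2
          have hg2 := hg_le s h1.le
          have h6 : 0 ≤ s * deriv Real.smoothTransition (s - 1) := mul_nonneg hs0.le hT'0
          have h3 : s * deriv Real.smoothTransition (s - 1) ≤ 2 * D := by nlinarith
          constructor
          · nlinarith
          · nlinarith
        · push Not at h2
          rw [Calculus.deriv_smoothTransition_of_one_le (by linarith), mul_zero, zero_mul]
          exact ⟨le_rfl, by positivity⟩
      have h1' : 0 ≤ β * (1 - Real.smoothTransition (s - 1)) := mul_nonneg hβ (by linarith)
      have h1'' : β * (1 - Real.smoothTransition (s - 1)) ≤ β := by nlinarith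
      nlinarith [hsec.1, hsec.2]
  · intro t ht
    rw [(hd t).deriv, abs_mul, abs_of_pos (by positivity : (0 : ℝ) < 1 / a)]
    have hbd := inner_abs_deriv_mul_le hβ hD0 hD (s := t / a) (by rwa [le_div_iff₀ ha, one_mul])
    calc |deriv ψ (t / a)| * (1 / a) * t = |deriv ψ (t / a)| * (t / a) := by
          field_simp
      _ ≤ (D + β) * (2 : ℝ) ^ (β + 1) := hbd

/-- **(Q1) The left integrand in the window, pointwise** (inner scale `a = 1/2`, outer
`Φ₂ = ((1 − t/b)₊)²`, `b ≥ 4`): with `Φ = Φ₁Φ₂`, `t = |y|²`,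
`κ(t)|U|² ≥ −K₁ 1_{|y| ≤ 1}|U|² + ½ (b/2)^{−β} 1_{b/4 ≤ t ≤ b/2… }` — here with the annulus
`A = {b/16 ≤ t ≤ b/4}` and the bound `(1/8)(b/4)^{−β}`. [folklore] -/
private theorem window_Q1 {β b K₁ : ℝ} {Φ₁ Φ₂ : ℝ → ℝ}
    (U : EuclideanSpace ℝ (Fin 3) → EuclideanSpace ℝ (Fin 3)) (hb : 16 ≤ b) (hβ : 0 ≤ β)
    (hΦ₁nn : ∀ t, 0 < t → 0 ≤ Φ₁ t) (hΦ₁two : ∀ t, 2 * (1 / 2) ≤ t → Φ₁ t = (t / (1 / 2) / 2) ^ (-β))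
    (hΦ₁sign : ∀ t, -(2 * β) * Φ₁ t - 2 * t * deriv Φ₁ t ≤ 0)
    (hΦ₁zero : ∀ t, 2 * (1 / 2) ≤ t → -(2 * β) * Φ₁ t - 2 * t * deriv Φ₁ t = 0)
    (hΦ₁low : ∀ t, -K₁ ≤ -(2 * β) * Φ₁ t - 2 * t * deriv Φ₁ t)
    (hΦ₂nn : ∀ t, 0 ≤ Φ₂ t) (hΦ₂le : ∀ t, 0 ≤ t → Φ₂ t ≤ 1) (hΦ₂d0 : ∀ t, deriv Φ₂ t ≤ 0)
    (hΦ₂low : ∀ t, t ≤ b / 2 → 1 / b ≤ -deriv Φ₂ t)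
    (hΦd : ∀ t, deriv (fun t => Φ₁ t * Φ₂ t) t = deriv Φ₁ t * Φ₂ t + Φ₁ t * deriv Φ₂ t)
    (y : EuclideanSpace ℝ (Fin 3)) :
    -K₁ * (closedBall (0 : EuclideanSpace ℝ (Fin 3)) 1).indicator (fun y => ‖U y‖ ^ 2) y +
      1 / 8 * (b / 4) ^ (-β) * ({y : EuclideanSpace ℝ (Fin 3) | b / 16 ≤ ‖y‖ ^ 2 ∧
        ‖y‖ ^ 2 ≤ b / 4}).indicator (fun y => ‖U y‖ ^ 2) y ≤
      ((-(2 * β)) * (Φ₁ (‖y‖ ^ 2) * Φ₂ (‖y‖ ^ 2)) -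
        2 * ‖y‖ ^ 2 * deriv (fun t => Φ₁ t * Φ₂ t) (‖y‖ ^ 2)) * ‖U y‖ ^ 2 := by
  have ht0 : 0 ≤ ‖y‖ ^ 2 := by positivity
  have hdecomp : ((-(2 * β)) * (Φ₁ (‖y‖ ^ 2) * Φ₂ (‖y‖ ^ 2)) -
      2 * ‖y‖ ^ 2 * deriv (fun t => Φ₁ t * Φ₂ t) (‖y‖ ^ 2)) * ‖U y‖ ^ 2 =
      (-(2 * β) * Φ₁ (‖y‖ ^ 2) - 2 * ‖y‖ ^ 2 * deriv Φ₁ (‖y‖ ^ 2)) * Φ₂ (‖y‖ ^ 2) *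
        ‖U y‖ ^ 2 + 2 * ‖y‖ ^ 2 * Φ₁ (‖y‖ ^ 2) * (-deriv Φ₂ (‖y‖ ^ 2)) * ‖U y‖ ^ 2 := by
    rw [hΦd]
    ring
  rw [hdecomp]
  gcongr ?_ + ?_
  · -- the defect term: `κ₁Φ₂|U|² ≥ −K₁ 1_{|y|≤1}|U|²`
    by_cases hy : y ∈ closedBall (0 : EuclideanSpace ℝ (Fin 3)) 1
    · rw [indicator_of_mem hy]
      have h1 : -K₁ ≤ (-(2 * β) * Φ₁ (‖y‖ ^ 2) - 2 * ‖y‖ ^ 2 * deriv Φ₁ (‖y‖ ^ 2)) *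
          Φ₂ (‖y‖ ^ 2) := by
        have hκ := hΦ₁low (‖y‖ ^ 2)
        have hκ0 := hΦ₁sign (‖y‖ ^ 2)
        have hK : 0 ≤ K₁ := by linarith
        have h2 := hΦ₂le _ ht0
        have h3 := hΦ₂nn (‖y‖ ^ 2)
        nlinarith
      nlinarith [sq_nonneg ‖U y‖]
    · rw [indicator_of_notMem hy, mul_zero]
      rw [mem_closedBall_zero_iff, not_le] at hy
      have h1 : 2 * (1 / 2) ≤ ‖y‖ ^ 2 := by nlinarith
      rw [hΦ₁zero _ h1, zero_mul, zero_mul]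
  · -- the annular term: `2tΦ₁(−Φ₂')|U|² ≥ (1/8)(b/4)^{−β} 1_A |U|²`
    have hw0 : 0 ≤ 2 * ‖y‖ ^ 2 * Φ₁ (‖y‖ ^ 2) * (-deriv Φ₂ (‖y‖ ^ 2)) * ‖U y‖ ^ 2 := by
      have h3 : 0 ≤ -deriv Φ₂ (‖y‖ ^ 2) := by linarith [hΦ₂d0 (‖y‖ ^ 2)]
      by_cases hy0 : y = 0
      · subst hy0
        simp
      · have : 0 < ‖y‖ ^ 2 := by positivity
        have h4 := hΦ₁nn _ this
        positivity
    by_cases hy : y ∈ {y : EuclideanSpace ℝ (Fin 3) | b / 16 ≤ ‖y‖ ^ 2 ∧ ‖y‖ ^ 2 ≤ b / 4}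
    · rw [indicator_of_mem hy]
      obtain ⟨hy1, hy2⟩ := hy
      have ht1 : 2 * (1 / 2) ≤ ‖y‖ ^ 2 := by linarith
      rw [hΦ₁two _ ht1, show ‖y‖ ^ 2 / (1 / 2) / 2 = ‖y‖ ^ 2 by ring]
      have hpow : (b / 4) ^ (-β) ≤ (‖y‖ ^ 2) ^ (-β) :=
        Real.rpow_le_rpow_of_nonpos (by linarith) hy2 (by linarith)
      have hpow0 : 0 ≤ (b / 4) ^ (-β) := Real.rpow_nonneg (by linarith) _
      have hd := hΦ₂low (‖y‖ ^ 2) (by linarith)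
      have hb0 : 0 < b := by linarith
      -- `2t(−Φ₂') ≥ 2(b/16)(1/b) = 1/8`
      have h5 : 1 / 8 ≤ 2 * ‖y‖ ^ 2 * (-deriv Φ₂ (‖y‖ ^ 2)) := by
        have e1 : (1 : ℝ) / 8 = 2 * (b / 16) * (1 / b) := by
          field_simp
          ring
        rw [e1]
        have h6 : 2 * (b / 16) ≤ 2 * ‖y‖ ^ 2 := by linarith
        have h7 : 0 ≤ 1 / b := by positivity
        exact mul_le_mul h6 hd h7 (by positivity)
      calc 1 / 8 * (b / 4) ^ (-β) * ‖U y‖ ^ 2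
          ≤ (2 * ‖y‖ ^ 2 * (-deriv Φ₂ (‖y‖ ^ 2))) * (‖y‖ ^ 2) ^ (-β) * ‖U y‖ ^ 2 := by
            gcongr
        _ = 2 * ‖y‖ ^ 2 * (‖y‖ ^ 2) ^ (-β) * (-deriv Φ₂ (‖y‖ ^ 2)) * ‖U y‖ ^ 2 := by ring
    · rw [indicator_of_notMem hy, mul_zero]
      exact hw0


/-! ## The annular energy bound in the window with a WEIGHTED LOCAL flux (general `p`) -/

/-- **(Q2′) The flux integrand in the window, pointwise, with weights** (inner scale `a = 1/2`,
outer polynomial cut at `b = L²`): with `f = |U|³ + 2|P||U|`,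
`|(|U|²+2P)·2Φ'(|y|²)⟨y,U⟩| ≤ (4K₂ + 2^{β+2}/L²) 1_{|y|≤1} f + 2β 1_{1≤|y|≤L} (|y|²)^{−β}|y|^{−1} f
+ (4/L²) 1_{1≤|y|≤L} (|y|²)^{−β}|y| f` — on `|y| ≥ 1`, `Φ₁ = t^{−β}` and `Φ₁' = −βΦ₁/t`; beyond
`|y| = L`, `Φ' = 0`. [folklore] -/
private theorem window_Q2_weighted {β L K₂ : ℝ} {Φ₁ Φ₂ : ℝ → ℝ}
    (U : EuclideanSpace ℝ (Fin 3) → EuclideanSpace ℝ (Fin 3)) (P : EuclideanSpace ℝ (Fin 3) → ℝ)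
    (hL : 2 ≤ L) (hβ : 0 ≤ β) (hK₂ : 0 ≤ K₂)
    (hΦ₁d0 : ∀ t, t ≤ 1 / 2 → deriv Φ₁ t = 0)
    (hΦ₁dec : ∀ t, 1 / 2 ≤ t → |deriv Φ₁ t| * t ≤ K₂)
    (hΦ₁nn : ∀ t, 0 < t → 0 ≤ Φ₁ t) (hΦ₁bd : ∀ t, 0 < t → Φ₁ t ≤ (2 : ℝ) ^ β)
    (hΦ₁two : ∀ t, 2 * (1 / 2) ≤ t → Φ₁ t = (t / (1 / 2) / 2) ^ (-β))
    (hΦ₁zero : ∀ t, 2 * (1 / 2) ≤ t → -(2 * β) * Φ₁ t - 2 * t * deriv Φ₁ t = 0)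
    (hΦ₂nn : ∀ t, 0 ≤ Φ₂ t) (hΦ₂le : ∀ t, 0 ≤ t → Φ₂ t ≤ 1)
    (hΦ₂dle : ∀ t, 0 ≤ t → |deriv Φ₂ t| ≤ 2 / L ^ 2) (hΦ₂d_b : ∀ t, L ^ 2 ≤ t → deriv Φ₂ t = 0)
    (hΦ₂zero : ∀ t, L ^ 2 ≤ t → Φ₂ t = 0)
    (hΦd : ∀ t, deriv (fun t => Φ₁ t * Φ₂ t) t = deriv Φ₁ t * Φ₂ t + Φ₁ t * deriv Φ₂ t)
    (y : EuclideanSpace ℝ (Fin 3)) :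
    ‖(‖U y‖ ^ 2 + 2 * P y) * (2 * deriv (fun t => Φ₁ t * Φ₂ t) (‖y‖ ^ 2) * ⟪y, U y⟫)‖ ≤
      (4 * K₂ + (2 : ℝ) ^ (β + 2) / L ^ 2) *
          (closedBall (0 : EuclideanSpace ℝ (Fin 3)) 1).indicator
            (fun y => ‖U y‖ ^ 3 + 2 * (|P y| * ‖U y‖)) y +
        2 * β * {y : EuclideanSpace ℝ (Fin 3) | 1 ≤ ‖y‖ ∧ ‖y‖ ≤ L}.indicator
          (fun y => (‖y‖ ^ 2) ^ (-β) / ‖y‖ * (‖U y‖ ^ 3 + 2 * (|P y| * ‖U y‖))) y +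
        4 / L ^ 2 * {y : EuclideanSpace ℝ (Fin 3) | 1 ≤ ‖y‖ ∧ ‖y‖ ≤ L}.indicator
          (fun y => (‖y‖ ^ 2) ^ (-β) * ‖y‖ * (‖U y‖ ^ 3 + 2 * (|P y| * ‖U y‖))) y := by
  have hL0 : 0 < L := by linarith
  have hL2 : 0 < L ^ 2 := by positivity
  have h2β : 0 < (2 : ℝ) ^ β := Real.rpow_pos_of_pos two_pos _
  have ht0 : 0 ≤ ‖y‖ ^ 2 := by positivity
  set f : ℝ := ‖U y‖ ^ 3 + 2 * (|P y| * ‖U y‖) with hf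
  have hf0 : 0 ≤ f := by positivity
  -- the three (nonnegative) terms of the bound
  set S : Set (EuclideanSpace ℝ (Fin 3)) := {y : EuclideanSpace ℝ (Fin 3) | 1 ≤ ‖y‖ ∧ ‖y‖ ≤ L}
    with hS
  have hw1 : 0 ≤ (‖y‖ ^ 2) ^ (-β) / ‖y‖ * f := by positivity
  have hw2 : 0 ≤ (‖y‖ ^ 2) ^ (-β) * ‖y‖ * f := by positivity
  have hT1 : 0 ≤ (4 * K₂ + (2 : ℝ) ^ (β + 2) / L ^ 2) *
      (closedBall (0 : EuclideanSpace ℝ (Fin 3)) 1).indicator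
        (fun y => ‖U y‖ ^ 3 + 2 * (|P y| * ‖U y‖)) y :=
    mul_nonneg (by positivity) (indicator_nonneg (fun z _ => by positivity) _)
  have hT2 : 0 ≤ 2 * β * S.indicator
      (fun y => (‖y‖ ^ 2) ^ (-β) / ‖y‖ * (‖U y‖ ^ 3 + 2 * (|P y| * ‖U y‖))) y :=
    mul_nonneg (by positivity) (indicator_nonneg (fun z _ => by positivity) _)
  have hT3 : 0 ≤ 4 / L ^ 2 * S.indicator
      (fun y => (‖y‖ ^ 2) ^ (-β) * ‖y‖ * (‖U y‖ ^ 3 + 2 * (|P y| * ‖U y‖))) y :=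
    mul_nonneg (by positivity) (indicator_nonneg (fun z _ => by positivity) _)
  -- the basic estimate `|F| ≤ 2|Φ'(t)| |y| f`
  have hbase : ‖(‖U y‖ ^ 2 + 2 * P y) * (2 * deriv (fun t => Φ₁ t * Φ₂ t) (‖y‖ ^ 2) * ⟪y, U y⟫)‖
      ≤ 2 * |deriv (fun t => Φ₁ t * Φ₂ t) (‖y‖ ^ 2)| * ‖y‖ * f := by
    rw [Real.norm_eq_abs, abs_mul, abs_mul, abs_mul, abs_two]
    have hin : |⟪y, U y⟫| ≤ ‖y‖ * ‖U y‖ := abs_real_inner_le_norm _ _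
    have hA : |‖U y‖ ^ 2 + 2 * P y| ≤ ‖U y‖ ^ 2 + 2 * |P y| := by
      calc |‖U y‖ ^ 2 + 2 * P y| ≤ |‖U y‖ ^ 2| + |2 * P y| := abs_add_le _ _
        _ = ‖U y‖ ^ 2 + 2 * |P y| := by rw [abs_of_nonneg (by positivity), abs_mul, abs_two]
    calc |‖U y‖ ^ 2 + 2 * P y| * (2 * |deriv (fun t => Φ₁ t * Φ₂ t) (‖y‖ ^ 2)| * |⟪y, U y⟫|)
        ≤ (‖U y‖ ^ 2 + 2 * |P y|) *
            (2 * |deriv (fun t => Φ₁ t * Φ₂ t) (‖y‖ ^ 2)| * (‖y‖ * ‖U y‖)) := by gcongr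
      _ = 2 * |deriv (fun t => Φ₁ t * Φ₂ t) (‖y‖ ^ 2)| * ‖y‖ *
            (‖U y‖ ^ 3 + 2 * (|P y| * ‖U y‖)) := by ring
  refine hbase.trans ?_
  by_cases hy1 : ‖y‖ ≤ 1
  · -- the core `|y| ≤ 1`: `|Φ'| ≤ 2K₂ + 2^β · 2/L²`
    have hmem : y ∈ closedBall (0 : EuclideanSpace ℝ (Fin 3)) 1 := by
      rw [mem_closedBall_zero_iff]; exact hy1
    rw [indicator_of_mem hmem]
    have hT1' : 0 ≤ (4 * K₂ + (2 : ℝ) ^ (β + 2) / L ^ 2) * f := by positivity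
    by_cases hy0 : ‖y‖ = 0
    · rw [hy0, mul_zero, zero_mul]
      linarith [hT2, hT3]
    · have hypos : 0 < ‖y‖ := lt_of_le_of_ne (norm_nonneg _) (Ne.symm hy0)
      have ht : 0 < ‖y‖ ^ 2 := by positivity
      have ht1 : ‖y‖ ^ 2 ≤ 1 := by nlinarith [norm_nonneg y]
      have hd1 : |deriv Φ₁ (‖y‖ ^ 2)| ≤ 2 * K₂ := by
        by_cases hh : ‖y‖ ^ 2 ≤ 1 / 2
        · rw [hΦ₁d0 _ hh, abs_zero]; positivity
        · push Not at hh
          have h1 := hΦ₁dec _ hh.le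
          have h2 : |deriv Φ₁ (‖y‖ ^ 2)| * (1 / 2) ≤ |deriv Φ₁ (‖y‖ ^ 2)| * ‖y‖ ^ 2 :=
            mul_le_mul_of_nonneg_left hh.le (abs_nonneg _)
          linarith
      have hd : |deriv (fun t => Φ₁ t * Φ₂ t) (‖y‖ ^ 2)| ≤ 2 * K₂ + (2 : ℝ) ^ β * (2 / L ^ 2) := by
        rw [hΦd]
        calc |deriv Φ₁ (‖y‖ ^ 2) * Φ₂ (‖y‖ ^ 2) + Φ₁ (‖y‖ ^ 2) * deriv Φ₂ (‖y‖ ^ 2)|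
            ≤ |deriv Φ₁ (‖y‖ ^ 2) * Φ₂ (‖y‖ ^ 2)| + |Φ₁ (‖y‖ ^ 2) * deriv Φ₂ (‖y‖ ^ 2)| :=
              abs_add_le _ _
          _ = |deriv Φ₁ (‖y‖ ^ 2)| * Φ₂ (‖y‖ ^ 2) + Φ₁ (‖y‖ ^ 2) * |deriv Φ₂ (‖y‖ ^ 2)| := by
              rw [abs_mul, abs_mul, abs_of_nonneg (hΦ₂nn _), abs_of_nonneg (hΦ₁nn _ ht)]
          _ ≤ 2 * K₂ * 1 + (2 : ℝ) ^ β * (2 / L ^ 2) := by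
              exact add_le_add (mul_le_mul hd1 (hΦ₂le _ ht0) (hΦ₂nn _) (by positivity))
                (mul_le_mul (hΦ₁bd _ ht) (hΦ₂dle _ ht0) (abs_nonneg _) h2β.le)
          _ = 2 * K₂ + (2 : ℝ) ^ β * (2 / L ^ 2) := by ring
      have hpow : (2 : ℝ) ^ (β + 2) = (2 : ℝ) ^ β * 4 := by
        rw [Real.rpow_add two_pos, show ((2 : ℝ) ^ (2 : ℝ)) = 4 by norm_num]
      calc 2 * |deriv (fun t => Φ₁ t * Φ₂ t) (‖y‖ ^ 2)| * ‖y‖ * f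
          ≤ 2 * (2 * K₂ + (2 : ℝ) ^ β * (2 / L ^ 2)) * 1 * f := by gcongr
        _ = (4 * K₂ + (2 : ℝ) ^ (β + 2) / L ^ 2) * f := by rw [hpow]; ring
        _ ≤ _ := by linarith [hT2, hT3]
  · push Not at hy1
    by_cases hyL : ‖y‖ ≤ L
    · -- the bulk `1 < |y| ≤ L`: `Φ₁ = t^{−β}`, `Φ₁' = −βΦ₁/t`
      have hmem : y ∈ S := ⟨hy1.le, hyL⟩
      have hnmem : y ∉ closedBall (0 : EuclideanSpace ℝ (Fin 3)) 1 := by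
        rw [mem_closedBall_zero_iff, not_le]; exact hy1
      rw [indicator_of_mem hmem, indicator_of_mem hmem, indicator_of_notMem hnmem, mul_zero,
        zero_add]
      have hypos : 0 < ‖y‖ := by linarith
      have ht : 0 < ‖y‖ ^ 2 := by positivity
      have ht1 : 2 * (1 / 2) ≤ ‖y‖ ^ 2 := by nlinarith
      have hΦ₁v : Φ₁ (‖y‖ ^ 2) = (‖y‖ ^ 2) ^ (-β) := by
        rw [hΦ₁two _ ht1, show ‖y‖ ^ 2 / (1 / 2) / 2 = ‖y‖ ^ 2 by ring]
      have hΦ₁' : deriv Φ₁ (‖y‖ ^ 2) = -β * (‖y‖ ^ 2) ^ (-β) / ‖y‖ ^ 2 := by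
        have h0 := hΦ₁zero _ ht1
        rw [hΦ₁v] at h0
        field_simp
        linarith
      have hw0 : 0 ≤ (‖y‖ ^ 2) ^ (-β) := Real.rpow_nonneg ht.le _
      have hd : |deriv (fun t => Φ₁ t * Φ₂ t) (‖y‖ ^ 2)| ≤
          β * (‖y‖ ^ 2) ^ (-β) / ‖y‖ ^ 2 + (‖y‖ ^ 2) ^ (-β) * (2 / L ^ 2) := by
        rw [hΦd, hΦ₁', hΦ₁v]
        calc |-β * (‖y‖ ^ 2) ^ (-β) / ‖y‖ ^ 2 * Φ₂ (‖y‖ ^ 2) +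
              (‖y‖ ^ 2) ^ (-β) * deriv Φ₂ (‖y‖ ^ 2)|
            ≤ |-β * (‖y‖ ^ 2) ^ (-β) / ‖y‖ ^ 2 * Φ₂ (‖y‖ ^ 2)| +
                |(‖y‖ ^ 2) ^ (-β) * deriv Φ₂ (‖y‖ ^ 2)| := abs_add_le _ _
          _ = β * (‖y‖ ^ 2) ^ (-β) / ‖y‖ ^ 2 * Φ₂ (‖y‖ ^ 2) +
                (‖y‖ ^ 2) ^ (-β) * |deriv Φ₂ (‖y‖ ^ 2)| := by
              rw [abs_mul, abs_mul, abs_of_nonneg (hΦ₂nn _), abs_of_nonneg hw0,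
                abs_div, abs_mul, abs_neg, abs_of_nonneg hβ, abs_of_nonneg hw0,
                abs_of_nonneg ht.le]
          _ ≤ β * (‖y‖ ^ 2) ^ (-β) / ‖y‖ ^ 2 * 1 + (‖y‖ ^ 2) ^ (-β) * (2 / L ^ 2) := by
              gcongr
              · exact hΦ₂le _ ht0
              · exact hΦ₂dle _ ht0
          _ = _ := by ring
      calc 2 * |deriv (fun t => Φ₁ t * Φ₂ t) (‖y‖ ^ 2)| * ‖y‖ * f
          ≤ 2 * (β * (‖y‖ ^ 2) ^ (-β) / ‖y‖ ^ 2 + (‖y‖ ^ 2) ^ (-β) * (2 / L ^ 2)) * ‖y‖ * f := by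
            gcongr
        _ = 2 * β * ((‖y‖ ^ 2) ^ (-β) / ‖y‖ * f) +
              4 / L ^ 2 * ((‖y‖ ^ 2) ^ (-β) * ‖y‖ * f) := by
            field_simp
            ring
    · -- beyond `L`: `Φ' = 0`
      push Not at hyL
      have htb : L ^ 2 ≤ ‖y‖ ^ 2 := by nlinarith
      have hd : deriv (fun t => Φ₁ t * Φ₂ t) (‖y‖ ^ 2) = 0 := by
        rw [hΦd, hΦ₂d_b _ htb, hΦ₂zero _ htb]
        ring
      rw [hd, abs_zero, mul_zero, zero_mul, zero_mul]
      linarith [hT1, hT2, hT3]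

/-- **The annular energy bound in the window with a weighted local flux** (CS13 (3.17)/(3.2) in
the window, general `p`; abstract inner profile `Φ₁` with defect constant `K₁` and decay constant
`K₂`, so that `Φ₁ ≡ 1`, `K₁ = K₂ = 0` is admissible at `β = 0`): for `β = 3/2 − α ≥ 0`, `L ≥ 4`,
`∫_{L²/16 ≤ |y|² ≤ L²/4} |U|² ≤ 8 L^{3−2α} [K₁ ∫_{|y|≤1}|U|² + (1+α)((4K₂ + 2^{β+2}/L²)∫_{|y|≤1} f
 + 2β ∫_{1≤|y|≤L} (|y|²)^{−β}|y|^{−1} f + (4/L²) ∫_{1≤|y|≤L} (|y|²)^{−β}|y| f)]`, `f = |U|³+2|P||U|`.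
[cite: ChaeShvydkoy2013, §3.2.2–3.2.3, display before (3.17) ("1/l₂^{N−2α}∫_{|y|≤l₂/2}|v|² ≲
1/l₁^{N−2α}∫_{|y|≤l₁}|v|² + ∫_{l₁/2≤|y|≤l₂}(|v|³+|q||v|)/|y|^{N+1−2α}")] -/
theorem IsSelfSimilarEulerProfile.annular_energy_le_weightedFlux_core {α β K₁ K₂ : ℝ}
    {U : EuclideanSpace ℝ (Fin 3) → EuclideanSpace ℝ (Fin 3)} {P : EuclideanSpace ℝ (Fin 3) → ℝ}
    {Φ₁ : ℝ → ℝ} (h : IsSelfSimilarEulerProfile (1 / (α + 1)) 0 U P) (hα : -1 < α)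
    (hβ : β = 3 / 2 - α) (hβ0 : 0 ≤ β) (hPloc : LocallyIntegrable P volume)
    (hK₂ : 0 ≤ K₂) (hΦ₁1 : ContDiff ℝ 1 Φ₁)
    (hΦ₁d0 : ∀ t, t ≤ 1 / 2 → deriv Φ₁ t = 0)
    (hΦ₁nn : ∀ t, 0 < t → 0 ≤ Φ₁ t) (hΦ₁bd : ∀ t, 0 < t → Φ₁ t ≤ (2 : ℝ) ^ β)
    (hΦ₁two : ∀ t, 2 * (1 / 2) ≤ t → Φ₁ t = (t / (1 / 2) / 2) ^ (-β))
    (hΦ₁sign : ∀ t, -(2 * β) * Φ₁ t - 2 * t * deriv Φ₁ t ≤ 0)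
    (hΦ₁zero : ∀ t, 2 * (1 / 2) ≤ t → -(2 * β) * Φ₁ t - 2 * t * deriv Φ₁ t = 0)
    (hΦ₁low : ∀ t, -K₁ ≤ -(2 * β) * Φ₁ t - 2 * t * deriv Φ₁ t)
    (hΦ₁dec : ∀ t, 1 / 2 ≤ t → |deriv Φ₁ t| * t ≤ K₂) {L : ℝ} (hL : 4 ≤ L) :
    ∫ y in {y : EuclideanSpace ℝ (Fin 3) | L ^ 2 / 16 ≤ ‖y‖ ^ 2 ∧ ‖y‖ ^ 2 ≤ L ^ 2 / 4},
        ‖U y‖ ^ 2 ≤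
      8 * L ^ (3 - 2 * α) * (K₁ * (∫ y in closedBall (0 : EuclideanSpace ℝ (Fin 3)) 1, ‖U y‖ ^ 2) +
        (1 + α) * ((4 * K₂ + (2 : ℝ) ^ (β + 2) / L ^ 2) *
            (∫ y in closedBall (0 : EuclideanSpace ℝ (Fin 3)) 1,
              (‖U y‖ ^ 3 + 2 * (|P y| * ‖U y‖))) +
          2 * β * (∫ y in {y : EuclideanSpace ℝ (Fin 3) | 1 ≤ ‖y‖ ∧ ‖y‖ ≤ L},
            (‖y‖ ^ 2) ^ (-β) / ‖y‖ * (‖U y‖ ^ 3 + 2 * (|P y| * ‖U y‖))) +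
          4 / L ^ 2 * (∫ y in {y : EuclideanSpace ℝ (Fin 3) | 1 ≤ ‖y‖ ∧ ‖y‖ ≤ L},
            (‖y‖ ^ 2) ^ (-β) * ‖y‖ * (‖U y‖ ^ 3 + 2 * (|P y| * ‖U y‖))))) := by
  have hα0 : α + 1 ≠ 0 := by
    intro h0
    linarith
  have hK₁ : 0 ≤ K₁ := by linarith [hΦ₁low 0, hΦ₁sign 0]
  have hUc : Continuous U := h.contDiff_velocity.continuous
  have hL0 : 0 < L := by linarith
  have hL2 : (2 : ℝ) ≤ L := by linarith
  have hb : 0 < L ^ 2 := by positivity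
  have hb16 : (16 : ℝ) ≤ L ^ 2 := by nlinarith
  obtain ⟨Φ₂, hΦ₂1, hΦ₂zero, hΦ₂nn, hΦ₂le, hΦ₂d0, hΦ₂dle, hΦ₂d_b, hΦ₂low⟩ := exists_polyCut hb
  have hΦ1 : ContDiff ℝ 1 (fun t => Φ₁ t * Φ₂ t) := hΦ₁1.mul hΦ₂1
  have hΦT : ∀ t, L ^ 2 ≤ t → (fun t => Φ₁ t * Φ₂ t) t = 0 := fun t ht => by
    simp only [hΦ₂zero t ht, mul_zero]
  have hΦd : ∀ t, deriv (fun t => Φ₁ t * Φ₂ t) t = deriv Φ₁ t * Φ₂ t + Φ₁ t * deriv Φ₂ t :=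
    fun t => ((((hΦ₁1.differentiable one_ne_zero) t).hasDerivAt).mul
      (((hΦ₂1.differentiable one_ne_zero) t).hasDerivAt)).deriv
  have key := h.localEnergy_identity_radial hα0 hΦ1 hΦT
  beta_reduce at key
  rw [show 2 * α - 3 = -(2 * β) by rw [hβ]; ring] at key
  -- names
  have hf0 : ∀ y : EuclideanSpace ℝ (Fin 3), 0 ≤ ‖U y‖ ^ 3 + 2 * (|P y| * ‖U y‖) := fun y => by
    positivity
  set A : Set (EuclideanSpace ℝ (Fin 3)) :=
    {y | L ^ 2 / 16 ≤ ‖y‖ ^ 2 ∧ ‖y‖ ^ 2 ≤ L ^ 2 / 4} with hA_def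
  set S : Set (EuclideanSpace ℝ (Fin 3)) := {y : EuclideanSpace ℝ (Fin 3) | 1 ≤ ‖y‖ ∧ ‖y‖ ≤ L}
    with hS_def
  -- pointwise bounds
  have hQ1 := window_Q1 U hb16 hβ0 hΦ₁nn hΦ₁two hΦ₁sign hΦ₁zero hΦ₁low hΦ₂nn hΦ₂le hΦ₂d0
    hΦ₂low hΦd
  have hQ2 := window_Q2_weighted U P hL2 hβ0 hK₂ hΦ₁d0 hΦ₁dec hΦ₁nn hΦ₁bd hΦ₁two hΦ₁zero
    hΦ₂nn hΦ₂le hΦ₂dle hΦ₂d_b hΦ₂zero hΦd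
  -- measurability / integrability
  have hAmeas : MeasurableSet A :=
    (isClosed_le continuous_const (continuous_norm.pow 2)).measurableSet.inter
      (isClosed_le (continuous_norm.pow 2) continuous_const).measurableSet
  have hSmeas : MeasurableSet S :=
    (isClosed_le continuous_const continuous_norm).measurableSet.inter
      (isClosed_le continuous_norm continuous_const).measurableSet
  have hKL : IsCompact (closedBall (0 : EuclideanSpace ℝ (Fin 3)) L) := isCompact_closedBall _ _
  have hAsub : A ⊆ closedBall (0 : EuclideanSpace ℝ (Fin 3)) L := fun y hy => by
    rw [mem_closedBall_zero_iff]
    have h2 : ‖y‖ ^ 2 ≤ L ^ 2 := by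
      have := hy.2
      nlinarith [sq_nonneg L]
    exact (pow_le_pow_iff_left₀ (norm_nonneg _) hL0.le two_ne_zero).1 h2
  have hSsub : S ⊆ closedBall (0 : EuclideanSpace ℝ (Fin 3)) L := fun y hy => by
    rw [mem_closedBall_zero_iff]
    exact hy.2
  have hcore_sub : closedBall (0 : EuclideanSpace ℝ (Fin 3)) 1 ⊆ closedBall 0 L :=
    closedBall_subset_closedBall (by linarith)
  have hsuppL : ∀ {g : EuclideanSpace ℝ (Fin 3) → ℝ}, (∀ y, L ^ 2 ≤ ‖y‖ ^ 2 → g y = 0) →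
      HasCompactSupport g := by
    intro g hg
    refine HasCompactSupport.intro hKL fun y hy => hg y ?_
    rw [mem_closedBall_zero_iff, not_le] at hy
    exact pow_le_pow_left₀ hL0.le hy.le 2
  have hderiv_b : ∀ t, L ^ 2 ≤ t → deriv (fun t => Φ₁ t * Φ₂ t) t = 0 := by
    intro t ht
    rw [hΦd t, hΦ₂d_b t ht, hΦ₂zero t ht]
    ring
  have hiL : Integrable (fun y : EuclideanSpace ℝ (Fin 3) =>
      ((-(2 * β)) * (Φ₁ (‖y‖ ^ 2) * Φ₂ (‖y‖ ^ 2)) -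
        2 * ‖y‖ ^ 2 * deriv (fun t => Φ₁ t * Φ₂ t) (‖y‖ ^ 2)) * ‖U y‖ ^ 2) := by
    have hc1 : Continuous fun y : EuclideanSpace ℝ (Fin 3) => Φ₁ (‖y‖ ^ 2) * Φ₂ (‖y‖ ^ 2) :=
      hΦ1.continuous.comp (continuous_norm.pow 2)
    have hc2 : Continuous fun y : EuclideanSpace ℝ (Fin 3) =>
        deriv (fun t => Φ₁ t * Φ₂ t) (‖y‖ ^ 2) :=
      hΦ1.continuous_deriv_one.comp (continuous_norm.pow 2)
    refine (((continuous_const.mul hc1).sub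
      ((continuous_const.mul (continuous_norm.pow 2)).mul hc2)).mul (hUc.norm.pow 2))
      |>.integrable_of_hasCompactSupport (hsuppL fun y hy => ?_)
    simp only [Pi.mul_apply, Pi.sub_apply, Pi.pow_apply]
    rw [hderiv_b _ hy, hΦ₂zero _ hy]
    ring
  have hint_ball : ∀ (s : Set (EuclideanSpace ℝ (Fin 3))), s ⊆ closedBall 0 L → MeasurableSet s →
      Integrable (fun y => s.indicator (fun y => ‖U y‖ ^ 2) y)
        (volume : Measure (EuclideanSpace ℝ (Fin 3))) := fun s hs hsm =>
    (((hUc.norm.pow 2).continuousOn.integrableOn_compact hKL).mono_set hs).integrable_indicator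
      hsm
  have hiQ : Integrable (fun y => -K₁ * (closedBall (0 : EuclideanSpace ℝ (Fin 3)) 1).indicator
      (fun y => ‖U y‖ ^ 2) y + 1 / 8 * (L ^ 2 / 4) ^ (-β) * A.indicator (fun y => ‖U y‖ ^ 2) y)
      (volume : Measure (EuclideanSpace ℝ (Fin 3))) :=
    ((hint_ball _ hcore_sub measurableSet_closedBall).const_mul _).add
      ((hint_ball _ hAsub hAmeas).const_mul _)
  -- integrate Q1
  have hI1 : -K₁ * (∫ y in closedBall (0 : EuclideanSpace ℝ (Fin 3)) 1, ‖U y‖ ^ 2) +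
      1 / 8 * (L ^ 2 / 4) ^ (-β) * ∫ y in A, ‖U y‖ ^ 2 ≤
      ∫ y : EuclideanSpace ℝ (Fin 3), ((-(2 * β)) * (Φ₁ (‖y‖ ^ 2) * Φ₂ (‖y‖ ^ 2)) -
        2 * ‖y‖ ^ 2 * deriv (fun t => Φ₁ t * Φ₂ t) (‖y‖ ^ 2)) * ‖U y‖ ^ 2 := by
    rw [← integral_indicator measurableSet_closedBall, ← integral_indicator hAmeas,
      ← integral_const_mul, ← integral_const_mul,
      ← integral_add ((hint_ball _ hcore_sub measurableSet_closedBall).const_mul _)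
        ((hint_ball _ hAsub hAmeas).const_mul _)]
    exact integral_mono hiQ hiL hQ1
  -- the flux: integrability of the local pieces
  have hfi : IntegrableOn (fun y => ‖U y‖ ^ 3 + 2 * (|P y| * ‖U y‖))
      (closedBall (0 : EuclideanSpace ℝ (Fin 3)) L) volume := by
    have h1 : IntegrableOn (fun y => ‖U y‖ ^ 3) (closedBall (0 : EuclideanSpace ℝ (Fin 3)) L)
        volume := (hUc.norm.pow 3).continuousOn.integrableOn_compact hKL
    have hPi : IntegrableOn (fun y => |P y|) (closedBall (0 : EuclideanSpace ℝ (Fin 3)) L)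
        volume := (hPloc.integrableOn_isCompact hKL).norm
    have h2 : IntegrableOn (fun y => |P y| * ‖U y‖) (closedBall (0 : EuclideanSpace ℝ (Fin 3)) L)
        volume := hPi.mul_continuousOn hUc.norm.continuousOn hKL
    exact h1.add (h2.const_mul 2)
  have hw1c : ContinuousOn (fun y : EuclideanSpace ℝ (Fin 3) => (‖y‖ ^ 2) ^ (-β) / ‖y‖) S := by
    refine ContinuousOn.div ?_ continuous_norm.continuousOn fun y hy => ?_
    · exact ContinuousOn.rpow_const (continuous_norm.pow 2).continuousOn fun y hy =>
        Or.inl (by have := hy.1; positivity)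
    · have := hy.1
      positivity
  have hw2c : ContinuousOn (fun y : EuclideanSpace ℝ (Fin 3) => (‖y‖ ^ 2) ^ (-β) * ‖y‖) S := by
    refine ContinuousOn.mul ?_ continuous_norm.continuousOn
    exact ContinuousOn.rpow_const (continuous_norm.pow 2).continuousOn fun y hy =>
      Or.inl (by have := hy.1; positivity)
  have hKS : IsCompact S := by
    refine (hKL.of_isClosed_subset ?_ hSsub)
    exact (isClosed_le continuous_const continuous_norm).inter
      (isClosed_le continuous_norm continuous_const)
  have hJ1i : IntegrableOn (fun y => (‖y‖ ^ 2) ^ (-β) / ‖y‖ * (‖U y‖ ^ 3 + 2 * (|P y| * ‖U y‖))) S volume :=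
    (hfi.mono_set hSsub).continuousOn_mul hw1c hKS
  have hJ2i : IntegrableOn (fun y => (‖y‖ ^ 2) ^ (-β) * ‖y‖ * (‖U y‖ ^ 3 + 2 * (|P y| * ‖U y‖))) S volume :=
    (hfi.mono_set hSsub).continuousOn_mul hw2c hKS
  have hF1i : IntegrableOn (fun y => ‖U y‖ ^ 3 + 2 * (|P y| * ‖U y‖))
      (closedBall (0 : EuclideanSpace ℝ (Fin 3)) 1) volume := hfi.mono_set hcore_sub
  -- the dominating function
  have hI₁ : Integrable (fun y => (4 * K₂ + (2 : ℝ) ^ (β + 2) / L ^ 2) *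
      (closedBall (0 : EuclideanSpace ℝ (Fin 3)) 1).indicator (fun y => (‖U y‖ ^ 3 + 2 * (|P y| * ‖U y‖))) y)
      (volume : Measure (EuclideanSpace ℝ (Fin 3))) :=
    (hF1i.integrable_indicator measurableSet_closedBall).const_mul _
  have hI₂ : Integrable (fun y => 2 * β *
      S.indicator (fun y => (‖y‖ ^ 2) ^ (-β) / ‖y‖ * (‖U y‖ ^ 3 + 2 * (|P y| * ‖U y‖))) y)
      (volume : Measure (EuclideanSpace ℝ (Fin 3))) :=
    (hJ1i.integrable_indicator hSmeas).const_mul _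
  have hI₃ : Integrable (fun y => 4 / L ^ 2 *
      S.indicator (fun y => (‖y‖ ^ 2) ^ (-β) * ‖y‖ * (‖U y‖ ^ 3 + 2 * (|P y| * ‖U y‖))) y)
      (volume : Measure (EuclideanSpace ℝ (Fin 3))) :=
    (hJ2i.integrable_indicator hSmeas).const_mul _
  have hI₁₂ : Integrable (fun y => (4 * K₂ + (2 : ℝ) ^ (β + 2) / L ^ 2) *
      (closedBall (0 : EuclideanSpace ℝ (Fin 3)) 1).indicator (fun y => (‖U y‖ ^ 3 + 2 * (|P y| * ‖U y‖))) y +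
      2 * β * S.indicator (fun y => (‖y‖ ^ 2) ^ (-β) / ‖y‖ * (‖U y‖ ^ 3 + 2 * (|P y| * ‖U y‖))) y)
      (volume : Measure (EuclideanSpace ℝ (Fin 3))) := hI₁.add hI₂
  have hGi : Integrable (fun y => ((4 * K₂ + (2 : ℝ) ^ (β + 2) / L ^ 2) *
        (closedBall (0 : EuclideanSpace ℝ (Fin 3)) 1).indicator
          (fun y => (‖U y‖ ^ 3 + 2 * (|P y| * ‖U y‖))) y +
      2 * β * S.indicator (fun y => (‖y‖ ^ 2) ^ (-β) / ‖y‖ * (‖U y‖ ^ 3 + 2 * (|P y| * ‖U y‖))) y +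
      4 / L ^ 2 * S.indicator (fun y => (‖y‖ ^ 2) ^ (-β) * ‖y‖ * (‖U y‖ ^ 3 + 2 * (|P y| * ‖U y‖))) y))
      (volume : Measure (EuclideanSpace ℝ (Fin 3))) := hI₁₂.add hI₃
  have hGint : ∫ y, ((4 * K₂ + (2 : ℝ) ^ (β + 2) / L ^ 2) *
        (closedBall (0 : EuclideanSpace ℝ (Fin 3)) 1).indicator
          (fun y => (‖U y‖ ^ 3 + 2 * (|P y| * ‖U y‖))) y +
      2 * β * S.indicator (fun y => (‖y‖ ^ 2) ^ (-β) / ‖y‖ * (‖U y‖ ^ 3 + 2 * (|P y| * ‖U y‖))) y +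
      4 / L ^ 2 * S.indicator (fun y => (‖y‖ ^ 2) ^ (-β) * ‖y‖ * (‖U y‖ ^ 3 + 2 * (|P y| * ‖U y‖))) y) =
      (4 * K₂ + (2 : ℝ) ^ (β + 2) / L ^ 2) *
        (∫ y in closedBall (0 : EuclideanSpace ℝ (Fin 3)) 1, (‖U y‖ ^ 3 + 2 * (|P y| * ‖U y‖))) +
      2 * β * (∫ y in S, (‖y‖ ^ 2) ^ (-β) / ‖y‖ * (‖U y‖ ^ 3 + 2 * (|P y| * ‖U y‖))) +
      4 / L ^ 2 * (∫ y in S, (‖y‖ ^ 2) ^ (-β) * ‖y‖ * (‖U y‖ ^ 3 + 2 * (|P y| * ‖U y‖))) := by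
    rw [integral_add hI₁₂ hI₃, integral_add hI₁ hI₂, integral_const_mul, integral_const_mul,
      integral_const_mul, integral_indicator measurableSet_closedBall, integral_indicator hSmeas,
      integral_indicator hSmeas]
  -- the flux integrand is integrable (supported in `|y| ≤ L`) and dominated
  have hFi : Integrable (fun y => (‖U y‖ ^ 2 + 2 * P y) *
      (2 * deriv (fun t => Φ₁ t * Φ₂ t) (‖y‖ ^ 2) * ⟪y, U y⟫))
      (volume : Measure (EuclideanSpace ℝ (Fin 3))) := by
    have hg : Continuous fun y : EuclideanSpace ℝ (Fin 3) =>
        2 * deriv (fun t => Φ₁ t * Φ₂ t) (‖y‖ ^ 2) * ⟪y, U y⟫ :=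
      (continuous_const.mul (hΦ1.continuous_deriv_one.comp (continuous_norm.pow 2))).mul
        (continuous_id.inner hUc)
    have h1 : IntegrableOn (fun y => ‖U y‖ ^ 2 + 2 * P y)
        (closedBall (0 : EuclideanSpace ℝ (Fin 3)) L) volume :=
      ((hUc.norm.pow 2).continuousOn.integrableOn_compact hKL).add
        ((hPloc.integrableOn_isCompact hKL).const_mul 2)
    refine (h1.mul_continuousOn hg.continuousOn hKL).integrable_of_forall_notMem_eq_zero
      fun y hy => ?_
    rw [mem_closedBall_zero_iff, not_le] at hy
    have hyb : L ^ 2 ≤ ‖y‖ ^ 2 := pow_le_pow_left₀ hL0.le hy.le 2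
    rw [hderiv_b _ hyb]
    ring
  have hup : ‖∫ y, (‖U y‖ ^ 2 + 2 * P y) *
        (2 * deriv (fun t => Φ₁ t * Φ₂ t) (‖y‖ ^ 2) * ⟪y, U y⟫)‖ ≤ ∫ y, ((4 * K₂ + (2 : ℝ) ^ (β + 2) / L ^ 2) *
        (closedBall (0 : EuclideanSpace ℝ (Fin 3)) 1).indicator
          (fun y => (‖U y‖ ^ 3 + 2 * (|P y| * ‖U y‖))) y +
      2 * β * S.indicator (fun y => (‖y‖ ^ 2) ^ (-β) / ‖y‖ * (‖U y‖ ^ 3 + 2 * (|P y| * ‖U y‖))) y +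
      4 / L ^ 2 * S.indicator (fun y => (‖y‖ ^ 2) ^ (-β) * ‖y‖ * (‖U y‖ ^ 3 + 2 * (|P y| * ‖U y‖))) y) :=
    norm_integral_le_of_norm_le hGi (Eventually.of_forall hQ2)
  have hα' : 0 ≤ 1 + α := by linarith
  have hEcore : 0 ≤ ∫ y in closedBall (0 : EuclideanSpace ℝ (Fin 3)) 1, ‖U y‖ ^ 2 :=
    integral_nonneg fun y => by positivity
  have hmain : 1 / 8 * (L ^ 2 / 4) ^ (-β) * ∫ y in A, ‖U y‖ ^ 2 ≤
      K₁ * (∫ y in closedBall (0 : EuclideanSpace ℝ (Fin 3)) 1, ‖U y‖ ^ 2) +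
        (1 + α) * ∫ y, ((4 * K₂ + (2 : ℝ) ^ (β + 2) / L ^ 2) *
        (closedBall (0 : EuclideanSpace ℝ (Fin 3)) 1).indicator
          (fun y => (‖U y‖ ^ 3 + 2 * (|P y| * ‖U y‖))) y +
      2 * β * S.indicator (fun y => (‖y‖ ^ 2) ^ (-β) / ‖y‖ * (‖U y‖ ^ 3 + 2 * (|P y| * ‖U y‖))) y +
      4 / L ^ 2 * S.indicator (fun y => (‖y‖ ^ 2) ^ (-β) * ‖y‖ * (‖U y‖ ^ 3 + 2 * (|P y| * ‖U y‖))) y) := by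
    have h2 : (1 + α) * ∫ y, (‖U y‖ ^ 2 + 2 * P y) *
        (2 * deriv (fun t => Φ₁ t * Φ₂ t) (‖y‖ ^ 2) * ⟪y, U y⟫) ≤ (1 + α) * ∫ y, ((4 * K₂ + (2 : ℝ) ^ (β + 2) / L ^ 2) *
        (closedBall (0 : EuclideanSpace ℝ (Fin 3)) 1).indicator
          (fun y => (‖U y‖ ^ 3 + 2 * (|P y| * ‖U y‖))) y +
      2 * β * S.indicator (fun y => (‖y‖ ^ 2) ^ (-β) / ‖y‖ * (‖U y‖ ^ 3 + 2 * (|P y| * ‖U y‖))) y +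
      4 / L ^ 2 * S.indicator (fun y => (‖y‖ ^ 2) ^ (-β) * ‖y‖ * (‖U y‖ ^ 3 + 2 * (|P y| * ‖U y‖))) y) :=
      mul_le_mul_of_nonneg_left ((Real.le_norm_self _).trans hup) hα'
    linarith [hI1, key, h2]
  -- solve for the annular energy
  have hw : 0 < (L ^ 2 / 4) ^ (-β) := Real.rpow_pos_of_pos (by positivity) _
  have hwinv : ((L ^ 2 / 4) ^ (-β))⁻¹ = (L ^ 2 / 4) ^ β := by
    rw [Real.rpow_neg (by positivity), inv_inv]
  have hpow : (L ^ 2 / 4) ^ β ≤ L ^ (3 - 2 * α) := by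
    calc (L ^ 2 / 4) ^ β ≤ (L ^ 2) ^ β := Real.rpow_le_rpow (by positivity) (by linarith) hβ0
      _ = L ^ (3 - 2 * α) := by
          rw [← Real.rpow_natCast, ← Real.rpow_mul hL0.le]
          congr 1
          rw [hβ]
          push_cast
          ring
  have hX0 : 0 ≤ ∫ y in A, ‖U y‖ ^ 2 := integral_nonneg fun y => by positivity
  have hG0 : 0 ≤ ∫ y, ((4 * K₂ + (2 : ℝ) ^ (β + 2) / L ^ 2) *
        (closedBall (0 : EuclideanSpace ℝ (Fin 3)) 1).indicator
          (fun y => (‖U y‖ ^ 3 + 2 * (|P y| * ‖U y‖))) y +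
      2 * β * S.indicator (fun y => (‖y‖ ^ 2) ^ (-β) / ‖y‖ * (‖U y‖ ^ 3 + 2 * (|P y| * ‖U y‖))) y +
      4 / L ^ 2 * S.indicator (fun y => (‖y‖ ^ 2) ^ (-β) * ‖y‖ * (‖U y‖ ^ 3 + 2 * (|P y| * ‖U y‖))) y) := integral_nonneg fun y => by
    have h1 : 0 ≤ (closedBall (0 : EuclideanSpace ℝ (Fin 3)) 1).indicator
        (fun y => (‖U y‖ ^ 3 + 2 * (|P y| * ‖U y‖))) y := indicator_nonneg (fun z _ => hf0 z) _
    have h2 : 0 ≤ S.indicator (fun y => (‖y‖ ^ 2) ^ (-β) / ‖y‖ * (‖U y‖ ^ 3 + 2 * (|P y| * ‖U y‖))) y :=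
      indicator_nonneg (fun z _ => by positivity) _
    have h3 : 0 ≤ S.indicator (fun y => (‖y‖ ^ 2) ^ (-β) * ‖y‖ * (‖U y‖ ^ 3 + 2 * (|P y| * ‖U y‖))) y :=
      indicator_nonneg (fun z _ => by positivity) _
    positivity
  have hM0 : 0 ≤ K₁ * (∫ y in closedBall (0 : EuclideanSpace ℝ (Fin 3)) 1, ‖U y‖ ^ 2) +
      (1 + α) * ∫ y, ((4 * K₂ + (2 : ℝ) ^ (β + 2) / L ^ 2) *
        (closedBall (0 : EuclideanSpace ℝ (Fin 3)) 1).indicator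
          (fun y => (‖U y‖ ^ 3 + 2 * (|P y| * ‖U y‖))) y +
      2 * β * S.indicator (fun y => (‖y‖ ^ 2) ^ (-β) / ‖y‖ * (‖U y‖ ^ 3 + 2 * (|P y| * ‖U y‖))) y +
      4 / L ^ 2 * S.indicator (fun y => (‖y‖ ^ 2) ^ (-β) * ‖y‖ * (‖U y‖ ^ 3 + 2 * (|P y| * ‖U y‖))) y) := by positivity
  calc ∫ y in A, ‖U y‖ ^ 2
      = 8 * (L ^ 2 / 4) ^ β * (1 / 8 * (L ^ 2 / 4) ^ (-β) * ∫ y in A, ‖U y‖ ^ 2) := by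
        rw [← hwinv]
        field_simp
    _ ≤ 8 * (L ^ 2 / 4) ^ β *
          (K₁ * (∫ y in closedBall (0 : EuclideanSpace ℝ (Fin 3)) 1, ‖U y‖ ^ 2) +
            (1 + α) * ∫ y, ((4 * K₂ + (2 : ℝ) ^ (β + 2) / L ^ 2) *
        (closedBall (0 : EuclideanSpace ℝ (Fin 3)) 1).indicator
          (fun y => (‖U y‖ ^ 3 + 2 * (|P y| * ‖U y‖))) y +
      2 * β * S.indicator (fun y => (‖y‖ ^ 2) ^ (-β) / ‖y‖ * (‖U y‖ ^ 3 + 2 * (|P y| * ‖U y‖))) y +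
      4 / L ^ 2 * S.indicator (fun y => (‖y‖ ^ 2) ^ (-β) * ‖y‖ * (‖U y‖ ^ 3 + 2 * (|P y| * ‖U y‖))) y)) := by gcongr
    _ ≤ 8 * L ^ (3 - 2 * α) *
          (K₁ * (∫ y in closedBall (0 : EuclideanSpace ℝ (Fin 3)) 1, ‖U y‖ ^ 2) +
            (1 + α) * ∫ y, ((4 * K₂ + (2 : ℝ) ^ (β + 2) / L ^ 2) *
        (closedBall (0 : EuclideanSpace ℝ (Fin 3)) 1).indicator
          (fun y => (‖U y‖ ^ 3 + 2 * (|P y| * ‖U y‖))) y +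
      2 * β * S.indicator (fun y => (‖y‖ ^ 2) ^ (-β) / ‖y‖ * (‖U y‖ ^ 3 + 2 * (|P y| * ‖U y‖))) y +
      4 / L ^ 2 * S.indicator (fun y => (‖y‖ ^ 2) ^ (-β) * ‖y‖ * (‖U y‖ ^ 3 + 2 * (|P y| * ‖U y‖))) y)) := by gcongr
    _ = _ := by rw [hGint]

/-! ## The unified annular bound (both `β > 0` and the endpoint `β = 0`) -/

/-- **The annular bound, unified form.** For `−1 < α ≤ 3/2` there is `A ≥ 0` with, for `L ≥ 4`,
`∫_{L/4≤|y|≤L/2}|U|² ≤ A[(3/2−α) L^{3−2α}(1 + J₁(L)) + L^{3−2α}L^{−2}(1 + J₂(L))]`,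
`J₁(L) = ∫_{1≤|y|≤L}(|y|²)^{α−3/2}|y|^{−1} f`, `J₂(L) = ∫_{1≤|y|≤L}(|y|²)^{α−3/2}|y| f`
(`β > 0`: the inner profile `ψ_β`; `β = 0`: `Φ₁ ≡ 1`, and the bound decays like `L^{−2}`).
[cite: ChaeShvydkoy2013, §3.2.2–3.2.3, display before (3.17)] -/
theorem IsSelfSimilarEulerProfile.annular_energy_le_weightedFlux {α : ℝ}
    {U : EuclideanSpace ℝ (Fin 3) → EuclideanSpace ℝ (Fin 3)} {P : EuclideanSpace ℝ (Fin 3) → ℝ}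
    (h : IsSelfSimilarEulerProfile (1 / (α + 1)) 0 U P) (hα : -1 < α) (hα2 : α ≤ 3 / 2)
    (hPloc : LocallyIntegrable P volume) :
    ∃ A : ℝ, 0 ≤ A ∧ ∀ L : ℝ, 4 ≤ L →
      ∫ y in {y : EuclideanSpace ℝ (Fin 3) | L ^ 2 / 16 ≤ ‖y‖ ^ 2 ∧ ‖y‖ ^ 2 ≤ L ^ 2 / 4},
          ‖U y‖ ^ 2 ≤
        A * ((3 / 2 - α) * L ^ (3 - 2 * α) *
            (1 + ∫ y in {y : EuclideanSpace ℝ (Fin 3) | 1 ≤ ‖y‖ ∧ ‖y‖ ≤ L},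
              (‖y‖ ^ 2) ^ (-(3 / 2 - α)) / ‖y‖ * (‖U y‖ ^ 3 + 2 * (|P y| * ‖U y‖))) +
          L ^ (3 - 2 * α) / L ^ 2 *
            (1 + ∫ y in {y : EuclideanSpace ℝ (Fin 3) | 1 ≤ ‖y‖ ∧ ‖y‖ ≤ L},
              (‖y‖ ^ 2) ^ (-(3 / 2 - α)) * ‖y‖ * (‖U y‖ ^ 3 + 2 * (|P y| * ‖U y‖)))) := by
  have hβ0 : 0 ≤ 3 / 2 - α := by linarith
  have hα' : 0 ≤ 1 + α := by linarith
  have hUc : Continuous U := h.contDiff_velocity.continuous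
  have hF₁ : 0 ≤ ∫ y in closedBall (0 : EuclideanSpace ℝ (Fin 3)) 1,
      (‖U y‖ ^ 3 + 2 * (|P y| * ‖U y‖)) := integral_nonneg fun y => by positivity
  have hE₁ : 0 ≤ ∫ y in closedBall (0 : EuclideanSpace ℝ (Fin 3)) 1, ‖U y‖ ^ 2 :=
    integral_nonneg fun y => by positivity
  rcases eq_or_lt_of_le hβ0 with hz | hpos
  · -- the endpoint `β = 0`: `Φ₁ ≡ 1`
    refine ⟨32 * (1 + α) * max 1 (∫ y in closedBall (0 : EuclideanSpace ℝ (Fin 3)) 1,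
      (‖U y‖ ^ 3 + 2 * (|P y| * ‖U y‖))), by positivity, fun L hL => ?_⟩
    have hL1 : (1 : ℝ) ≤ L ^ 2 := by nlinarith
    have core := h.annular_energy_le_weightedFlux_core (β := 3 / 2 - α) (K₁ := 0) (K₂ := 0)
      (Φ₁ := fun _ => (1 : ℝ)) hα rfl hβ0 hPloc le_rfl contDiff_const
      (fun t _ => deriv_const t 1) (fun t _ => zero_le_one)
      (fun t _ => by rw [← hz, Real.rpow_zero])
      (fun t _ => by rw [← hz, neg_zero, Real.rpow_zero])
      (fun t => by rw [← hz, deriv_const]; norm_num)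
      (fun t _ => by rw [← hz, deriv_const]; norm_num)
      (fun t => by rw [← hz, deriv_const]; norm_num)
      (fun t _ => by rw [deriv_const, abs_zero, zero_mul]) hL
    rw [← hz] at core ⊢
    rw [zero_add, show ((2 : ℝ) ^ (2 : ℝ)) = 4 by norm_num] at core
    set J₂ : ℝ := ∫ y in {y : EuclideanSpace ℝ (Fin 3) | 1 ≤ ‖y‖ ∧ ‖y‖ ≤ L},
      (‖y‖ ^ 2) ^ (-(0 : ℝ)) * ‖y‖ * (‖U y‖ ^ 3 + 2 * (|P y| * ‖U y‖)) with hJ₂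
    set J₁ : ℝ := ∫ y in {y : EuclideanSpace ℝ (Fin 3) | 1 ≤ ‖y‖ ∧ ‖y‖ ≤ L},
      (‖y‖ ^ 2) ^ (-(0 : ℝ)) / ‖y‖ * (‖U y‖ ^ 3 + 2 * (|P y| * ‖U y‖)) with hJ₁
    set F₁ : ℝ := ∫ y in closedBall (0 : EuclideanSpace ℝ (Fin 3)) 1,
      (‖U y‖ ^ 3 + 2 * (|P y| * ‖U y‖)) with hF₁_def
    set E₁ : ℝ := ∫ y in closedBall (0 : EuclideanSpace ℝ (Fin 3)) 1, ‖U y‖ ^ 2 with hE₁_def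
    have hJ₂0 : 0 ≤ J₂ := integral_nonneg fun y => by positivity
    have hm1 : 1 ≤ max 1 F₁ := le_max_left _ _
    have hmF : F₁ ≤ max 1 F₁ := le_max_right _ _
    have hLt : 0 ≤ L ^ (3 - 2 * α) / L ^ 2 := by positivity
    have hsum : F₁ + J₂ ≤ max 1 F₁ * (1 + J₂) := by
      have := mul_nonneg (sub_nonneg.2 hm1) hJ₂0
      nlinarith
    have hc0 : 0 ≤ 32 * (1 + α) * (L ^ (3 - 2 * α) / L ^ 2) :=
      mul_nonneg (mul_nonneg (by norm_num) hα') hLt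
    calc ∫ y in {y : EuclideanSpace ℝ (Fin 3) | L ^ 2 / 16 ≤ ‖y‖ ^ 2 ∧ ‖y‖ ^ 2 ≤ L ^ 2 / 4},
          ‖U y‖ ^ 2
        ≤ 8 * L ^ (3 - 2 * α) * (0 * E₁ + (1 + α) * ((4 * 0 + 4 / L ^ 2) * F₁ + 2 * 0 * J₁ +
            4 / L ^ 2 * J₂)) := core
      _ = 32 * (1 + α) * (L ^ (3 - 2 * α) / L ^ 2) * (F₁ + J₂) := by ring
      _ ≤ 32 * (1 + α) * (L ^ (3 - 2 * α) / L ^ 2) * (max 1 F₁ * (1 + J₂)) :=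
          mul_le_mul_of_nonneg_left hsum hc0
      _ = 32 * (1 + α) * max 1 F₁ * (0 * L ^ (3 - 2 * α) * (1 + J₁) +
            L ^ (3 - 2 * α) / L ^ 2 * (1 + J₂)) := by ring
  · -- `β > 0`: the inner profile `ψ_β`
    obtain ⟨D, hD0, hD⟩ := Calculus.exists_bound_deriv_smoothTransition
    obtain ⟨Φ₁, hΦ₁1, hΦ₁d0, hΦ₁nn, hΦ₁bd, hΦ₁two, hΦ₁sign, hΦ₁zero, hΦ₁low, hΦ₁dec⟩ :=
      exists_innerCut₂ (β := 3 / 2 - α) (a := 1 / 2) hβ0 (by norm_num) hD0 hD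
    set β : ℝ := 3 / 2 - α with hβ_def
    set K₁ : ℝ := 2 * β + 4 * D * (2 : ℝ) ^ β with hK₁
    set K₂ : ℝ := (D + β) * (2 : ℝ) ^ (β + 1) with hK₂
    have hK₂0 : 0 ≤ K₂ := by positivity
    set F₁ : ℝ := ∫ y in closedBall (0 : EuclideanSpace ℝ (Fin 3)) 1,
      (‖U y‖ ^ 3 + 2 * (|P y| * ‖U y‖)) with hF₁_def
    set E₁ : ℝ := ∫ y in closedBall (0 : EuclideanSpace ℝ (Fin 3)) 1, ‖U y‖ ^ 2 with hE₁_def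
    have hK₁0 : 0 ≤ K₁ := by positivity
    set C₀ : ℝ := 8 * (K₁ * E₁ + (1 + α) * ((4 * K₂ + (2 : ℝ) ^ (β + 2)) * F₁)) with hC₀
    have hC₀0 : 0 ≤ C₀ :=
      mul_nonneg (by norm_num) (add_nonneg (mul_nonneg hK₁0 hE₁)
        (mul_nonneg hα' (mul_nonneg (by positivity) hF₁)))
    have hA0 : 0 ≤ C₀ / β + 32 * (1 + α) :=
      add_nonneg (div_nonneg hC₀0 hβ0) (mul_nonneg (by norm_num) hα')
    refine ⟨C₀ / β + 32 * (1 + α), hA0, fun L hL => ?_⟩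
    have hL0 : 0 < L := by linarith
    have hL1 : (1 : ℝ) ≤ L ^ 2 := by nlinarith
    have core := h.annular_energy_le_weightedFlux_core hα hβ_def hβ0 hPloc hK₂0 hΦ₁1 hΦ₁d0
      hΦ₁nn hΦ₁bd hΦ₁two hΦ₁sign hΦ₁zero hΦ₁low hΦ₁dec hL
    set J₁ : ℝ := ∫ y in {y : EuclideanSpace ℝ (Fin 3) | 1 ≤ ‖y‖ ∧ ‖y‖ ≤ L},
      (‖y‖ ^ 2) ^ (-β) / ‖y‖ * (‖U y‖ ^ 3 + 2 * (|P y| * ‖U y‖)) with hJ₁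
    set J₂ : ℝ := ∫ y in {y : EuclideanSpace ℝ (Fin 3) | 1 ≤ ‖y‖ ∧ ‖y‖ ≤ L},
      (‖y‖ ^ 2) ^ (-β) * ‖y‖ * (‖U y‖ ^ 3 + 2 * (|P y| * ‖U y‖)) with hJ₂
    have hJ₁0 : 0 ≤ J₁ := integral_nonneg fun y => by positivity
    have hJ₂0 : 0 ≤ J₂ := integral_nonneg fun y => by positivity
    have hLt : 0 ≤ L ^ (3 - 2 * α) := by positivity
    have hLt2 : 0 ≤ L ^ (3 - 2 * α) / L ^ 2 := by positivity
    have h1 : (4 * K₂ + (2 : ℝ) ^ (β + 2) / L ^ 2) * F₁ ≤ (4 * K₂ + (2 : ℝ) ^ (β + 2)) * F₁ :=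
      mul_le_mul_of_nonneg_right (by
        have : (2 : ℝ) ^ (β + 2) / L ^ 2 ≤ (2 : ℝ) ^ (β + 2) :=
          div_le_self (by positivity) hL1
        linarith) hF₁
    have hcore' : ∫ y in {y : EuclideanSpace ℝ (Fin 3) | L ^ 2 / 16 ≤ ‖y‖ ^ 2 ∧
        ‖y‖ ^ 2 ≤ L ^ 2 / 4}, ‖U y‖ ^ 2 ≤
        C₀ * L ^ (3 - 2 * α) + 16 * (1 + α) * (β * L ^ (3 - 2 * α) * J₁) +
          32 * (1 + α) * (L ^ (3 - 2 * α) / L ^ 2 * J₂) := by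
      refine core.trans ?_
      have h2 : 8 * L ^ (3 - 2 * α) * (K₁ * E₁ + (1 + α) * ((4 * K₂ + (2 : ℝ) ^ (β + 2) / L ^ 2) *
          F₁ + 2 * β * J₁ + 4 / L ^ 2 * J₂)) ≤ 8 * L ^ (3 - 2 * α) * (K₁ * E₁ + (1 + α) *
          ((4 * K₂ + (2 : ℝ) ^ (β + 2)) * F₁ + 2 * β * J₁ + 4 / L ^ 2 * J₂)) :=
        mul_le_mul_of_nonneg_left (add_le_add le_rfl (mul_le_mul_of_nonneg_left
          (add_le_add (add_le_add h1 le_rfl) le_rfl) hα')) (by positivity)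
      refine h2.trans (le_of_eq ?_)
      rw [hC₀]
      ring
    have hβne : β ≠ 0 := hpos.ne'
    have ha : C₀ * L ^ (3 - 2 * α) ≤ (C₀ / β + 32 * (1 + α)) * (β * L ^ (3 - 2 * α)) := by
      have e : C₀ * L ^ (3 - 2 * α) = C₀ / β * (β * L ^ (3 - 2 * α)) := by
        field_simp
      rw [e]
      exact mul_le_mul_of_nonneg_right (le_add_of_nonneg_right (mul_nonneg (by norm_num) hα'))
        (mul_nonneg hβ0 hLt)
    have hb : 16 * (1 + α) * (β * L ^ (3 - 2 * α) * J₁) ≤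
        (C₀ / β + 32 * (1 + α)) * (β * L ^ (3 - 2 * α) * J₁) :=
      mul_le_mul_of_nonneg_right (by
        have : 0 ≤ C₀ / β := div_nonneg hC₀0 hβ0
        nlinarith) (mul_nonneg (mul_nonneg hβ0 hLt) hJ₁0)
    have hc : 32 * (1 + α) * (L ^ (3 - 2 * α) / L ^ 2 * J₂) ≤
        (C₀ / β + 32 * (1 + α)) * (L ^ (3 - 2 * α) / L ^ 2 * J₂) :=
      mul_le_mul_of_nonneg_right (le_add_of_nonneg_left (div_nonneg hC₀0 hβ0))
        (mul_nonneg hLt2 hJ₂0)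
    have hd : 0 ≤ (C₀ / β + 32 * (1 + α)) * (L ^ (3 - 2 * α) / L ^ 2) := mul_nonneg hA0 hLt2
    linarith [hcore', ha, hb, hc, hd]

/-! ## Dyadic shell sums of the weighted local flux -/

/-- `(2^d)^N = (2^N)^d`. [folklore] -/
private theorem two_rpow_pow_comm (d : ℝ) (N : ℕ) : ((2 : ℝ) ^ d) ^ N = ((2 : ℝ) ^ N) ^ d := by
  rw [← Real.rpow_natCast, ← Real.rpow_mul (by norm_num), mul_comm, Real.rpow_mul (by norm_num),
    Real.rpow_natCast]

/-- **Shell summation from `|y| = 1` upwards.** If `w` is integrable on the truncated regions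
`{1 ≤ |y| < R}` and `∫_{ρ≤|y|<2ρ} w ≤ C ρ^d` for `ρ ≥ 1`, then
`∫_{1≤|y|<2^N} w ≤ C Σ_{k<N} (2^d)^k`. [folklore] -/
private theorem setIntegral_shells_le {w : EuclideanSpace ℝ (Fin 3) → ℝ} {C d : ℝ}
    (hw : ∀ R : ℝ, IntegrableOn w {y : EuclideanSpace ℝ (Fin 3) | 1 ≤ ‖y‖ ∧ ‖y‖ < R} volume)
    (hann : ∀ ρ : ℝ, 1 ≤ ρ →
      ∫ y in {y : EuclideanSpace ℝ (Fin 3) | ρ ≤ ‖y‖ ∧ ‖y‖ < 2 * ρ}, w y ≤ C * ρ ^ d) (N : ℕ) :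
    ∫ y in {y : EuclideanSpace ℝ (Fin 3) | 1 ≤ ‖y‖ ∧ ‖y‖ < (2 : ℝ) ^ N}, w y ≤
      C * ∑ k ∈ Finset.range N, ((2 : ℝ) ^ d) ^ k := by
  induction N with
  | zero =>
    have h0 : {y : EuclideanSpace ℝ (Fin 3) | 1 ≤ ‖y‖ ∧ ‖y‖ < (2 : ℝ) ^ 0} = ∅ := by
      ext y
      simp only [pow_zero, mem_setOf_eq, mem_empty_iff_false, iff_false, not_and, not_lt]
      exact fun h => h
    rw [h0, Measure.restrict_empty, integral_zero_measure]
    simp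
  | succ N ih =>
    set ρ : ℝ := 2 ^ N with hρ
    have hρ1 : 1 ≤ ρ := one_le_pow₀ (by norm_num)
    have hsplit : {y : EuclideanSpace ℝ (Fin 3) | 1 ≤ ‖y‖ ∧ ‖y‖ < (2 : ℝ) ^ (N + 1)} =
        {y : EuclideanSpace ℝ (Fin 3) | 1 ≤ ‖y‖ ∧ ‖y‖ < (2 : ℝ) ^ N} ∪
          {y : EuclideanSpace ℝ (Fin 3) | ρ ≤ ‖y‖ ∧ ‖y‖ < 2 * ρ} := by
      ext y
      simp only [mem_setOf_eq, mem_union, pow_succ, hρ]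
      constructor
      · rintro ⟨h1, h2⟩
        by_cases h3 : ‖y‖ < 2 ^ N
        · exact Or.inl ⟨h1, h3⟩
        · push Not at h3
          exact Or.inr ⟨h3, by linarith⟩
      · rintro (⟨h1, h2⟩ | ⟨h1, h2⟩)
        · refine ⟨h1, ?_⟩
          have : (0 : ℝ) < 2 ^ N := by positivity
          linarith
        · exact ⟨le_trans hρ1 h1, by linarith⟩
    have hdisj : Disjoint {y : EuclideanSpace ℝ (Fin 3) | 1 ≤ ‖y‖ ∧ ‖y‖ < (2 : ℝ) ^ N}
        {y : EuclideanSpace ℝ (Fin 3) | ρ ≤ ‖y‖ ∧ ‖y‖ < 2 * ρ} := by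
      rw [Set.disjoint_left]
      intro y hy hy'
      exact absurd hy.2 (not_lt.2 hy'.1)
    have hAm : MeasurableSet {y : EuclideanSpace ℝ (Fin 3) | ρ ≤ ‖y‖ ∧ ‖y‖ < 2 * ρ} :=
      (isClosed_le continuous_const continuous_norm).measurableSet.inter
        (isOpen_lt continuous_norm continuous_const).measurableSet
    have hsub1 : {y : EuclideanSpace ℝ (Fin 3) | 1 ≤ ‖y‖ ∧ ‖y‖ < (2 : ℝ) ^ N} ⊆
        {y : EuclideanSpace ℝ (Fin 3) | 1 ≤ ‖y‖ ∧ ‖y‖ < 2 * ρ} := fun y hy =>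
      ⟨hy.1, by have := hy.2; rw [hρ]; linarith [this]⟩
    have hsub2 : {y : EuclideanSpace ℝ (Fin 3) | ρ ≤ ‖y‖ ∧ ‖y‖ < 2 * ρ} ⊆
        {y : EuclideanSpace ℝ (Fin 3) | 1 ≤ ‖y‖ ∧ ‖y‖ < 2 * ρ} := fun y hy =>
      ⟨le_trans hρ1 hy.1, hy.2⟩
    rw [hsplit, setIntegral_union hdisj hAm ((hw (2 * ρ)).mono_set hsub1)
      ((hw (2 * ρ)).mono_set hsub2), Finset.sum_range_succ, mul_add]
    refine add_le_add ih ?_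
    have hA := hann ρ hρ1
    rwa [hρ, ← two_rpow_pow_comm] at hA

/-- **Geometric sums, ratio `< 1`.** [folklore] -/
private theorem geom_sum_two_rpow_le_of_neg {d : ℝ} (hd : d < 0) (N : ℕ) :
    ∑ k ∈ Finset.range N, ((2 : ℝ) ^ d) ^ k ≤ (1 - (2 : ℝ) ^ d)⁻¹ := by
  have hq1 : (2 : ℝ) ^ d < 1 := Real.rpow_lt_one_of_one_lt_of_neg (by norm_num) hd
  have hq0 : 0 < (2 : ℝ) ^ d := Real.rpow_pos_of_pos two_pos _
  rw [geom_sum_eq hq1.ne N]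
  have hqN : 0 ≤ ((2 : ℝ) ^ d) ^ N := pow_nonneg hq0.le N
  rw [show (((2 : ℝ) ^ d) ^ N - 1) / ((2 : ℝ) ^ d - 1) =
    (1 - ((2 : ℝ) ^ d) ^ N) * (1 - (2 : ℝ) ^ d)⁻¹ by
      rw [show ((2 : ℝ) ^ d) ^ N - 1 = -(1 - ((2 : ℝ) ^ d) ^ N) by ring,
        show (2 : ℝ) ^ d - 1 = -(1 - (2 : ℝ) ^ d) by ring, neg_div_neg_eq, div_eq_mul_inv]]
  exact mul_le_of_le_one_left (inv_nonneg.2 (by linarith)) (by linarith)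

/-- **Geometric sums, ratio `> 1`.** [folklore] -/
private theorem geom_sum_two_rpow_le_of_pos {d : ℝ} (hd : 0 < d) (N : ℕ) :
    ∑ k ∈ Finset.range N, ((2 : ℝ) ^ d) ^ k ≤ ((2 : ℝ) ^ d) ^ N / ((2 : ℝ) ^ d - 1) := by
  have hq1 : 1 < (2 : ℝ) ^ d := Real.one_lt_rpow (by norm_num) hd
  rw [geom_sum_eq hq1.ne' N]
  exact div_le_div_of_nonneg_right (by linarith) (by linarith)

/-- Monotonicity of geometric sums in the ratio. [folklore] -/
private theorem geom_sum_mono {q q' : ℝ} (hq : 0 ≤ q) (hqq' : q ≤ q') (N : ℕ) :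
    ∑ k ∈ Finset.range N, q ^ k ≤ ∑ k ∈ Finset.range N, q' ^ k :=
  Finset.sum_le_sum fun k _ => pow_le_pow_left₀ hq hqq' k

/-- **The shell sums of `J(L) = ∫_{1≤|y|≤L} w`.** With `N` such that `L < 2^N ≤ 2L`:
`J(L) ≤ C Σ_{k<N}(2^d)^k`. [folklore] -/
private theorem exists_setIntegral_le_geom {w : EuclideanSpace ℝ (Fin 3) → ℝ} {C d L : ℝ}
    (hw0 : ∀ y : EuclideanSpace ℝ (Fin 3), 1 ≤ ‖y‖ → 0 ≤ w y)
    (hw : ∀ R : ℝ, IntegrableOn w {y : EuclideanSpace ℝ (Fin 3) | 1 ≤ ‖y‖ ∧ ‖y‖ < R} volume)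
    (hann : ∀ ρ : ℝ, 1 ≤ ρ →
      ∫ y in {y : EuclideanSpace ℝ (Fin 3) | ρ ≤ ‖y‖ ∧ ‖y‖ < 2 * ρ}, w y ≤ C * ρ ^ d)
    (hL : 1 ≤ L) :
    ∃ N : ℕ, (2 : ℝ) ^ N ≤ 2 * L ∧
      ∫ y in {y : EuclideanSpace ℝ (Fin 3) | 1 ≤ ‖y‖ ∧ ‖y‖ ≤ L}, w y ≤
        C * ∑ k ∈ Finset.range N, ((2 : ℝ) ^ d) ^ k := by
  obtain ⟨n, hn1, hn2⟩ := exists_nat_pow_near hL (by norm_num : (1 : ℝ) < 2)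
  refine ⟨n + 1, by rw [pow_succ]; linarith, ?_⟩
  refine le_trans ?_ (setIntegral_shells_le hw hann (n + 1))
  refine setIntegral_mono_set (hw _) ?_ (Eventually.of_forall fun y hy => ⟨hy.1, ?_⟩)
  · exact ae_restrict_of_forall_mem
      ((isClosed_le continuous_const continuous_norm).measurableSet.inter
        (isOpen_lt continuous_norm continuous_const).measurableSet) fun y hy => hw0 y hy.1
  · exact lt_of_le_of_lt hy.2 hn2

/-- **Shell bound for the weight `(|y|²)^{−β}|y|^{−1}`** under the local flux growth
`∫_{|y|≤ρ} f ≤ C_f ρ^b` (`ρ ≥ 1`): `∫_{ρ≤|y|<2ρ}(|y|²)^{−β}|y|^{−1} f ≤ C_f 2^b ρ^{b−2β−1}`.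
[folklore] -/
private theorem shell_bound_weight_inv {β b C_f : ℝ} {f : EuclideanSpace ℝ (Fin 3) → ℝ}
    (hβ : 0 ≤ β) (hf0 : ∀ y, 0 ≤ f y)
    (hfi : ∀ R : ℝ, IntegrableOn f (closedBall (0 : EuclideanSpace ℝ (Fin 3)) R) volume)
    (hflux : ∀ ρ : ℝ, 1 ≤ ρ →
      ∫ y in closedBall (0 : EuclideanSpace ℝ (Fin 3)) ρ, f y ≤ C_f * ρ ^ b)
    {ρ : ℝ} (hρ : 1 ≤ ρ) :
    ∫ y in {y : EuclideanSpace ℝ (Fin 3) | ρ ≤ ‖y‖ ∧ ‖y‖ < 2 * ρ},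
        (‖y‖ ^ 2) ^ (-β) / ‖y‖ * f y ≤ C_f * 2 ^ b * ρ ^ (b - 2 * β - 1) := by
  have hρ0 : 0 < ρ := by linarith
  set A : Set (EuclideanSpace ℝ (Fin 3)) := {y | ρ ≤ ‖y‖ ∧ ‖y‖ < 2 * ρ} with hA
  have hAm : MeasurableSet A :=
    (isClosed_le continuous_const continuous_norm).measurableSet.inter
      (isOpen_lt continuous_norm continuous_const).measurableSet
  have hAsub : A ⊆ closedBall (0 : EuclideanSpace ℝ (Fin 3)) (2 * ρ) := fun y hy => by
    rw [mem_closedBall_zero_iff]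
    exact hy.2.le
  have hK : IsCompact (closedBall (0 : EuclideanSpace ℝ (Fin 3)) (2 * ρ)) :=
    isCompact_closedBall _ _
  have hwc : ContinuousOn (fun y : EuclideanSpace ℝ (Fin 3) => (‖y‖ ^ 2) ^ (-β) / ‖y‖)
      (closedBall (0 : EuclideanSpace ℝ (Fin 3)) (2 * ρ) \ ball 0 (ρ / 2)) := by
    have hpos : ∀ y ∈ closedBall (0 : EuclideanSpace ℝ (Fin 3)) (2 * ρ) \ ball 0 (ρ / 2),
        0 < ‖y‖ := fun y hy => by
      have h2 := hy.2
      rw [mem_ball_zero_iff, not_lt] at h2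
      linarith
    refine ContinuousOn.div ?_ continuous_norm.continuousOn fun y hy => (hpos y hy).ne'
    exact ContinuousOn.rpow_const (continuous_norm.pow 2).continuousOn fun y hy =>
      Or.inl (pow_ne_zero 2 (hpos y hy).ne')
  have hKd : IsCompact (closedBall (0 : EuclideanSpace ℝ (Fin 3)) (2 * ρ) \ ball 0 (ρ / 2)) :=
    hK.diff isOpen_ball
  have hAsub' : A ⊆ closedBall (0 : EuclideanSpace ℝ (Fin 3)) (2 * ρ) \ ball 0 (ρ / 2) :=
    fun y hy => ⟨hAsub hy, by rw [mem_ball_zero_iff, not_lt]; linarith [hy.1]⟩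
  have hwi : IntegrableOn (fun y => (‖y‖ ^ 2) ^ (-β) / ‖y‖ * f y) A volume :=
    ((hfi (2 * ρ)).mono_set hAsub).continuousOn_mul_of_subset hwc hKd hAm hAsub'
  have hci : IntegrableOn (fun y => (ρ ^ 2) ^ (-β) / ρ * f y) A volume :=
    ((hfi (2 * ρ)).mono_set hAsub).const_mul _
  have h1 : ∫ y in A, (‖y‖ ^ 2) ^ (-β) / ‖y‖ * f y ≤ ∫ y in A, (ρ ^ 2) ^ (-β) / ρ * f y := by
    refine setIntegral_mono_on hwi hci hAm fun y hy => ?_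
    have hy0 : 0 < ‖y‖ := lt_of_lt_of_le hρ0 hy.1
    refine mul_le_mul_of_nonneg_right ?_ (hf0 y)
    calc (‖y‖ ^ 2) ^ (-β) / ‖y‖ ≤ (ρ ^ 2) ^ (-β) / ‖y‖ :=
          div_le_div_of_nonneg_right (Real.rpow_le_rpow_of_nonpos (by positivity)
            (pow_le_pow_left₀ hρ0.le hy.1 2) (by linarith)) hy0.le
      _ ≤ (ρ ^ 2) ^ (-β) / ρ :=
          div_le_div_of_nonneg_left (Real.rpow_nonneg (by positivity) _) hρ0 hy.1
  have h2 : ∫ y in A, f y ≤ ∫ y in closedBall (0 : EuclideanSpace ℝ (Fin 3)) (2 * ρ), f y :=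
    setIntegral_mono_set (hfi _) (Eventually.of_forall hf0) hAsub.eventuallyLE
  have h3 := hflux (2 * ρ) (by linarith)
  calc ∫ y in A, (‖y‖ ^ 2) ^ (-β) / ‖y‖ * f y
      ≤ ∫ y in A, (ρ ^ 2) ^ (-β) / ρ * f y := h1
    _ = (ρ ^ 2) ^ (-β) / ρ * ∫ y in A, f y := integral_const_mul _ _
    _ ≤ (ρ ^ 2) ^ (-β) / ρ * (C_f * (2 * ρ) ^ b) :=
        mul_le_mul_of_nonneg_left (h2.trans h3) (by positivity)
    _ = C_f * 2 ^ b * (ρ ^ (2 * -β) * ρ ^ (-1 : ℝ) * ρ ^ b) := by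
        rw [← Real.rpow_two, ← Real.rpow_mul hρ0.le, div_eq_mul_inv, ← Real.rpow_neg_one,
          Real.mul_rpow (by norm_num) hρ0.le]
        ring
    _ = C_f * 2 ^ b * ρ ^ (b - 2 * β - 1) := by
        rw [← Real.rpow_add hρ0, ← Real.rpow_add hρ0]
        congr 1
        congr 1
        ring

/-- **Shell bound for the weight `(|y|²)^{−β}|y|`**: `∫_{ρ≤|y|<2ρ}(|y|²)^{−β}|y| f ≤
2 C_f 2^b ρ^{b−2β+1}`. [folklore] -/
private theorem shell_bound_weight_mul {β b C_f : ℝ} {f : EuclideanSpace ℝ (Fin 3) → ℝ}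
    (hβ : 0 ≤ β) (hf0 : ∀ y, 0 ≤ f y)
    (hfi : ∀ R : ℝ, IntegrableOn f (closedBall (0 : EuclideanSpace ℝ (Fin 3)) R) volume)
    (hflux : ∀ ρ : ℝ, 1 ≤ ρ →
      ∫ y in closedBall (0 : EuclideanSpace ℝ (Fin 3)) ρ, f y ≤ C_f * ρ ^ b)
    {ρ : ℝ} (hρ : 1 ≤ ρ) :
    ∫ y in {y : EuclideanSpace ℝ (Fin 3) | ρ ≤ ‖y‖ ∧ ‖y‖ < 2 * ρ},
        (‖y‖ ^ 2) ^ (-β) * ‖y‖ * f y ≤ 2 * C_f * 2 ^ b * ρ ^ (b - 2 * β + 1) := by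
  have hρ0 : 0 < ρ := by linarith
  set A : Set (EuclideanSpace ℝ (Fin 3)) := {y | ρ ≤ ‖y‖ ∧ ‖y‖ < 2 * ρ} with hA
  have hAm : MeasurableSet A :=
    (isClosed_le continuous_const continuous_norm).measurableSet.inter
      (isOpen_lt continuous_norm continuous_const).measurableSet
  have hAsub : A ⊆ closedBall (0 : EuclideanSpace ℝ (Fin 3)) (2 * ρ) := fun y hy => by
    rw [mem_closedBall_zero_iff]
    exact hy.2.le
  have hK : IsCompact (closedBall (0 : EuclideanSpace ℝ (Fin 3)) (2 * ρ)) :=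
    isCompact_closedBall _ _
  have hKd : IsCompact (closedBall (0 : EuclideanSpace ℝ (Fin 3)) (2 * ρ) \ ball 0 (ρ / 2)) :=
    hK.diff isOpen_ball
  have hAsub' : A ⊆ closedBall (0 : EuclideanSpace ℝ (Fin 3)) (2 * ρ) \ ball 0 (ρ / 2) :=
    fun y hy => ⟨hAsub hy, by rw [mem_ball_zero_iff, not_lt]; linarith [hy.1]⟩
  have hwc : ContinuousOn (fun y : EuclideanSpace ℝ (Fin 3) => (‖y‖ ^ 2) ^ (-β) * ‖y‖)
      (closedBall (0 : EuclideanSpace ℝ (Fin 3)) (2 * ρ) \ ball 0 (ρ / 2)) := by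
    have hpos : ∀ y ∈ closedBall (0 : EuclideanSpace ℝ (Fin 3)) (2 * ρ) \ ball 0 (ρ / 2),
        0 < ‖y‖ := fun y hy => by
      have h2 := hy.2
      rw [mem_ball_zero_iff, not_lt] at h2
      linarith
    refine ContinuousOn.mul ?_ continuous_norm.continuousOn
    exact ContinuousOn.rpow_const (continuous_norm.pow 2).continuousOn fun y hy =>
      Or.inl (pow_ne_zero 2 (hpos y hy).ne')
  have hwi : IntegrableOn (fun y => (‖y‖ ^ 2) ^ (-β) * ‖y‖ * f y) A volume :=
    ((hfi (2 * ρ)).mono_set hAsub).continuousOn_mul_of_subset hwc hKd hAm hAsub'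
  have hci : IntegrableOn (fun y => (ρ ^ 2) ^ (-β) * (2 * ρ) * f y) A volume :=
    ((hfi (2 * ρ)).mono_set hAsub).const_mul _
  have h1 : ∫ y in A, (‖y‖ ^ 2) ^ (-β) * ‖y‖ * f y ≤
      ∫ y in A, (ρ ^ 2) ^ (-β) * (2 * ρ) * f y := by
    refine setIntegral_mono_on hwi hci hAm fun y hy => ?_
    refine mul_le_mul_of_nonneg_right ?_ (hf0 y)
    exact mul_le_mul (Real.rpow_le_rpow_of_nonpos (by positivity)
      (pow_le_pow_left₀ hρ0.le hy.1 2) (by linarith)) hy.2.le (norm_nonneg _)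
      (Real.rpow_nonneg (by positivity) _)
  have h2 : ∫ y in A, f y ≤ ∫ y in closedBall (0 : EuclideanSpace ℝ (Fin 3)) (2 * ρ), f y :=
    setIntegral_mono_set (hfi _) (Eventually.of_forall hf0) hAsub.eventuallyLE
  have h3 := hflux (2 * ρ) (by linarith)
  calc ∫ y in A, (‖y‖ ^ 2) ^ (-β) * ‖y‖ * f y
      ≤ ∫ y in A, (ρ ^ 2) ^ (-β) * (2 * ρ) * f y := h1
    _ = (ρ ^ 2) ^ (-β) * (2 * ρ) * ∫ y in A, f y := integral_const_mul _ _
    _ ≤ (ρ ^ 2) ^ (-β) * (2 * ρ) * (C_f * (2 * ρ) ^ b) :=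
        mul_le_mul_of_nonneg_left (h2.trans h3) (by positivity)
    _ = 2 * C_f * 2 ^ b * (ρ ^ (2 * -β) * ρ ^ (1 : ℝ) * ρ ^ b) := by
        rw [← Real.rpow_two, ← Real.rpow_mul hρ0.le, Real.rpow_one,
          Real.mul_rpow (by norm_num) hρ0.le]
        ring
    _ = 2 * C_f * 2 ^ b * ρ ^ (b - 2 * β + 1) := by
        rw [← Real.rpow_add hρ0, ← Real.rpow_add hρ0]
        congr 1
        congr 1
        ring

/-- Integrability of the weighted fluxes on the truncated regions `{1 ≤ |y| < R}`. [folklore] -/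
private theorem integrableOn_weight_trunc {β : ℝ} {f : EuclideanSpace ℝ (Fin 3) → ℝ}
    (hfi : ∀ R : ℝ, IntegrableOn f (closedBall (0 : EuclideanSpace ℝ (Fin 3)) R) volume)
    (R : ℝ) :
    IntegrableOn (fun y => (‖y‖ ^ 2) ^ (-β) / ‖y‖ * f y)
        {y : EuclideanSpace ℝ (Fin 3) | 1 ≤ ‖y‖ ∧ ‖y‖ < R} volume ∧
      IntegrableOn (fun y => (‖y‖ ^ 2) ^ (-β) * ‖y‖ * f y)
        {y : EuclideanSpace ℝ (Fin 3) | 1 ≤ ‖y‖ ∧ ‖y‖ < R} volume := by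
  set T : Set (EuclideanSpace ℝ (Fin 3)) := {y | 1 ≤ ‖y‖ ∧ ‖y‖ < R} with hT
  have hTm : MeasurableSet T :=
    (isClosed_le continuous_const continuous_norm).measurableSet.inter
      (isOpen_lt continuous_norm continuous_const).measurableSet
  set K : Set (EuclideanSpace ℝ (Fin 3)) := closedBall 0 R \ ball 0 (1 / 2) with hK
  have hKc : IsCompact K := (isCompact_closedBall _ _).diff isOpen_ball
  have hTK : T ⊆ K := fun y hy =>
    ⟨by rw [mem_closedBall_zero_iff]; exact hy.2.le,
      by rw [mem_ball_zero_iff, not_lt]; linarith [hy.1]⟩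
  have hpos : ∀ y ∈ K, 0 < ‖y‖ := fun y hy => by
    have := hy.2
    rw [mem_ball_zero_iff, not_lt] at this
    linarith
  have hr : ContinuousOn (fun y : EuclideanSpace ℝ (Fin 3) => (‖y‖ ^ 2) ^ (-β)) K :=
    ContinuousOn.rpow_const (continuous_norm.pow 2).continuousOn fun y hy =>
      Or.inl (pow_ne_zero 2 (hpos y hy).ne')
  have hfT : IntegrableOn f T volume := (hfi R).mono_set fun y hy => by
    rw [mem_closedBall_zero_iff]; exact hy.2.le
  exact ⟨hfT.continuousOn_mul_of_subset (hr.div continuous_norm.continuousOn fun y hy =>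
      (hpos y hy).ne') hKc hTm hTK,
    hfT.continuousOn_mul_of_subset (hr.mul continuous_norm.continuousOn) hKc hTm hTK⟩

/-! ## Dyadic summation of annular energies -/

/-- **Dyadic summation, finite form.** If `E` is monotone on `[0, ∞)` and
`E ρ ≤ E(ρ/2) + C₁ρ^e` for `ρ ≥ 2`, then for `0 ≤ ρ < 2·2^n`:
`E ρ ≤ E 2 + C₁ ρ^e Σ_{j<n} (2^{−e})^j`. [folklore] -/
private theorem dyadic_energy_sum_le {E : ℝ → ℝ} {C₁ e : ℝ} (hC₁ : 0 ≤ C₁)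
    (hmono : ∀ ρ₁ ρ₂, 0 ≤ ρ₁ → ρ₁ ≤ ρ₂ → E ρ₁ ≤ E ρ₂)
    (hrec : ∀ ρ, 2 ≤ ρ → E ρ ≤ E (ρ / 2) + C₁ * ρ ^ e) :
    ∀ n : ℕ, ∀ ρ : ℝ, 0 ≤ ρ → ρ < 2 * 2 ^ n →
      E ρ ≤ E 2 + C₁ * ρ ^ e * ∑ j ∈ Finset.range n, ((2 : ℝ) ^ (-e)) ^ j := by
  have hq0 : 0 < (2 : ℝ) ^ (-e) := Real.rpow_pos_of_pos two_pos _
  intro n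
  induction n with
  | zero =>
    intro ρ hρ0 hρ
    simp only [pow_zero, mul_one] at hρ
    simp only [Finset.range_zero, Finset.sum_empty, mul_zero, add_zero]
    exact hmono ρ 2 hρ0 hρ.le
  | succ n ih =>
    intro ρ hρ0 hρ
    have hS0 : 0 ≤ C₁ * ρ ^ e * ∑ j ∈ Finset.range (n + 1), ((2 : ℝ) ^ (-e)) ^ j := by
      have : 0 ≤ ∑ j ∈ Finset.range (n + 1), ((2 : ℝ) ^ (-e)) ^ j :=
        Finset.sum_nonneg fun j _ => pow_nonneg hq0.le j
      have : 0 ≤ ρ ^ e := Real.rpow_nonneg hρ0 e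
      positivity
    by_cases h2 : ρ < 2
    · linarith [hmono ρ 2 hρ0 h2.le]
    · push Not at h2
      have hr := hrec ρ h2
      have hih := ih (ρ / 2) (by positivity) (by rw [pow_succ] at hρ; linarith)
      have hhalf : (ρ / 2) ^ e = ρ ^ e * (2 : ℝ) ^ (-e) := by
        rw [Real.div_rpow hρ0 two_pos.le, Real.rpow_neg two_pos.le, div_eq_mul_inv]
      rw [hhalf] at hih
      rw [Finset.sum_range_succ', pow_zero]
      have e1 : ∑ j ∈ Finset.range n, ((2 : ℝ) ^ (-e)) ^ (j + 1) =
          (2 : ℝ) ^ (-e) * ∑ j ∈ Finset.range n, ((2 : ℝ) ^ (-e)) ^ j := by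
        rw [Finset.mul_sum]
        refine Finset.sum_congr rfl fun j _ => ?_
        ring
      rw [e1]
      nlinarith [hr, hih]

/-- **Dyadic summation, growth case `e > 0`:** `E ρ ≤ E 2 + C₁ρ^e(1 − 2^{−e})^{−1}` for
`ρ ≥ 0`. [folklore] -/
private theorem dyadic_growth_pos {E : ℝ → ℝ} {C₁ e : ℝ} (he : 0 < e) (hC₁ : 0 ≤ C₁)
    (hmono : ∀ ρ₁ ρ₂, 0 ≤ ρ₁ → ρ₁ ≤ ρ₂ → E ρ₁ ≤ E ρ₂)
    (hrec : ∀ ρ, 2 ≤ ρ → E ρ ≤ E (ρ / 2) + C₁ * ρ ^ e) {ρ : ℝ} (hρ0 : 0 ≤ ρ) :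
    E ρ ≤ E 2 + C₁ * ρ ^ e * (1 - (2 : ℝ) ^ (-e))⁻¹ := by
  obtain ⟨n, hn⟩ := pow_unbounded_of_one_lt ρ (by norm_num : (1 : ℝ) < 2)
  have h := dyadic_energy_sum_le hC₁ hmono hrec n ρ hρ0 (by linarith [pow_pos (two_pos : (0:ℝ) < 2) n])
  refine h.trans ?_
  have hneg : -e < 0 := by linarith
  have hs := geom_sum_two_rpow_le_of_neg hneg n
  have : 0 ≤ C₁ * ρ ^ e := mul_nonneg hC₁ (Real.rpow_nonneg hρ0 e)
  nlinarith

/-- **Dyadic summation, decay case `e < 0`:** `E ρ ≤ E 2 + C₁(2^{−e} − 1)^{−1}` for `ρ ≥ 1`.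
[folklore] -/
private theorem dyadic_growth_neg {E : ℝ → ℝ} {C₁ e : ℝ} (he : e < 0) (hC₁ : 0 ≤ C₁)
    (hmono : ∀ ρ₁ ρ₂, 0 ≤ ρ₁ → ρ₁ ≤ ρ₂ → E ρ₁ ≤ E ρ₂)
    (hrec : ∀ ρ, 2 ≤ ρ → E ρ ≤ E (ρ / 2) + C₁ * ρ ^ e) {ρ : ℝ} (hρ1 : 1 ≤ ρ) :
    E ρ ≤ E 2 + C₁ * ((2 : ℝ) ^ (-e) - 1)⁻¹ := by
  have hρ0 : 0 < ρ := by linarith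
  obtain ⟨n, hn1, hn2⟩ := exists_nat_pow_near hρ1 (by norm_num : (1 : ℝ) < 2)
  have h := dyadic_energy_sum_le hC₁ hmono hrec n ρ hρ0.le (by rw [pow_succ] at hn2; linarith)
  refine h.trans ?_
  have hpos : 0 < -e := by linarith
  have hq1 : 1 < (2 : ℝ) ^ (-e) := Real.one_lt_rpow (by norm_num) hpos
  have hs := geom_sum_two_rpow_le_of_pos hpos n
  -- `ρ^e (2^{-e})^n ≤ 1` since `2^n ≤ ρ`
  have hqn : ((2 : ℝ) ^ (-e)) ^ n ≤ ρ ^ (-e) := by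
    rw [two_rpow_pow_comm]
    exact Real.rpow_le_rpow (by positivity) hn1 hpos.le
  have hone : ρ ^ e * ((2 : ℝ) ^ (-e)) ^ n ≤ 1 := by
    calc ρ ^ e * ((2 : ℝ) ^ (-e)) ^ n ≤ ρ ^ e * ρ ^ (-e) :=
          mul_le_mul_of_nonneg_left hqn (Real.rpow_nonneg hρ0.le e)
      _ = 1 := by rw [← Real.rpow_add hρ0, add_neg_cancel, Real.rpow_zero]
  have hq1' : 0 < (2 : ℝ) ^ (-e) - 1 := by linarith
  calc E 2 + C₁ * ρ ^ e * ∑ j ∈ Finset.range n, ((2 : ℝ) ^ (-e)) ^ j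
      ≤ E 2 + C₁ * ρ ^ e * (((2 : ℝ) ^ (-e)) ^ n / ((2 : ℝ) ^ (-e) - 1)) :=
        add_le_add le_rfl (mul_le_mul_of_nonneg_left hs
          (mul_nonneg hC₁ (Real.rpow_nonneg hρ0.le e)))
    _ = E 2 + C₁ * (ρ ^ e * ((2 : ℝ) ^ (-e)) ^ n) * ((2 : ℝ) ^ (-e) - 1)⁻¹ := by
        rw [div_eq_mul_inv]
        ring
    _ ≤ E 2 + C₁ * 1 * ((2 : ℝ) ^ (-e) - 1)⁻¹ :=
        add_le_add le_rfl (mul_le_mul_of_nonneg_right (mul_le_mul_of_nonneg_left hone hC₁)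
          (inv_nonneg.2 hq1'.le))
    _ = E 2 + C₁ * ((2 : ℝ) ^ (-e) - 1)⁻¹ := by ring

/-- **From annular bounds to ball energies, growth case.** If `U` is continuous and
`∫_{L/4≤|y|≤L/2}|U|² ≤ M L^e` for `L ≥ 4` with `e > 0`, then `∫_{|y|<R}|U|² ≤ C R^e` for `R ≥ 1`.
[folklore] -/
private theorem energyGrowth_of_annular_pos {e M : ℝ}
    {U : EuclideanSpace ℝ (Fin 3) → EuclideanSpace ℝ (Fin 3)} (hUc : Continuous U) (he : 0 < e)
    (hM : 0 ≤ M) (hann : ∀ L : ℝ, 4 ≤ L →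
      ∫ y in {y : EuclideanSpace ℝ (Fin 3) | L ^ 2 / 16 ≤ ‖y‖ ^ 2 ∧ ‖y‖ ^ 2 ≤ L ^ 2 / 4},
        ‖U y‖ ^ 2 ≤ M * L ^ e) :
    ∃ C : ℝ, 0 ≤ C ∧ ∀ R : ℝ, 1 ≤ R →
      ∫ y in ball (0 : EuclideanSpace ℝ (Fin 3)) R, ‖U y‖ ^ 2 ≤ C * R ^ e := by
  set E : ℝ → ℝ := fun ρ => ∫ y in ball (0 : EuclideanSpace ℝ (Fin 3)) ρ, ‖U y‖ ^ 2 with hE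
  have hint : ∀ ρ, IntegrableOn (fun y => ‖U y‖ ^ 2) (ball (0 : EuclideanSpace ℝ (Fin 3)) ρ)
      volume := fun ρ =>
    ((hUc.norm.pow 2).continuousOn.integrableOn_compact
      (isCompact_closedBall (0 : EuclideanSpace ℝ (Fin 3)) ρ)).mono_set ball_subset_closedBall
  have hmono : ∀ ρ₁ ρ₂, 0 ≤ ρ₁ → ρ₁ ≤ ρ₂ → E ρ₁ ≤ E ρ₂ := fun ρ₁ ρ₂ _ h12 =>
    setIntegral_mono_set (hint ρ₂) (ae_of_all _ fun y => by positivity)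
      (ball_subset_ball h12).eventuallyLE
  have hrec : ∀ ρ, 2 ≤ ρ → E ρ ≤ E (ρ / 2) + M * 2 ^ e * ρ ^ e := by
    intro ρ hρ
    have hρ0 : 0 < ρ := by linarith
    set Ann : Set (EuclideanSpace ℝ (Fin 3)) :=
      {y | (2 * ρ) ^ 2 / 16 ≤ ‖y‖ ^ 2 ∧ ‖y‖ ^ 2 ≤ (2 * ρ) ^ 2 / 4} with hAnn
    have hAm : MeasurableSet Ann :=
      (isClosed_le continuous_const (continuous_norm.pow 2)).measurableSet.inter
        (isClosed_le (continuous_norm.pow 2) continuous_const).measurableSet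
    have hsub : ball (0 : EuclideanSpace ℝ (Fin 3)) ρ \ ball 0 (ρ / 2) ⊆ Ann := by
      intro y hy
      rw [Set.mem_sdiff, mem_ball_zero_iff, mem_ball_zero_iff, not_lt] at hy
      constructor
      · nlinarith [hy.2]
      · nlinarith [hy.1, norm_nonneg y]
    have hunion : ball (0 : EuclideanSpace ℝ (Fin 3)) (ρ / 2) ∪ (ball 0 ρ \ ball 0 (ρ / 2)) =
        ball 0 ρ := union_sdiff_cancel (ball_subset_ball (by linarith))
    have hannI : IntegrableOn (fun y => ‖U y‖ ^ 2) Ann volume :=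
      ((hUc.norm.pow 2).continuousOn.integrableOn_compact
        (isCompact_closedBall (0 : EuclideanSpace ℝ (Fin 3)) ρ)).mono_set fun y hy => by
        rw [mem_closedBall_zero_iff]
        nlinarith [hy.2, norm_nonneg y]
    have h1 : E ρ = E (ρ / 2) + ∫ y in ball (0 : EuclideanSpace ℝ (Fin 3)) ρ \ ball 0 (ρ / 2),
        ‖U y‖ ^ 2 := by
      simp only [hE]
      rw [← setIntegral_union disjoint_sdiff_right (measurableSet_ball.diff measurableSet_ball)
        (hint _) ((hint ρ).mono_set sdiff_subset), hunion]
    have h2 : ∫ y in ball (0 : EuclideanSpace ℝ (Fin 3)) ρ \ ball 0 (ρ / 2), ‖U y‖ ^ 2 ≤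
        ∫ y in Ann, ‖U y‖ ^ 2 :=
      setIntegral_mono_set hannI (ae_of_all _ fun y => by positivity) hsub.eventuallyLE
    have h3 := hann (2 * ρ) (by linarith)
    rw [Real.mul_rpow (by norm_num) hρ0.le] at h3
    linarith [h1, h2, h3]
  have hq : (2 : ℝ) ^ (-e) < 1 := Real.rpow_lt_one_of_one_lt_of_neg (by norm_num) (by linarith)
  have hinv : 0 ≤ (1 - (2 : ℝ) ^ (-e))⁻¹ := inv_nonneg.2 (by linarith)
  have hE2 : 0 ≤ E 2 := integral_nonneg fun y => by positivity
  have hM2 : 0 ≤ M * 2 ^ e := mul_nonneg hM (Real.rpow_nonneg (by norm_num) e)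
  refine ⟨E 2 + M * 2 ^ e * (1 - (2 : ℝ) ^ (-e))⁻¹,
    add_nonneg hE2 (mul_nonneg hM2 hinv), fun R hR => ?_⟩
  · have hR0 : 0 ≤ R := by linarith
    have h := dyadic_growth_pos he hM2 hmono hrec hR0
    have hRe : 1 ≤ R ^ e := Real.one_le_rpow hR he.le
    calc E R ≤ E 2 + M * 2 ^ e * R ^ e * (1 - (2 : ℝ) ^ (-e))⁻¹ := h
      _ ≤ E 2 * R ^ e + M * 2 ^ e * R ^ e * (1 - (2 : ℝ) ^ (-e))⁻¹ := by
          nlinarith [mul_le_mul_of_nonneg_left hRe hE2]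
      _ = (E 2 + M * 2 ^ e * (1 - (2 : ℝ) ^ (-e))⁻¹) * R ^ e := by ring

/-- **From annular bounds to ball energies, decay case.** If
`∫_{L/4≤|y|≤L/2}|U|² ≤ M L^e` for `L ≥ 4` with `e < 0`, then `∫_{|y|<R}|U|² ≤ C` for all `R`
with `R ≥ 1` (`U ∈ L²`). [folklore] -/
private theorem energyGrowth_of_annular_neg {e M : ℝ}
    {U : EuclideanSpace ℝ (Fin 3) → EuclideanSpace ℝ (Fin 3)} (hUc : Continuous U) (he : e < 0)
    (hM : 0 ≤ M) (hann : ∀ L : ℝ, 4 ≤ L →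
      ∫ y in {y : EuclideanSpace ℝ (Fin 3) | L ^ 2 / 16 ≤ ‖y‖ ^ 2 ∧ ‖y‖ ^ 2 ≤ L ^ 2 / 4},
        ‖U y‖ ^ 2 ≤ M * L ^ e) :
    ∃ C : ℝ, 0 ≤ C ∧ ∀ R : ℝ, 1 ≤ R →
      ∫ y in ball (0 : EuclideanSpace ℝ (Fin 3)) R, ‖U y‖ ^ 2 ≤ C := by
  set E : ℝ → ℝ := fun ρ => ∫ y in ball (0 : EuclideanSpace ℝ (Fin 3)) ρ, ‖U y‖ ^ 2 with hE
  have hint : ∀ ρ, IntegrableOn (fun y => ‖U y‖ ^ 2) (ball (0 : EuclideanSpace ℝ (Fin 3)) ρ)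
      volume := fun ρ =>
    ((hUc.norm.pow 2).continuousOn.integrableOn_compact
      (isCompact_closedBall (0 : EuclideanSpace ℝ (Fin 3)) ρ)).mono_set ball_subset_closedBall
  have hmono : ∀ ρ₁ ρ₂, 0 ≤ ρ₁ → ρ₁ ≤ ρ₂ → E ρ₁ ≤ E ρ₂ := fun ρ₁ ρ₂ _ h12 =>
    setIntegral_mono_set (hint ρ₂) (ae_of_all _ fun y => by positivity)
      (ball_subset_ball h12).eventuallyLE
  have hrec : ∀ ρ, 2 ≤ ρ → E ρ ≤ E (ρ / 2) + M * 2 ^ e * ρ ^ e := by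
    intro ρ hρ
    have hρ0 : 0 < ρ := by linarith
    set Ann : Set (EuclideanSpace ℝ (Fin 3)) :=
      {y | (2 * ρ) ^ 2 / 16 ≤ ‖y‖ ^ 2 ∧ ‖y‖ ^ 2 ≤ (2 * ρ) ^ 2 / 4} with hAnn
    have hsub : ball (0 : EuclideanSpace ℝ (Fin 3)) ρ \ ball 0 (ρ / 2) ⊆ Ann := by
      intro y hy
      rw [Set.mem_sdiff, mem_ball_zero_iff, mem_ball_zero_iff, not_lt] at hy
      constructor
      · nlinarith [hy.2]
      · nlinarith [hy.1, norm_nonneg y]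
    have hunion : ball (0 : EuclideanSpace ℝ (Fin 3)) (ρ / 2) ∪ (ball 0 ρ \ ball 0 (ρ / 2)) =
        ball 0 ρ := union_sdiff_cancel (ball_subset_ball (by linarith))
    have hannI : IntegrableOn (fun y => ‖U y‖ ^ 2) Ann volume :=
      ((hUc.norm.pow 2).continuousOn.integrableOn_compact
        (isCompact_closedBall (0 : EuclideanSpace ℝ (Fin 3)) ρ)).mono_set fun y hy => by
        rw [mem_closedBall_zero_iff]
        nlinarith [hy.2, norm_nonneg y]
    have h1 : E ρ = E (ρ / 2) + ∫ y in ball (0 : EuclideanSpace ℝ (Fin 3)) ρ \ ball 0 (ρ / 2),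
        ‖U y‖ ^ 2 := by
      simp only [hE]
      rw [← setIntegral_union disjoint_sdiff_right (measurableSet_ball.diff measurableSet_ball)
        (hint _) ((hint ρ).mono_set sdiff_subset), hunion]
    have h2 : ∫ y in ball (0 : EuclideanSpace ℝ (Fin 3)) ρ \ ball 0 (ρ / 2), ‖U y‖ ^ 2 ≤
        ∫ y in Ann, ‖U y‖ ^ 2 :=
      setIntegral_mono_set hannI (ae_of_all _ fun y => by positivity) hsub.eventuallyLE
    have h3 := hann (2 * ρ) (by linarith)
    rw [Real.mul_rpow (by norm_num) hρ0.le] at h3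
    linarith [h1, h2, h3]
  have hq1 : 1 < (2 : ℝ) ^ (-e) := Real.one_lt_rpow (by norm_num) (by linarith)
  have hE2 : 0 ≤ E 2 := integral_nonneg fun y => by positivity
  have hM2 : 0 ≤ M * 2 ^ e := mul_nonneg hM (Real.rpow_nonneg (by norm_num) e)
  have hinv : 0 ≤ ((2 : ℝ) ^ (-e) - 1)⁻¹ := inv_nonneg.2 (by linarith)
  exact ⟨E 2 + M * 2 ^ e * ((2 : ℝ) ^ (-e) - 1)⁻¹, add_nonneg hE2 (mul_nonneg hM2 hinv),
    fun R hR => dyadic_growth_neg he hM2 hmono hrec hR⟩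

/-! ## Bounds for the truncated weighted fluxes `J(L) = ∫_{1≤|y|≤L} w` -/

/-- `J(L) ≤ C (2^{d'}/(2^{d'}−1)) L^{d'}` when the shells of `w` are `≤ C ρ^d`, `d ≤ d'`, `0 < d'`
(geometric sum with ratio pushed up to `2^{d'} > 1`; this absorbs CS13's logarithm at `d = 0`).
[folklore] -/
private theorem setIntegral_trunc_le_rpow {w : EuclideanSpace ℝ (Fin 3) → ℝ} {C d d' L : ℝ}
    (hC : 0 ≤ C) (hw0 : ∀ y : EuclideanSpace ℝ (Fin 3), 1 ≤ ‖y‖ → 0 ≤ w y)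
    (hw : ∀ R : ℝ, IntegrableOn w {y : EuclideanSpace ℝ (Fin 3) | 1 ≤ ‖y‖ ∧ ‖y‖ < R} volume)
    (hann : ∀ ρ : ℝ, 1 ≤ ρ →
      ∫ y in {y : EuclideanSpace ℝ (Fin 3) | ρ ≤ ‖y‖ ∧ ‖y‖ < 2 * ρ}, w y ≤ C * ρ ^ d)
    (hd' : 0 < d') (hdd' : d ≤ d') (hL : 1 ≤ L) :
    ∫ y in {y : EuclideanSpace ℝ (Fin 3) | 1 ≤ ‖y‖ ∧ ‖y‖ ≤ L}, w y ≤
      C * ((2 : ℝ) ^ d' / ((2 : ℝ) ^ d' - 1)) * L ^ d' := by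
  have hL0 : 0 ≤ L := by linarith
  obtain ⟨N, hN, hJ⟩ := exists_setIntegral_le_geom hw0 hw hann hL
  have hq1 : 1 < (2 : ℝ) ^ d' := Real.one_lt_rpow (by norm_num) hd'
  have hmono : ∑ k ∈ Finset.range N, ((2 : ℝ) ^ d) ^ k ≤
      ∑ k ∈ Finset.range N, ((2 : ℝ) ^ d') ^ k :=
    geom_sum_mono (Real.rpow_nonneg (by norm_num) _)
      (Real.rpow_le_rpow_of_exponent_le (by norm_num) hdd') N
  have hgeom := geom_sum_two_rpow_le_of_pos hd' N
  have hpow : ((2 : ℝ) ^ d') ^ N ≤ (2 : ℝ) ^ d' * L ^ d' := by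
    rw [two_rpow_pow_comm, ← Real.mul_rpow (by norm_num) hL0]
    exact Real.rpow_le_rpow (by positivity) hN hd'.le
  have hq0 : 0 < (2 : ℝ) ^ d' - 1 := by linarith
  calc ∫ y in {y : EuclideanSpace ℝ (Fin 3) | 1 ≤ ‖y‖ ∧ ‖y‖ ≤ L}, w y
      ≤ C * ∑ k ∈ Finset.range N, ((2 : ℝ) ^ d) ^ k := hJ
    _ ≤ C * (((2 : ℝ) ^ d') ^ N / ((2 : ℝ) ^ d' - 1)) :=
        mul_le_mul_of_nonneg_left (hmono.trans hgeom) hC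
    _ ≤ C * ((2 : ℝ) ^ d' * L ^ d' / ((2 : ℝ) ^ d' - 1)) :=
        mul_le_mul_of_nonneg_left (div_le_div_of_nonneg_right hpow hq0.le) hC
    _ = C * ((2 : ℝ) ^ d' / ((2 : ℝ) ^ d' - 1)) * L ^ d' := by
        rw [div_eq_mul_inv, div_eq_mul_inv]
        ring

/-- `J(L) ≤ C (1 − 2^d)^{−1}` when the shells of `w` are `≤ C ρ^d` with `d < 0`. [folklore] -/
private theorem setIntegral_trunc_le_const {w : EuclideanSpace ℝ (Fin 3) → ℝ} {C d L : ℝ}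
    (hC : 0 ≤ C) (hw0 : ∀ y : EuclideanSpace ℝ (Fin 3), 1 ≤ ‖y‖ → 0 ≤ w y)
    (hw : ∀ R : ℝ, IntegrableOn w {y : EuclideanSpace ℝ (Fin 3) | 1 ≤ ‖y‖ ∧ ‖y‖ < R} volume)
    (hann : ∀ ρ : ℝ, 1 ≤ ρ →
      ∫ y in {y : EuclideanSpace ℝ (Fin 3) | ρ ≤ ‖y‖ ∧ ‖y‖ < 2 * ρ}, w y ≤ C * ρ ^ d)
    (hd : d < 0) (hL : 1 ≤ L) :
    ∫ y in {y : EuclideanSpace ℝ (Fin 3) | 1 ≤ ‖y‖ ∧ ‖y‖ ≤ L}, w y ≤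
      C * (1 - (2 : ℝ) ^ d)⁻¹ := by
  obtain ⟨N, -, hJ⟩ := exists_setIntegral_le_geom hw0 hw hann hL
  exact hJ.trans (mul_le_mul_of_nonneg_left (geom_sum_two_rpow_le_of_neg hd N) hC)

/-! ## The two rounds of the window bootstrap -/

/-- **Final round.** If the local flux grows like `ρ^b` with `b − 1 < 3 − 2α` (and `0 ≤ b`), the
annular bound gives the target: `∫_{|y|<R}|U|² ≤ C R^{3−2α}` for `R ≥ 1` — for `α < 3/2` the
`J₁`-shells are summable and the `J₂`-term is of lower order; at the endpoint `α = 3/2` only the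
`J₂`-term is present and the annular energies DECAY, so `U ∈ L²` (CS13: "In particular, if
`v ∈ L^p`, `p ≥ 3`, and `α = N/2`, then automatically `v ∈ L²`", §1).
[cite: ChaeShvydkoy2013, §3.2.3 Cor. 3.4 (last step of the bootstrap)] -/
private theorem energyGrowth_window_final {α A C_f b : ℝ}
    {U : EuclideanSpace ℝ (Fin 3) → EuclideanSpace ℝ (Fin 3)} {P : EuclideanSpace ℝ (Fin 3) → ℝ}
    (hUc : Continuous U) (hα0 : 0 < α) (hα2 : α ≤ 3 / 2) (hA0 : 0 ≤ A) (hCf : 0 ≤ C_f)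
    (hb0 : 0 ≤ b) (hb : b - 1 < 3 - 2 * α)
    (hfi : ∀ R : ℝ, IntegrableOn (fun y => ‖U y‖ ^ 3 + 2 * (|P y| * ‖U y‖))
      (closedBall (0 : EuclideanSpace ℝ (Fin 3)) R) volume)
    (hann : ∀ L : ℝ, 4 ≤ L →
      ∫ y in {y : EuclideanSpace ℝ (Fin 3) | L ^ 2 / 16 ≤ ‖y‖ ^ 2 ∧ ‖y‖ ^ 2 ≤ L ^ 2 / 4},
          ‖U y‖ ^ 2 ≤
        A * ((3 / 2 - α) * L ^ (3 - 2 * α) *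
            (1 + ∫ y in {y : EuclideanSpace ℝ (Fin 3) | 1 ≤ ‖y‖ ∧ ‖y‖ ≤ L},
              (‖y‖ ^ 2) ^ (-(3 / 2 - α)) / ‖y‖ * (‖U y‖ ^ 3 + 2 * (|P y| * ‖U y‖))) +
          L ^ (3 - 2 * α) / L ^ 2 *
            (1 + ∫ y in {y : EuclideanSpace ℝ (Fin 3) | 1 ≤ ‖y‖ ∧ ‖y‖ ≤ L},
              (‖y‖ ^ 2) ^ (-(3 / 2 - α)) * ‖y‖ * (‖U y‖ ^ 3 + 2 * (|P y| * ‖U y‖)))))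
    (hflux : ∀ ρ : ℝ, 1 ≤ ρ →
      ∫ y in closedBall (0 : EuclideanSpace ℝ (Fin 3)) ρ, (‖U y‖ ^ 3 + 2 * (|P y| * ‖U y‖)) ≤
        C_f * ρ ^ b) :
    ∃ C : ℝ, 0 ≤ C ∧ ∀ R : ℝ, 1 ≤ R →
      ∫ y in ball (0 : EuclideanSpace ℝ (Fin 3)) R, ‖U y‖ ^ 2 ≤ C * R ^ (3 - 2 * α) := by
  set β : ℝ := 3 / 2 - α with hβ_def
  have hβ0 : 0 ≤ β := by rw [hβ_def]; linarith
  have ht : 3 - 2 * α = 2 * β := by rw [hβ_def]; ring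
  have hf0 : ∀ y : EuclideanSpace ℝ (Fin 3), 0 ≤ ‖U y‖ ^ 3 + 2 * (|P y| * ‖U y‖) := fun y => by
    positivity
  -- shell data for the two weights
  have hw1 := fun R => (integrableOn_weight_trunc (β := β) hfi R).1
  have hw2 := fun R => (integrableOn_weight_trunc (β := β) hfi R).2
  have hw10 : ∀ y : EuclideanSpace ℝ (Fin 3), 1 ≤ ‖y‖ →
      0 ≤ (‖y‖ ^ 2) ^ (-β) / ‖y‖ * (‖U y‖ ^ 3 + 2 * (|P y| * ‖U y‖)) := fun y _ => by
    have := hf0 y; positivity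
  have hw20 : ∀ y : EuclideanSpace ℝ (Fin 3), 1 ≤ ‖y‖ →
      0 ≤ (‖y‖ ^ 2) ^ (-β) * ‖y‖ * (‖U y‖ ^ 3 + 2 * (|P y| * ‖U y‖)) := fun y _ => by
    have := hf0 y; positivity
  have hann1 := fun ρ (hρ : 1 ≤ ρ) => shell_bound_weight_inv hβ0 hf0 hfi hflux hρ
  have hann2 := fun ρ (hρ : 1 ≤ ρ) => shell_bound_weight_mul hβ0 hf0 hfi hflux hρ
  have hC₁ : 0 ≤ C_f * 2 ^ b := by positivity
  have hC₂ : 0 ≤ 2 * C_f * 2 ^ b := by positivity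
  -- `J₁` is bounded (`d₁ = b − 2β − 1 < 0`)
  have hd1 : b - 2 * β - 1 < 0 := by linarith
  set J₁star : ℝ := C_f * 2 ^ b * (1 - (2 : ℝ) ^ (b - 2 * β - 1))⁻¹ with hJ₁star
  have hJ₁star0 : 0 ≤ J₁star := mul_nonneg hC₁ (inv_nonneg.2 (by
    linarith [Real.rpow_lt_one_of_one_lt_of_neg (by norm_num : (1 : ℝ) < 2) hd1]))
  have hJ1 : ∀ L : ℝ, 1 ≤ L → ∫ y in {y : EuclideanSpace ℝ (Fin 3) | 1 ≤ ‖y‖ ∧ ‖y‖ ≤ L},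
      (‖y‖ ^ 2) ^ (-β) / ‖y‖ * (‖U y‖ ^ 3 + 2 * (|P y| * ‖U y‖)) ≤ J₁star := fun L hL =>
    setIntegral_trunc_le_const hC₁ hw10 hw1 hann1 hd1 hL
  -- `J₂ ≲ L^{d''}` with `d'' = max(d₂,0) + ε`, `ε = (3−2α−(b−1))/2`
  set ε : ℝ := (2 * β - (b - 1)) / 2 with hε_def
  have hε0 : 0 < ε := by rw [hε_def]; linarith
  set d'' : ℝ := max (b - 2 * β + 1) 0 + ε with hd''
  have hd''0 : 0 < d'' := by
    have := le_max_right (b - 2 * β + 1) 0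
    rw [hd'']; linarith
  have hd''le : b - 2 * β + 1 ≤ d'' := by
    have := le_max_left (b - 2 * β + 1) 0
    rw [hd'']; linarith
  have hd''2 : d'' < 2 := by
    have h1 : max (b - 2 * β + 1) 0 < 2 - ε := by
      refine max_lt ?_ ?_
      · rw [hε_def]; linarith
      · rw [hε_def]; linarith
    rw [hd'']; linarith
  set c₂ : ℝ := 2 * C_f * 2 ^ b * ((2 : ℝ) ^ d'' / ((2 : ℝ) ^ d'' - 1)) with hc₂
  have hc₂0 : 0 ≤ c₂ := mul_nonneg hC₂ (div_nonneg (by positivity)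
    (by linarith [Real.one_lt_rpow (by norm_num : (1 : ℝ) < 2) hd''0]))
  have hJ2 : ∀ L : ℝ, 1 ≤ L → ∫ y in {y : EuclideanSpace ℝ (Fin 3) | 1 ≤ ‖y‖ ∧ ‖y‖ ≤ L},
      (‖y‖ ^ 2) ^ (-β) * ‖y‖ * (‖U y‖ ^ 3 + 2 * (|P y| * ‖U y‖)) ≤ c₂ * L ^ d'' :=
    fun L hL => setIntegral_trunc_le_rpow hC₂ hw20 hw2 hann2 hd''0 hd''le hL
  -- the lower-order exponent
  set s : ℝ := 2 * β - 2 + d'' with hs_def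
  have hst : s < 2 * β := by rw [hs_def]; linarith
  have hann' : ∀ L : ℝ, 4 ≤ L →
      ∫ y in {y : EuclideanSpace ℝ (Fin 3) | L ^ 2 / 16 ≤ ‖y‖ ^ 2 ∧ ‖y‖ ^ 2 ≤ L ^ 2 / 4},
        ‖U y‖ ^ 2 ≤ A * (β * (1 + J₁star)) * L ^ (2 * β) + A * (1 + c₂) * L ^ s := by
    intro L hL
    have hL1 : (1 : ℝ) ≤ L := by linarith
    have hL0 : 0 < L := by linarith
    have h1 := hann L hL
    rw [ht] at h1
    have hJ1L := hJ1 L hL1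
    have hJ2L := hJ2 L hL1
    have hLt : 0 ≤ L ^ (2 * β) := by positivity
    have hq : L ^ (2 * β) / L ^ 2 = L ^ (2 * β - 2) := by
      rw [Real.rpow_sub hL0, Real.rpow_two]
    have hq1 : L ^ (2 * β - 2) ≤ L ^ s :=
      Real.rpow_le_rpow_of_exponent_le hL1 (by rw [hs_def]; linarith)
    have hq2 : L ^ (2 * β - 2) * L ^ d'' = L ^ s := by
      rw [← Real.rpow_add hL0, hs_def]
    -- the two terms
    have hT1 : β * L ^ (2 * β) * (1 + ∫ y in {y : EuclideanSpace ℝ (Fin 3) | 1 ≤ ‖y‖ ∧ ‖y‖ ≤ L},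
        (‖y‖ ^ 2) ^ (-β) / ‖y‖ * (‖U y‖ ^ 3 + 2 * (|P y| * ‖U y‖))) ≤
        β * (1 + J₁star) * L ^ (2 * β) := by
      have : β * L ^ (2 * β) * (1 + ∫ y in {y : EuclideanSpace ℝ (Fin 3) | 1 ≤ ‖y‖ ∧ ‖y‖ ≤ L},
          (‖y‖ ^ 2) ^ (-β) / ‖y‖ * (‖U y‖ ^ 3 + 2 * (|P y| * ‖U y‖))) ≤
          β * L ^ (2 * β) * (1 + J₁star) :=
        mul_le_mul_of_nonneg_left (by linarith) (mul_nonneg hβ0 hLt)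
      linarith
    have hT2 : L ^ (2 * β) / L ^ 2 * (1 + ∫ y in {y : EuclideanSpace ℝ (Fin 3) | 1 ≤ ‖y‖ ∧
        ‖y‖ ≤ L}, (‖y‖ ^ 2) ^ (-β) * ‖y‖ * (‖U y‖ ^ 3 + 2 * (|P y| * ‖U y‖))) ≤
        (1 + c₂) * L ^ s := by
      rw [hq]
      have hLs : 0 ≤ L ^ (2 * β - 2) := by positivity
      calc L ^ (2 * β - 2) * (1 + ∫ y in {y : EuclideanSpace ℝ (Fin 3) | 1 ≤ ‖y‖ ∧ ‖y‖ ≤ L},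
            (‖y‖ ^ 2) ^ (-β) * ‖y‖ * (‖U y‖ ^ 3 + 2 * (|P y| * ‖U y‖)))
          ≤ L ^ (2 * β - 2) * (1 + c₂ * L ^ d'') :=
            mul_le_mul_of_nonneg_left (by linarith) hLs
        _ = L ^ (2 * β - 2) + c₂ * (L ^ (2 * β - 2) * L ^ d'') := by ring
        _ ≤ L ^ s + c₂ * L ^ s := by rw [hq2]; linarith
        _ = (1 + c₂) * L ^ s := by ring
    calc ∫ y in {y : EuclideanSpace ℝ (Fin 3) | L ^ 2 / 16 ≤ ‖y‖ ^ 2 ∧ ‖y‖ ^ 2 ≤ L ^ 2 / 4},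
          ‖U y‖ ^ 2 ≤ _ := h1
      _ ≤ A * (β * (1 + J₁star) * L ^ (2 * β) + (1 + c₂) * L ^ s) :=
          mul_le_mul_of_nonneg_left (add_le_add hT1 hT2) hA0
      _ = A * (β * (1 + J₁star)) * L ^ (2 * β) + A * (1 + c₂) * L ^ s := by ring
  rcases eq_or_lt_of_le hβ0 with hz | hpos
  · -- the endpoint `β = 0`: decay of the annular energies, `U ∈ L²`
    have hs0 : s < 0 := by rw [← hz] at hst; simpa using hst
    have hann'' : ∀ L : ℝ, 4 ≤ L →
        ∫ y in {y : EuclideanSpace ℝ (Fin 3) | L ^ 2 / 16 ≤ ‖y‖ ^ 2 ∧ ‖y‖ ^ 2 ≤ L ^ 2 / 4},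
          ‖U y‖ ^ 2 ≤ A * (1 + c₂) * L ^ s := by
      intro L hL
      have := hann' L hL
      rw [← hz] at this
      simpa using this
    obtain ⟨C, hC0, hC⟩ := energyGrowth_of_annular_neg hUc hs0 (by positivity) hann''
    refine ⟨C, hC0, fun R hR => ?_⟩
    rw [ht, ← hz, mul_zero, Real.rpow_zero, mul_one]
    exact hC R hR
  · -- `β > 0`: growth `L^{2β}`
    have h2β : 0 < 2 * β := by linarith
    have hann'' : ∀ L : ℝ, 4 ≤ L →
        ∫ y in {y : EuclideanSpace ℝ (Fin 3) | L ^ 2 / 16 ≤ ‖y‖ ^ 2 ∧ ‖y‖ ^ 2 ≤ L ^ 2 / 4},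
          ‖U y‖ ^ 2 ≤ (A * (β * (1 + J₁star)) + A * (1 + c₂)) * L ^ (2 * β) := by
      intro L hL
      have hL1 : (1 : ℝ) ≤ L := by linarith
      have h1 := hann' L hL
      have h2 : L ^ s ≤ L ^ (2 * β) := Real.rpow_le_rpow_of_exponent_le hL1 hst.le
      have h3 : A * (1 + c₂) * L ^ s ≤ A * (1 + c₂) * L ^ (2 * β) :=
        mul_le_mul_of_nonneg_left h2 (by positivity)
      linarith
    obtain ⟨C, hC0, hC⟩ := energyGrowth_of_annular_pos hUc h2β (by positivity) hann''
    refine ⟨C, hC0, fun R hR => ?_⟩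
    rw [ht]
    exact hC R hR

/-- **Intermediate round.** If the local flux grows like `ρ^b` with `3 − 2α ≤ b − 1`, the annular
bound gives `∫_{|y|<R}|U|² ≤ C R^{b − 1/2}` (`R ≥ 1`): CS13's "Otherwise, we obtain
`≲ L^{N−2α} + L^{β_pα_p−1}`", with the `ε = 1/2` shift that also covers the logarithmic case
"`≲ L^{N−2α} log₂ L`". [cite: ChaeShvydkoy2013, §3.2.2–3.2.3 (bootstrap rounds)] -/
private theorem energyGrowth_window_step {α A C_f b : ℝ}
    {U : EuclideanSpace ℝ (Fin 3) → EuclideanSpace ℝ (Fin 3)} {P : EuclideanSpace ℝ (Fin 3) → ℝ}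
    (hUc : Continuous U) (hα2 : α ≤ 3 / 2) (hA0 : 0 ≤ A) (hCf : 0 ≤ C_f)
    (hb : 3 - 2 * α ≤ b - 1)
    (hfi : ∀ R : ℝ, IntegrableOn (fun y => ‖U y‖ ^ 3 + 2 * (|P y| * ‖U y‖))
      (closedBall (0 : EuclideanSpace ℝ (Fin 3)) R) volume)
    (hann : ∀ L : ℝ, 4 ≤ L →
      ∫ y in {y : EuclideanSpace ℝ (Fin 3) | L ^ 2 / 16 ≤ ‖y‖ ^ 2 ∧ ‖y‖ ^ 2 ≤ L ^ 2 / 4},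
          ‖U y‖ ^ 2 ≤
        A * ((3 / 2 - α) * L ^ (3 - 2 * α) *
            (1 + ∫ y in {y : EuclideanSpace ℝ (Fin 3) | 1 ≤ ‖y‖ ∧ ‖y‖ ≤ L},
              (‖y‖ ^ 2) ^ (-(3 / 2 - α)) / ‖y‖ * (‖U y‖ ^ 3 + 2 * (|P y| * ‖U y‖))) +
          L ^ (3 - 2 * α) / L ^ 2 *
            (1 + ∫ y in {y : EuclideanSpace ℝ (Fin 3) | 1 ≤ ‖y‖ ∧ ‖y‖ ≤ L},
              (‖y‖ ^ 2) ^ (-(3 / 2 - α)) * ‖y‖ * (‖U y‖ ^ 3 + 2 * (|P y| * ‖U y‖)))))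
    (hflux : ∀ ρ : ℝ, 1 ≤ ρ →
      ∫ y in closedBall (0 : EuclideanSpace ℝ (Fin 3)) ρ, (‖U y‖ ^ 3 + 2 * (|P y| * ‖U y‖)) ≤
        C_f * ρ ^ b) :
    ∃ C : ℝ, 0 ≤ C ∧ ∀ R : ℝ, 1 ≤ R →
      ∫ y in ball (0 : EuclideanSpace ℝ (Fin 3)) R, ‖U y‖ ^ 2 ≤ C * R ^ (b - 1 / 2) := by
  set β : ℝ := 3 / 2 - α with hβ_def
  have hβ0 : 0 ≤ β := by rw [hβ_def]; linarith
  have ht : 3 - 2 * α = 2 * β := by rw [hβ_def]; ring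
  rw [ht] at hb
  have hf0 : ∀ y : EuclideanSpace ℝ (Fin 3), 0 ≤ ‖U y‖ ^ 3 + 2 * (|P y| * ‖U y‖) := fun y => by
    positivity
  have hw1 := fun R => (integrableOn_weight_trunc (β := β) hfi R).1
  have hw2 := fun R => (integrableOn_weight_trunc (β := β) hfi R).2
  have hw10 : ∀ y : EuclideanSpace ℝ (Fin 3), 1 ≤ ‖y‖ →
      0 ≤ (‖y‖ ^ 2) ^ (-β) / ‖y‖ * (‖U y‖ ^ 3 + 2 * (|P y| * ‖U y‖)) := fun y _ => by
    have := hf0 y; positivity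
  have hw20 : ∀ y : EuclideanSpace ℝ (Fin 3), 1 ≤ ‖y‖ →
      0 ≤ (‖y‖ ^ 2) ^ (-β) * ‖y‖ * (‖U y‖ ^ 3 + 2 * (|P y| * ‖U y‖)) := fun y _ => by
    have := hf0 y; positivity
  have hann1 := fun ρ (hρ : 1 ≤ ρ) => shell_bound_weight_inv hβ0 hf0 hfi hflux hρ
  have hann2 := fun ρ (hρ : 1 ≤ ρ) => shell_bound_weight_mul hβ0 hf0 hfi hflux hρ
  have hC₁ : 0 ≤ C_f * 2 ^ b := by positivity
  have hC₂ : 0 ≤ 2 * C_f * 2 ^ b := by positivity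
  -- `J₁ ≲ L^{d₁ + 1/2}`, `d₁ = b − 2β − 1 ≥ 0`
  set d₁' : ℝ := b - 2 * β - 1 + 1 / 2 with hd₁'
  have hd₁'0 : 0 < d₁' := by rw [hd₁']; linarith
  set c₁ : ℝ := C_f * 2 ^ b * ((2 : ℝ) ^ d₁' / ((2 : ℝ) ^ d₁' - 1)) with hc₁
  have hc₁0 : 0 ≤ c₁ := mul_nonneg hC₁ (div_nonneg (by positivity)
    (by linarith [Real.one_lt_rpow (by norm_num : (1 : ℝ) < 2) hd₁'0]))
  have hJ1 : ∀ L : ℝ, 1 ≤ L → ∫ y in {y : EuclideanSpace ℝ (Fin 3) | 1 ≤ ‖y‖ ∧ ‖y‖ ≤ L},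
      (‖y‖ ^ 2) ^ (-β) / ‖y‖ * (‖U y‖ ^ 3 + 2 * (|P y| * ‖U y‖)) ≤ c₁ * L ^ d₁' :=
    fun L hL => setIntegral_trunc_le_rpow hC₁ hw10 hw1 hann1 hd₁'0 (by rw [hd₁']; linarith) hL
  -- `J₂ ≲ L^{d₂}`, `d₂ = b − 2β + 1 > 0`
  set d₂ : ℝ := b - 2 * β + 1 with hd₂
  have hd₂0 : 0 < d₂ := by rw [hd₂]; linarith
  set c₂ : ℝ := 2 * C_f * 2 ^ b * ((2 : ℝ) ^ d₂ / ((2 : ℝ) ^ d₂ - 1)) with hc₂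
  have hc₂0 : 0 ≤ c₂ := mul_nonneg hC₂ (div_nonneg (by positivity)
    (by linarith [Real.one_lt_rpow (by norm_num : (1 : ℝ) < 2) hd₂0]))
  have hJ2 : ∀ L : ℝ, 1 ≤ L → ∫ y in {y : EuclideanSpace ℝ (Fin 3) | 1 ≤ ‖y‖ ∧ ‖y‖ ≤ L},
      (‖y‖ ^ 2) ^ (-β) * ‖y‖ * (‖U y‖ ^ 3 + 2 * (|P y| * ‖U y‖)) ≤ c₂ * L ^ d₂ :=
    fun L hL => setIntegral_trunc_le_rpow hC₂ hw20 hw2 hann2 hd₂0 le_rfl hL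
  -- annular energies `≲ L^{b − 1/2}`
  have he0 : 0 < b - 1 / 2 := by linarith
  have hann' : ∀ L : ℝ, 4 ≤ L →
      ∫ y in {y : EuclideanSpace ℝ (Fin 3) | L ^ 2 / 16 ≤ ‖y‖ ^ 2 ∧ ‖y‖ ^ 2 ≤ L ^ 2 / 4},
        ‖U y‖ ^ 2 ≤ A * (β + β * c₁ + 1 + c₂) * L ^ (b - 1 / 2) := by
    intro L hL
    have hL1 : (1 : ℝ) ≤ L := by linarith
    have hL0 : 0 < L := by linarith
    have h1 := hann L hL
    rw [ht] at h1
    have hJ1L := hJ1 L hL1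
    have hJ2L := hJ2 L hL1
    have hLt : 0 ≤ L ^ (2 * β) := by positivity
    have hLe : 0 ≤ L ^ (b - 1 / 2) := by positivity
    have hq : L ^ (2 * β) / L ^ 2 = L ^ (2 * β - 2) := by
      rw [Real.rpow_sub hL0, Real.rpow_two]
    have hp1 : L ^ (2 * β) ≤ L ^ (b - 1 / 2) :=
      Real.rpow_le_rpow_of_exponent_le hL1 (by linarith)
    have hp2 : L ^ (2 * β) * L ^ d₁' = L ^ (b - 1 / 2) := by
      rw [← Real.rpow_add hL0, hd₁']
      ring_nf
    have hp3 : L ^ (2 * β - 2) ≤ L ^ (b - 1 / 2) :=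
      Real.rpow_le_rpow_of_exponent_le hL1 (by linarith)
    have hp4 : L ^ (2 * β - 2) * L ^ d₂ ≤ L ^ (b - 1 / 2) := by
      rw [← Real.rpow_add hL0, hd₂]
      exact Real.rpow_le_rpow_of_exponent_le hL1 (by linarith)
    have hT1 : β * L ^ (2 * β) * (1 + ∫ y in {y : EuclideanSpace ℝ (Fin 3) | 1 ≤ ‖y‖ ∧ ‖y‖ ≤ L},
        (‖y‖ ^ 2) ^ (-β) / ‖y‖ * (‖U y‖ ^ 3 + 2 * (|P y| * ‖U y‖))) ≤
        (β + β * c₁) * L ^ (b - 1 / 2) := by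
      calc β * L ^ (2 * β) * (1 + ∫ y in {y : EuclideanSpace ℝ (Fin 3) | 1 ≤ ‖y‖ ∧ ‖y‖ ≤ L},
            (‖y‖ ^ 2) ^ (-β) / ‖y‖ * (‖U y‖ ^ 3 + 2 * (|P y| * ‖U y‖)))
          ≤ β * L ^ (2 * β) * (1 + c₁ * L ^ d₁') :=
            mul_le_mul_of_nonneg_left (by linarith) (mul_nonneg hβ0 hLt)
        _ = β * L ^ (2 * β) + β * c₁ * (L ^ (2 * β) * L ^ d₁') := by ring
        _ ≤ β * L ^ (b - 1 / 2) + β * c₁ * L ^ (b - 1 / 2) := by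
            rw [hp2]
            exact add_le_add (mul_le_mul_of_nonneg_left hp1 hβ0) le_rfl
        _ = (β + β * c₁) * L ^ (b - 1 / 2) := by ring
    have hT2 : L ^ (2 * β) / L ^ 2 * (1 + ∫ y in {y : EuclideanSpace ℝ (Fin 3) | 1 ≤ ‖y‖ ∧
        ‖y‖ ≤ L}, (‖y‖ ^ 2) ^ (-β) * ‖y‖ * (‖U y‖ ^ 3 + 2 * (|P y| * ‖U y‖))) ≤
        (1 + c₂) * L ^ (b - 1 / 2) := by
      rw [hq]
      have hLs : 0 ≤ L ^ (2 * β - 2) := by positivity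
      calc L ^ (2 * β - 2) * (1 + ∫ y in {y : EuclideanSpace ℝ (Fin 3) | 1 ≤ ‖y‖ ∧ ‖y‖ ≤ L},
            (‖y‖ ^ 2) ^ (-β) * ‖y‖ * (‖U y‖ ^ 3 + 2 * (|P y| * ‖U y‖)))
          ≤ L ^ (2 * β - 2) * (1 + c₂ * L ^ d₂) :=
            mul_le_mul_of_nonneg_left (by linarith) hLs
        _ = L ^ (2 * β - 2) + c₂ * (L ^ (2 * β - 2) * L ^ d₂) := by ring
        _ ≤ L ^ (b - 1 / 2) + c₂ * L ^ (b - 1 / 2) :=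
            add_le_add hp3 (mul_le_mul_of_nonneg_left hp4 hc₂0)
        _ = (1 + c₂) * L ^ (b - 1 / 2) := by ring
    calc ∫ y in {y : EuclideanSpace ℝ (Fin 3) | L ^ 2 / 16 ≤ ‖y‖ ^ 2 ∧ ‖y‖ ^ 2 ≤ L ^ 2 / 4},
          ‖U y‖ ^ 2 ≤ _ := h1
      _ ≤ A * ((β + β * c₁) * L ^ (b - 1 / 2) + (1 + c₂) * L ^ (b - 1 / 2)) :=
          mul_le_mul_of_nonneg_left (add_le_add hT1 hT2) hA0
      _ = A * (β + β * c₁ + 1 + c₂) * L ^ (b - 1 / 2) := by ring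
  exact energyGrowth_of_annular_pos hUc he0 (by positivity) hann'

/-! ## The first flux bound, the exponent sequence, and Corollary 3.4 -/

/-- The flux `|U|³ + 2|P||U|` is in `L^{p/3}` for `U ∈ L^p`, `P ∈ L^{p/2}`, `p ≥ 3` (the tree's
`memLp_flux_of_memLp` with `3 ≤ p` allowed; same proof). [folklore] -/
private theorem memLp_flux_of_three_le {p : ℝ} (hp : 3 ≤ p)
    {U : EuclideanSpace ℝ (Fin 3) → EuclideanSpace ℝ (Fin 3)} {P : EuclideanSpace ℝ (Fin 3) → ℝ}
    (hU : MemLp U (ENNReal.ofReal p) volume) (hP : MemLp P (ENNReal.ofReal (p / 2)) volume) :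
    MemLp (fun y => ‖U y‖ ^ 3 + 2 * (|P y| * ‖U y‖)) (ENNReal.ofReal (p / 3)) volume := by
  have hp0 : 0 < p := by linarith
  have h3 : ENNReal.ofReal p / 3 = ENNReal.ofReal (p / 3) := by
    rw [ENNReal.ofReal_div_of_pos (by norm_num : (0 : ℝ) < 3)]
    norm_num
  have h1 : MemLp (fun y => ‖U y‖ ^ 3) (ENNReal.ofReal (p / 3)) volume := by
    have h := hU.norm_rpow_div (3 : ℝ≥0∞)
    rw [h3] at h
    refine h.congr_norm ?_ (Eventually.of_forall fun y => ?_)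
    · exact (hU.1.norm.aemeasurable.pow_const _).aestronglyMeasurable
    · simp only [ENNReal.toReal_ofNat, Real.norm_eq_abs]
      rw [show (3 : ℝ) = ((3 : ℕ) : ℝ) by norm_num, Real.rpow_natCast]
  haveI : ENNReal.HolderTriple (ENNReal.ofReal (p / 2)) (ENNReal.ofReal p)
      (ENNReal.ofReal (p / 3)) := by
    constructor
    rw [← ENNReal.ofReal_inv_of_pos (by positivity), ← ENNReal.ofReal_inv_of_pos hp0,
      ← ENNReal.ofReal_inv_of_pos (by positivity),
      ← ENNReal.ofReal_add (by positivity) (by positivity)]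
    congr 1
    field_simp
    ring
  have hPabs : MemLp (fun y => |P y|) (ENNReal.ofReal (p / 2)) volume := by
    simpa [Real.norm_eq_abs] using hP.norm
  have h2 : MemLp (fun y => |P y| * ‖U y‖) (ENNReal.ofReal (p / 3)) volume :=
    MemLp.mul' hU.norm hPabs
  exact h1.add (h2.const_mul 2)

/-- **Hölder against `1`, general exponent** (as in the tree's Theorem 3.2 files). [folklore] -/
private theorem setIntegral_le_rpow_mul_measureReal_rpow_aux {r : ℝ} (hr : 1 < r)
    {φ : EuclideanSpace ℝ (Fin 3) → ℝ} {S : Set (EuclideanSpace ℝ (Fin 3))}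
    (hS : volume S ≠ ⊤) (hφ0 : ∀ y, 0 ≤ φ y)
    (hφ : MemLp φ (ENNReal.ofReal r) (volume.restrict S)) :
    ∫ y in S, φ y ≤ (∫ y in S, φ y ^ r) ^ (1 / r) * (volume.real S) ^ (1 - 1 / r) := by
  haveI : IsFiniteMeasure (volume.restrict S) := isFiniteMeasure_restrict.2 hS
  have hpq : Real.HolderConjugate r (Real.conjExponent r) := Real.HolderConjugate.conjExponent hr
  have h := integral_mul_le_Lp_mul_Lq_of_nonneg (μ := volume.restrict S) hpq
    (f := φ) (g := fun _ => (1 : ℝ))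
    (Eventually.of_forall hφ0) (Eventually.of_forall fun _ => zero_le_one) hφ (memLp_const 1)
  have hr0 : r ≠ 0 := by positivity
  have he : 1 / Real.conjExponent r = 1 - 1 / r := by
    have h1 := hpq.inv_add_inv_eq_inv
    rw [inv_one] at h1
    rw [one_div, one_div]
    linarith
  simp only [mul_one, Real.one_rpow, integral_const, smul_eq_mul,
    measureReal_restrict_apply_univ, he] at h
  exact h

/-- **The first local flux bound** (the start of CS13's window bootstrap, "by the Hölder"):
`∫_{|y|≤ρ}(|U|³ + 2|P||U|) ≤ C_f ρ^{3 − 9/p}` for `ρ ≥ 1`, `3 ≤ p` (`p = 3`: the flux is globally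
integrable). [cite: ChaeShvydkoy2013, §3.2.2 ("and by the Hölder, ≲ L^{N−2α} + L^{β_p}")] -/
private theorem flux_growth_first {p : ℝ} (hp : 3 ≤ p)
    {U : EuclideanSpace ℝ (Fin 3) → EuclideanSpace ℝ (Fin 3)} {P : EuclideanSpace ℝ (Fin 3) → ℝ}
    (hU : MemLp U (ENNReal.ofReal p) volume) (hP : MemLp P (ENNReal.ofReal (p / 2)) volume) :
    ∃ C_f : ℝ, 0 ≤ C_f ∧ ∀ ρ : ℝ, 1 ≤ ρ →
      ∫ y in closedBall (0 : EuclideanSpace ℝ (Fin 3)) ρ, (‖U y‖ ^ 3 + 2 * (|P y| * ‖U y‖)) ≤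
        C_f * ρ ^ (3 - 9 / p) := by
  have hp0 : 0 < p := by linarith
  have hf0 : ∀ y : EuclideanSpace ℝ (Fin 3), 0 ≤ ‖U y‖ ^ 3 + 2 * (|P y| * ‖U y‖) := fun y => by
    positivity
  have hfLp := memLp_flux_of_three_le hp hU hP
  rcases eq_or_lt_of_le hp with h3 | hp3
  · -- `p = 3`: the flux is integrable
    subst h3
    have hfi : Integrable (fun y => ‖U y‖ ^ 3 + 2 * (|P y| * ‖U y‖))
        (volume : Measure (EuclideanSpace ℝ (Fin 3))) := by
      rw [← memLp_one_iff_integrable]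
      simpa using hfLp
    refine ⟨∫ y, (‖U y‖ ^ 3 + 2 * (|P y| * ‖U y‖)), integral_nonneg hf0, fun ρ hρ => ?_⟩
    rw [show (3 : ℝ) - 9 / 3 = 0 by norm_num, Real.rpow_zero, mul_one]
    exact setIntegral_le_integral hfi (Eventually.of_forall hf0)
  · -- `p > 3`: Hölder against `1`
    have hr : 1 < p / 3 := by
      rw [lt_div_iff₀ (by norm_num : (0 : ℝ) < 3)]
      linarith
    have hfi : Integrable (fun y => (‖U y‖ ^ 3 + 2 * (|P y| * ‖U y‖)) ^ (p / 3))
        (volume : Measure (EuclideanSpace ℝ (Fin 3))) := by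
      have h := hfLp.integrable_norm_rpow (by simp; linarith) ENNReal.ofReal_ne_top
      rw [ENNReal.toReal_ofReal (by positivity)] at h
      exact h.congr (Eventually.of_forall fun y => by
        simp [Real.norm_eq_abs, abs_of_nonneg (hf0 y)])
    set F : ℝ := (∫ y, (‖U y‖ ^ 3 + 2 * (|P y| * ‖U y‖)) ^ (p / 3)) ^ (3 / p) with hF_def
    have hF0 : 0 ≤ F := Real.rpow_nonneg (integral_nonneg fun y => Real.rpow_nonneg (hf0 y) _) _
    set v₁ : ℝ := (volume : Measure (EuclideanSpace ℝ (Fin 3))).real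
      (closedBall (0 : EuclideanSpace ℝ (Fin 3)) 1) with hv₁_def
    have hv₁ : 0 ≤ v₁ := measureReal_nonneg
    have h13 : 0 ≤ 1 - 3 / p := by
      rw [sub_nonneg, div_le_one hp0]
      linarith
    refine ⟨F * v₁ ^ (1 - 3 / p), by positivity, fun ρ hρ => ?_⟩
    have hρ0 : 0 < ρ := by linarith
    have hvol : (volume : Measure (EuclideanSpace ℝ (Fin 3))).real
        (closedBall (0 : EuclideanSpace ℝ (Fin 3)) ρ) = v₁ * ρ ^ 3 := by
      rw [hv₁_def, Measure.addHaar_real_closedBall' volume (0 : EuclideanSpace ℝ (Fin 3)) hρ0.le,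
        finrank_euclideanSpace_fin, mul_comm]
    have h1 := setIntegral_le_rpow_mul_measureReal_rpow_aux hr
      (S := closedBall (0 : EuclideanSpace ℝ (Fin 3)) ρ) measure_closedBall_lt_top.ne hf0
      (hfLp.restrict _)
    rw [hvol, show 1 / (p / 3) = 3 / p by rw [one_div, inv_div]] at h1
    refine h1.trans ?_
    have hI : ∫ y in closedBall (0 : EuclideanSpace ℝ (Fin 3)) ρ,
        (‖U y‖ ^ 3 + 2 * (|P y| * ‖U y‖)) ^ (p / 3) ≤
        ∫ y, (‖U y‖ ^ 3 + 2 * (|P y| * ‖U y‖)) ^ (p / 3) :=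
      setIntegral_le_integral hfi (Eventually.of_forall fun y => Real.rpow_nonneg (hf0 y) _)
    have hpow : (v₁ * ρ ^ 3) ^ (1 - 3 / p) = v₁ ^ (1 - 3 / p) * ρ ^ (3 - 9 / p) := by
      rw [Real.mul_rpow hv₁ (by positivity), show (ρ ^ 3 : ℝ) = ρ ^ (3 : ℝ) by
        rw [show (3 : ℝ) = (3 : ℕ) by norm_num, Real.rpow_natCast], ← Real.rpow_mul hρ0.le]
      congr 1
      congr 1
      field_simp
      ring
    rw [hpow]
    calc (∫ y in closedBall (0 : EuclideanSpace ℝ (Fin 3)) ρ,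
          (‖U y‖ ^ 3 + 2 * (|P y| * ‖U y‖)) ^ (p / 3)) ^ (3 / p) * (v₁ ^ (1 - 3 / p) * ρ ^ (3 - 9 / p))
        ≤ F * (v₁ ^ (1 - 3 / p) * ρ ^ (3 - 9 / p)) :=
          mul_le_mul_of_nonneg_right (Real.rpow_le_rpow (integral_nonneg fun y =>
            Real.rpow_nonneg (hf0 y) _) hI (by positivity)) (by positivity)
      _ = F * v₁ ^ (1 - 3 / p) * ρ ^ (3 - 9 / p) := by ring

/-- The exponent sequence `c₀ = b₀`, `c_{n+1} = κ(c_n − 1/2)` (`κ ≤ 1`) eventually satisfies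
`c_n − 1 < t` (any `t ≥ 0`). [folklore] -/
private theorem exists_iterate_lt (b₀ κ t : ℝ) (hκ : κ ≤ 1) (ht : 0 ≤ t) :
    ∃ n : ℕ, (fun x : ℝ => κ * (x - 1 / 2))^[n] b₀ - 1 < t := by
  by_contra hcon
  push Not at hcon
  have hle : ∀ n : ℕ, (fun x : ℝ => κ * (x - 1 / 2))^[n] b₀ ≤ b₀ - n / 2 := by
    intro n
    induction n with
    | zero => simp
    | succ n ih =>
      rw [Function.iterate_succ_apply']
      have h0 := hcon n
      have h1 : 1 ≤ (fun x : ℝ => κ * (x - 1 / 2))^[n] b₀ := by linarith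
      push_cast
      nlinarith
  obtain ⟨n, hn⟩ := exists_nat_gt (2 * b₀)
  have h1 := hle n
  have h2 := hcon n
  linarith

/-- **Chae–Shvydkoy 2013, Corollary 3.4, every `3 ≤ p < ∞`, window `3/p < α ≤ 3/2`.** A
stationary self-similar Euler profile with exponent `γ = 1/(α+1)`, `U ∈ L^p` (`C¹`), associated
pressure `P ∈ L^{p/2}` (weak Poisson equation), has `∫_{|y|<R}|U|² ≤ C R^{3−2α}` for `R ≥ 1`:
the annular inequality `annular_energy_le_weightedFlux`, the first flux bound `ρ^{3−9/p}`,
intermediate rounds `b ↦ α_p(b − 1/2)` through the flux lemma `setIntegral_flux_le_of_growth`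
while `b − 1 ≥ 3 − 2α`, then the final round (at `p = 3` the flux is integrable and the final
round applies at once). [cite: ChaeShvydkoy2013, §3.2.3 Cor. 3.4] -/
theorem IsSelfSimilarEulerProfile.energyGrowth_of_memLp_of_window {α p : ℝ}
    {U : EuclideanSpace ℝ (Fin 3) → EuclideanSpace ℝ (Fin 3)} {P : EuclideanSpace ℝ (Fin 3) → ℝ}
    (h : IsSelfSimilarEulerProfile (1 / (α + 1)) 0 U P) (hp : 3 ≤ p) (hαp : 3 / p < α)
    (hα2 : α ≤ 3 / 2) (hU : MemLp U (ENNReal.ofReal p) volume)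
    (hP : MemLp P (ENNReal.ofReal (p / 2)) volume)
    (hPoisson : ∀ φ : EuclideanSpace ℝ (Fin 3) → ℝ, ContDiff ℝ (⊤ : ℕ∞) φ → HasCompactSupport φ →
      ∫ x, P x * (Δ φ) x = -∫ x, fderiv ℝ (fderiv ℝ φ) x (U x) (U x)) :
    ∃ C : ℝ, 0 ≤ C ∧ ∀ R : ℝ, 1 ≤ R →
      ∫ y in ball (0 : EuclideanSpace ℝ (Fin 3)) R, ‖U y‖ ^ 2 ≤ C * R ^ (3 - 2 * α) := by
  have hp0 : 0 < p := by linarith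
  have hα0 : 0 < α := lt_trans (by positivity) hαp
  have hα : -1 < α := by linarith
  have ht0 : 0 ≤ 3 - 2 * α := by linarith
  have hUc : Continuous U := h.contDiff_velocity.continuous
  have hPloc : LocallyIntegrable P volume :=
    hP.locallyIntegrable (by
      rw [← ENNReal.ofReal_one]
      exact ENNReal.ofReal_le_ofReal (by linarith))
  have hfi : ∀ R : ℝ, IntegrableOn (fun y => ‖U y‖ ^ 3 + 2 * (|P y| * ‖U y‖))
      (closedBall (0 : EuclideanSpace ℝ (Fin 3)) R) volume := by
    intro R
    have hK : IsCompact (closedBall (0 : EuclideanSpace ℝ (Fin 3)) R) := isCompact_closedBall _ _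
    have hPi : IntegrableOn (fun y => |P y|) (closedBall (0 : EuclideanSpace ℝ (Fin 3)) R)
        volume := (hPloc.integrableOn_isCompact hK).norm
    exact ((hUc.norm.pow 3).continuousOn.integrableOn_compact hK).add
      ((hPi.mul_continuousOn hUc.norm.continuousOn hK).const_mul 2)
  obtain ⟨A, hA0, hann⟩ := h.annular_energy_le_weightedFlux hα hα2 hPloc
  obtain ⟨C₀, hC₀0, hflux₀⟩ := flux_growth_first hp hU hP
  rcases eq_or_lt_of_le hp with h3 | hp3
  · -- `p = 3`: one (final) round
    subst h3
    exact energyGrowth_window_final hUc hα0 hα2 hA0 hC₀0 (by norm_num) (by norm_num; linarith)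
      hfi hann hflux₀
  · -- `p > 3`: the bootstrap
    have hp2 : 0 < p - 2 := by linarith
    set κ : ℝ := (p - 3) / (p - 2) with hκ
    have hκ0 : 0 ≤ κ := div_nonneg (by linarith) hp2.le
    have hκ1 : κ ≤ 1 := by
      rw [hκ, div_le_one hp2]
      linarith
    set b₀ : ℝ := 3 - 9 / p with hb₀
    have hb₀0 : 0 ≤ b₀ := by
      rw [hb₀, sub_nonneg, div_le_iff₀ hp0]
      linarith
    have hb₀le : b₀ - 1 / 2 ≤ 3 - 6 / p := by
      rw [hb₀]
      have : (0 : ℝ) < 3 / p := by positivity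
      have e : (9 : ℝ) / p = 6 / p + 3 / p := by ring
      linarith
    set c : ℕ → ℝ := fun n => (fun x : ℝ => κ * (x - 1 / 2))^[n] b₀ with hc_def
    have hc0 : c 0 = b₀ := by simp [hc_def]
    have hcsucc : ∀ n, c (n + 1) = κ * (c n - 1 / 2) := fun n => by
      simp only [hc_def]
      rw [Function.iterate_succ_apply']
    have hex : ∃ n, c n - 1 < 3 - 2 * α := exists_iterate_lt b₀ κ (3 - 2 * α) hκ1 ht0
    classical
    set N : ℕ := Nat.find hex with hN
    have hNlt : c N - 1 < 3 - 2 * α := Nat.find_spec hex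
    have hbefore : ∀ k, k < N → 3 - 2 * α ≤ c k - 1 := fun k hk =>
      not_lt.1 (Nat.find_min hex hk)
    -- invariant along the rounds: `0 ≤ c k ≤ b₀` and local flux growth `ρ^{c k}`
    have hinv : ∀ k, k ≤ N → 0 ≤ c k ∧ c k ≤ b₀ ∧ ∃ C_f : ℝ, 0 ≤ C_f ∧ ∀ ρ : ℝ, 1 ≤ ρ →
        ∫ y in closedBall (0 : EuclideanSpace ℝ (Fin 3)) ρ, (‖U y‖ ^ 3 + 2 * (|P y| * ‖U y‖)) ≤
          C_f * ρ ^ (c k) := by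
      intro k
      induction k with
      | zero =>
        intro
        refine ⟨by rw [hc0]; exact hb₀0, by rw [hc0], C₀, hC₀0, fun ρ hρ => ?_⟩
        rw [hc0, hb₀]
        exact hflux₀ ρ hρ
      | succ k ih =>
        intro hk
        have hk' : k < N := Nat.lt_of_succ_le hk
        obtain ⟨hck0, hckle, C_f, hCf0, hCf⟩ := ih hk'.le
        have hround := hbefore k hk'
        have hck1 : 1 ≤ c k := by linarith
        -- intermediate round: energy growth `R^{c k − 1/2}`
        obtain ⟨C, hC0, hC⟩ := energyGrowth_window_step hUc hα2 hA0 hCf0 hround hfi hann hCf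
        -- the flux lemma of Theorem 3.2: flux growth `ρ^{κ (c k − 1/2)}`
        have ha : c k - 1 / 2 ≤ 3 - 6 / p := by linarith
        obtain ⟨C', hC'0, hC'⟩ := setIntegral_flux_le_of_growth hp3 hC0 ha hUc hU hP hPoisson hC
        refine ⟨by rw [hcsucc]; exact mul_nonneg hκ0 (by linarith), ?_, C', hC'0, fun ρ hρ => ?_⟩
        · rw [hcsucc]
          nlinarith
        · rw [hcsucc, hκ]
          exact hC' ρ hρ
    obtain ⟨hcN0, -, C_f, hCf0, hCf⟩ := hinv N le_rfl
    exact energyGrowth_window_final hUc hα0 hα2 hA0 hCf0 hcN0 hNlt hfi hann hCf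

/-- **DISCHARGE of the named fact `chaeShvydkoy2013_energy_growth`** (Chae–Shvydkoy 2013,
Corollary 3.4, `N = 3`, every `3 ≤ p < ∞`, window `3/p < α ≤ 3/2`).
[cite: ChaeShvydkoy2013, §3.2.3 Cor. 3.4] -/
theorem chaeShvydkoy2013_energy_growth_holds : chaeShvydkoy2013_energy_growth := by
  intro α p U P h3 htop hαp hα2 hprof hU hP hPoisson
  have hpr : 3 ≤ p.toReal := by
    have := (ENNReal.toReal_le_toReal (by norm_num : (3 : ℝ≥0∞) ≠ ⊤) htop).2 h3
    simpa using this
  have hU' : MemLp U (ENNReal.ofReal p.toReal) volume := by rwa [ENNReal.ofReal_toReal htop]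
  have hP' : MemLp P (ENNReal.ofReal (p.toReal / 2)) volume := by
    rw [ENNReal.ofReal_div_of_pos two_pos, ENNReal.ofReal_toReal htop]
    simpa using hP
  obtain ⟨C, -, hC⟩ := hprof.energyGrowth_of_memLp_of_window hpr hαp hα2 hU' hP' hPoisson
  exact ⟨C, 1, one_pos, fun L hL => hC L hL⟩

/-- Corollary 3.4 in the fact's own binder shape, as a theorem.
[cite: ChaeShvydkoy2013, §3.2.3 Cor. 3.4] -/
theorem chaeShvydkoy2013_energy_growth_thm (α : ℝ) (p : ℝ≥0∞)
    (U : EuclideanSpace ℝ (Fin 3) → EuclideanSpace ℝ (Fin 3)) (P : EuclideanSpace ℝ (Fin 3) → ℝ)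
    (h3 : 3 ≤ p) (htop : p ≠ ∞) (hαp : 3 / p.toReal < α) (hα2 : α ≤ 3 / 2)
    (hprof : IsSelfSimilarEulerProfile (1 / (α + 1)) 0 U P)
    (hU : MemLp U p volume) (hP : MemLp P (p / 2) volume)
    (hPoisson : ∀ φ : EuclideanSpace ℝ (Fin 3) → ℝ, ContDiff ℝ (⊤ : ℕ∞) φ → HasCompactSupport φ →
      ∫ x, P x * (Δ φ) x = -∫ x, fderiv ℝ (fderiv ℝ φ) x (U x) (U x)) :
    ∃ C L₀ : ℝ, 0 < L₀ ∧ ∀ L : ℝ, L₀ ≤ L →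
      ∫ y in ball (0 : EuclideanSpace ℝ (Fin 3)) L, ‖U y‖ ^ 2 ≤ C * L ^ (3 - 2 * α) :=
  chaeShvydkoy2013_energy_growth_holds α p U P h3 htop hαp hα2 hprof hU hP hPoisson

/-- **The endpoint `α = 3/2` (`c_l = 2/5`): an `L^p` profile with associated pressure is in `L²`**
("In particular, if `v ∈ L^p`, `p ≥ 3`, and `α = N/2`, then automatically `v ∈ L²`", CS13 §1).
[cite: ChaeShvydkoy2013, §1 and §3.2.3 Cor. 3.4 (α = N/2)] -/
theorem IsSelfSimilarEulerProfile.ballEnergy_bounded_of_memLp_of_three_halves {p : ℝ}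
    {U : EuclideanSpace ℝ (Fin 3) → EuclideanSpace ℝ (Fin 3)} {P : EuclideanSpace ℝ (Fin 3) → ℝ}
    (h : IsSelfSimilarEulerProfile (1 / ((3 / 2 : ℝ) + 1)) 0 U P) (hp : 3 ≤ p)
    (hU : MemLp U (ENNReal.ofReal p) volume) (hP : MemLp P (ENNReal.ofReal (p / 2)) volume)
    (hPoisson : ∀ φ : EuclideanSpace ℝ (Fin 3) → ℝ, ContDiff ℝ (⊤ : ℕ∞) φ → HasCompactSupport φ →
      ∫ x, P x * (Δ φ) x = -∫ x, fderiv ℝ (fderiv ℝ φ) x (U x) (U x)) :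
    ∃ C : ℝ, ∀ R : ℝ, 1 ≤ R → ∫ y in ball (0 : EuclideanSpace ℝ (Fin 3)) R, ‖U y‖ ^ 2 ≤ C := by
  have hp0 : 0 < p := by linarith
  have hαp : 3 / p < (3 / 2 : ℝ) := by
    rw [div_lt_iff₀ hp0]
    linarith
  obtain ⟨C, -, hC⟩ := h.energyGrowth_of_memLp_of_window hp hαp le_rfl hU hP hPoisson
  refine ⟨C, fun R hR => ?_⟩
  have := hC R hR
  rwa [show (3 : ℝ) - 2 * (3 / 2) = 0 by norm_num, Real.rpow_zero, mul_one] at this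

end Literature.Analysis.FluidPDE
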